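import Summits.QuantumFields.BalabanUV.Beta.FP.TowerKernelLawNamedC
import Summits.QuantumFields.BalabanUV.Beta.FP.StepRecursionFeedNestedComp
import Summits.QuantumFields.BalabanUV.Beta.FP.TowerHSideRowsClosing
import Summits.QuantumFields.BalabanUV.Beta.FP.TowerNSlotLetters
import Summits.QuantumFields.BalabanUV.Beta.FP.TowerH2Letters
import Summits.QuantumFields.BalabanUV.Beta.FP.TowerH2LettersG
import Summits.QuantumFields.BalabanUV.Beta.FP.TorusCompositeNestedJetsSym
import Summits.QuantumFields.BalabanUV.Beta.CombWilsonT2EvenPairRow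
import Summits.QuantumFields.BalabanUV.Beta.FP.TorusWJunctionOfNLeg
import Summits.QuantumFields.BalabanUV.Beta.FP.TowerK2bStoreyBridge
import Summits.QuantumFields.BalabanUV.Beta.FP.KernelPeriodisationFibWoundLetter
import Summits.QuantumFields.BalabanUV.Beta.FP.NestedConstraintScaling
import Summits.QuantumFields.BalabanUV.Beta.FP.TowerHN2RowMixedDoor
import Summits.QuantumFields.BalabanUV.Beta.FP.TowerDoorSlotLetters
import Summits.QuantumFields.BalabanUV.Beta.FP.EndJunctionSecondMomentG
import Summits.QuantumFields.BalabanUV.Beta.FP.TowerFTransportRowSymG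
import Summits.QuantumFields.BalabanUV.Beta.FP.TowerQN1ReadersChartGeneric
import Summits.QuantumFields.BalabanUV.Beta.FP.TowerHLinkRowsChartGeneric
import Summits.QuantumFields.BalabanUV.Beta.FP.TowerK1RowTopColumnChartGeneric
import Summits.QuantumFields.BalabanUV.Beta.FP.TowerLamSourceDisplayChartGeneric
import Summits.QuantumFields.BalabanUV.Beta.FP.TowerN1RowsFamilyChartGeneric
import Summits.QuantumFields.BalabanUV.Beta.FP.TowerHN2ReadersChartGeneric
import Summits.QuantumFields.BalabanUV.Beta.FP.TowerHN2ReadersChartGenericG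
import Summits.QuantumFields.BalabanUV.Beta.FP.TowerHN2DoorChartGenericG
import Summits.QuantumFields.BalabanUV.Beta.NVertexChartSymLetters
import Summits.QuantumFields.BalabanUV.Beta.NVertexColumnK1RowSym
import Summits.QuantumFields.BalabanUV.Beta.NVertexEvenChartGenericBorderG
import Summits.QuantumFields.BalabanUV.Beta.NVertexLamFoldTorusChartGeneric
import Summits.QuantumFields.BalabanUV.Beta.NVertexChartGenericObjectsG
import Summits.QuantumFields.BalabanUV.Beta.FP.CompositeOneShotJetDataSymG

/-!
# `BalabanUV.Beta.FP.StepRecursionSymEndNamedG` — road «FP», **S-END-G: S-END (`FP.StepRecursionSymEndNamed`, ✓ p828649 v1.1b) UNDER σ_T** = referee #169's KEY «S-END-G LANDED (`hM₂` AND `hWΔT` ↦ `compMixG` even half;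
# docstring cites A2-LOCATE 547291ba ∕ j333652; key word `tabsCompG`)», director-ym g23 [DIRYM-G23-INBOX-9] (2026-08-31T17:00:37Z) rulings (1) «located repair σ_T `tabsComp ↦ tabsCompG`» and
# «`a2` = S-END-G (road, #169 key)»; director-ym g24 [DIRYM-G24-INBOX-2] (2026-08-31T17:56:16Z) ∕ [DIRYM-G24-INBOX-3] (17:59:34Z): LANDING ORDER OF RECORD (an2's six row twins ✓ p829989
# p830106 p830184 p830251 p830347 p830418 → road FP g74 R-C16-G ✓ p830543 → R-C17-G → R-C18-G → R-C19-G → THIS FILE → referee #169).  WHAT CHANGED AGAINST S-END (token map, nothing else): the N-system's second-order carrier `WNA ↦ WNAG` (F-L8-G `NVertexChartGenericObjectsG.WNAG`, over the GRADED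
# slotted tables `CompositeOneShotJetsGraded.tabsCompG`, `mixFF := CompositeMixedTableGraded.compMixG`), S-L1's `WNs ↦ WNsG` (an2 L-3a ✓ p829147), the L-composite `JcSymL ↦ JcSymLG` (S-L3b-G ✓ p829586),
# every displayed table word `tabsComp ↦ tabsCompG` — so the located rows **`a2` ∧ `hM₂`** (E-FP-73-1 = E-AN2-94-1: A2.md f2ed6054 ∕ A2-LOCATE.md 547291ba ∕ A2-ROOT c0c1d1ff, jobs j333652 ∕ j333808 ∕
# j333890: the UNGRADED even half of `M2Of … (tabsComp …).mixFF = compMix` fails `a2` at every μ at (4,3), `‖(1−Π)·LHS‖∕‖LHS‖ ∈ [0.024, 1.003]`; ENTRYWISE ≤ 5.4e−13 at μ0 once `M₂` is the even half of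
# the GRADED table `compMixG`, free fit (−Lc⁸, −1, 54, 108, 54)) now DISPLAY `M2Of 3 (Lc^(n+2)) (tabsCompG (n+2) …).mixFF` = `compMixG` (`tabsCompG_mixFF`, `rfl`) — THE LOCATED WORD — and so does
# `hWΔT`'s mixed defect; and the crux **`hlawL ↦ hlawLG`** (E-FP-73-3 = E-AN2-94-3, director rider #2: the kernel law whose by-value check closes at (2,3) — S2 1.46e−12, D₁⁺ 1.86e−12,
# `prestab/sym2/STARTED-SYM2` 3b67f41a §Q6, `prestab/tel2/span/STARTED-SYM2-FOLD` c8551995 — is the GRADED tower's Nˢʸᵐ(G); the ungraded typed target R «does not close in either convention»,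
# `SPAN-SYM2.addendum4` 56c550e9).  Suppliers re-pointed BY NAME to their σ_T twins: row F-L8-G `WNAG`, row #12-G…#15-G `NVertexEvenChartGenericBorderG`∕`CarrierG`∕`CarrierPeriodisedG`∕`TorusG`
# (`vertexFamilies_VNA_WNAG`; the chart-only `translate_inv_A'` stays row #12's `NVertexEvenChartGenericBorder.translate_inv_A'`, which an2's landed twin `open`s rather than restates), #19-G `NVertexChartSymReadings3G`; road R-C1-G `TowerFTransportRowSymG` (`d1Tel_JcS_nestedG_of_fedW_pairingCoclosed_wStep`), R-C15-G
# `TowerHN2ReadersChartGenericG` (`hJΛ2_of_mixedLock_of_mixedGauge_doorAG`; the table-free `hJΛ2'_of_wardRow_doorA` stays R-C15's), R-C16-G…R-C19-G `TowerEvenReadersChartGenericG`∕`TowerEvenPeriodicityChartGenericG`∕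
# `TowerHN2LocksChartGenericG`∕`TowerHN2DoorChartGenericG`, annex-G `EndJunctionSecondMomentG.TshotOf_JcSymLG_succ`; every other supplier (R-C2…R-C14, rows #1–#11, #16–#18, S-L1's `ANs`∕`VNs`,
# row F-L8's `VNA`) is table-free ∕ grading-blind and is consumed UNCHANGED.  PROOF = S-END's VERBATIM under the token map (generator `HOME/b2b-balaban-beta-d1-p3/g73/xread-sigmaT/sigmaT_send.py`;
# kernel-clean as one 12-module unit before filing: `g73/cert/CONCAT-FULL12.NOT-TO-FILE.lean` 090f208a43ad98c6, rc 0 ∣ 0 warnings ∣ 0 sorry ∣ axioms {propext, Classical.choice, Quot.sound} ∣ 197.7 s).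

HEADLINE. [folklore] **`d1Tel_JcSymLG_ctr_namedI : (S-END's 120 binders under σ_T) → D1Tel Lc (JsB12CombShSym hLc N (symTablesAn1S2 3 Lc cΛ) cΛ cB) (JcSymLG (Roots.ctr Lc) Pn hLc N cΛ cB)`** —
`D1Tel` at ROOT M‴'s literal and the GRADED L-composite, as the graded (b) END S-L3b-G `StepRecursionSymEndG.d1Tel_LG_of_hlawLG'` (✓ p829586), at v10's GRANULARITY.
STATURE SENTENCE (director-ym g24 [DIRYM-G24-INBOX-2] (3), UNCHANGED from S-END's and carried here verbatim): **CONDITIONAL on `hlawLG` (THE CRUX, open by name; by-value support (G) at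
(2,3) and now (4,3) n = 0) and on v10's displayed sym rows; re-typings, 0 new mathematics; count sentence 0∕4 + riders #1 #2.**
HONEST STATUS: CONDITIONAL on its displayed binders exactly as S-END is — `hlawLG` (THE CRUX, open by name; by-value support ONLY, at the GRADED chart (G): (2,3) SYM2 (ii) S2 1.46e−12 ∕
D₁⁺ 1.86e−12; (4,3) n = 0 the graded row `a2` by J2C LEG B1 kit j344339 (rc 0; deposit `run/shared/lean/ttrl/bal-j2c/j344339/`, `b1_check.txt` 1a222f68): r_sec ≤ 5.3e−13 (μ0) ∕ ≤ 8.0e−14 (μ3)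
GRADED, the UNGRADED display re-opens r_sec ∈ [1.5e−2, 1.16], free fit (−6561, −1, 54, 108, 54) = the road's FP-84 integers — booked by [DIRYM-G24-INBOX-2] (2) as the by-value confirmation of
exactly this graded row; Engine float64 at ONE lattice, ZERO binder weight), v10's sym rows at the graded record (RIDER #1 = E-AN2-94-1 NOTE b155a; RIDER #2 = E-AN2-94-3 NOTE b155b, director g23);
(γ)∕(r3) located rows: NONE of record at the graded display (the one located row of S-END, `a2` ∧ `hM₂`, is located-REPAIRED by the token map per A2-LOCATE 547291ba); 0∕4 row-D1 binders;
`D1Tel`∕`D1Rep` AT THE RECORD untouched; (T-ID)∕(C1) off the table; nothing of Bałaban's asserted, valued or discharged (ABSOLUTE RULE); 0 estimates; not [B], not (d); NO «(L-v10) complete»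
sentence; NOT SDF, NOT D1, NEVER «G-an2-4 closed», NOT BetaPertH, NOT continuum, NOT Clay; the Yang–Mills mass gap is NOT proved.
COUNT SENTENCE (c3)∕(r5): «0∕4; `D1Tel` at `JcSymLG` MODULO `hlawLG` MODULO v10's sym rows (graded)» + RIDERS #1 #2.

HONEST DEPENDENCY (page 1, mandatory): continuum YM on T⁴ ⇐ BetaPertH ∧ nine spine estimates (0/9 proved); BetaPertH ⇐ (D1) ∧ (D4) ∧ CAP+tail;
G-an2-4 gates asym, D1 and NE2/3/4.  HONEST FRAMING (cell contract, verbatim): «discharging `BetaPertH` makes Bałaban's UV stability UNCONDITIONAL —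
a real constructive-QFT result; it is NOT the continuum limit and NOT the Clay problem.»  ABSOLUTE RULE (cell charter, verbatim): «No internally-minted
statement may enter as a cited fact. Every hypothesis is either kernel-proved in this package or a verbatim quotation of a PUBLISHED theorem with page
reference. The manuscript(s) under audit are NOT citable for their own disputed steps — they are the thing under adjudication; programme-internal
(2001/route/tribunal) claims are never citable.»  Road «FP» OWNER, b2b-balaban-beta-d1-p3 gen 73 (xread) ∕ gen 74 (filing), 2026-08-31 (σ_T; generator `HOME/b2b-balaban-beta-d1-p3/g73/xread-sigmaT/sigmaT.py`; the row's six σ_T modules imported BY NAME from the tree).  No existing file touched.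
-/

noncomputable section

open scoped BigOperators Matrix Topology

namespace Summit.QuantumFields.BalabanUV.Beta.FP.StepRecursionSymEndNamedG

open Matrix Finset Filter  open Literature.Probability.LatticeModels (Torus.proj)  open Literature.MathematicalPhysics.QuantumFieldTheory.Balaban1983to89  open Literature.MathematicalPhysics.QuantumFieldTheory.Balaban1983to89.Beta  open Literature.MathematicalPhysics.QuantumFieldTheory.Balaban1983to89.Beta.Composition (kkt)  open Literature.MathematicalPhysics.QuantumFieldTheory.Balaban1983to89.Beta.CompositionSingular (effForm flucCov minOp minOpL)  open B4TorusKernel.MultiPeriod (translate)  open B5Prop11Plancherel (fine)  open B6Lemma24Torus (pbox mem_pbox)  open AffineAveraging (Site box toSite unitVec)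
open AveragingContoursRooted (ctr ctrOff ctrOff_mem_box)  open OneStepResolventKernel (Fib)  open ExpKernelCalculus (MKer Decays BiLoc VertexFamily VertexFamily₂ shiftK hessKer tadpole)  open BalabanStepJetsSucc (wVH)  open Summit.QuantumFields.BalabanUV.Beta.AxialDressingRooted (axEc)  open Summit.QuantumFields.BalabanUV.Beta.BorderedHessian (stepScale)  open Summit.QuantumFields.BalabanUV.Beta.D1BFx.LogDetSecondVariation (secondVar)  open Summit.QuantumFields.BalabanUV.Beta.FP.KernelPeriodisationFib (Idx perF)  open Summit.QuantumFields.BalabanUV.Beta.SymAveragingHessianCounts (symVhSAt)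
open Summit.QuantumFields.BalabanUV.Beta.SymAveragingMixedJetTables (symVh₂SAt)  open Summit.QuantumFields.BalabanUV.Beta.SymShiftedSpread (bhKStepSh)  open Summit.QuantumFields.BalabanUV.Beta.DshAn1 (Dsh)  open Summit.QuantumFields.BalabanUV.Beta.CombChartStepJets (GcombSh)  open Summit.QuantumFields.BalabanUV.Beta.FP.KernelPeriodisationFibLoc (dper)  open Summit.QuantumFields.BalabanUV.Beta.FP.TorusCombRows (Res)  open Summit.QuantumFields.BalabanUV.Beta.FP.TorusGaugeCovariance (tgrad tdelta)  open Summit.QuantumFields.BalabanUV.Beta.FP.TorusCompositeObjects (towerTorus NParam combF bigP towerGen)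
open Summit.QuantumFields.BalabanUV.Beta.FP.TorusCompositeObjectsG (QSym compRowsSym nestedSliceSym)  open Summit.QuantumFields.BalabanUV.Beta.FP.TorusCompositeFP (evalN)  open Summit.QuantumFields.BalabanUV.Beta.GAN24.FineReadoutCauchyFrame (toSite_mem_range)  open Summit.QuantumFields.BalabanUV.Beta.FP.TorusCompositeSliceG (det_nestedSliceSym_mul_towerGen_ne_zero)  open Summit.QuantumFields.BalabanUV.Beta.FP.TorusCompositeSliceOneShotG (torus_hTW_oneShot_towerSym)  open Summit.QuantumFields.BalabanUV.Beta.FP.TorusCompositeCovarianceSym (compRowsSym_mul_towerGen_succ QtopSym_mul_smul_tgrad_res)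
open Summit.QuantumFields.BalabanUV.Beta.FP.TorusCompositeCovarianceOneSym (compIns₁Sym)  open Summit.QuantumFields.BalabanUV.Beta.FP.TorusCompositeCovarianceTwoPolarSym (compIns₂₂Sym)  open Summit.QuantumFields.BalabanUV.Beta.FP.TorusCompositeCovarianceOneRowsSym (torus_c1_towerSym torus_d1_towerSym)  open Summit.QuantumFields.BalabanUV.Beta.FP.TorusCompositeCovarianceTwoRowsSym (torus_d2_towerSym)  open Summit.QuantumFields.BalabanUV.Beta.FP.TorusCompositeRowsDirectionalSym (Q11f_lin Q21f_lin Q12f_lin_left Q12f_lin_right Q22f_lin_left Q22f_lin_right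
  torus_c2_towerSym_polar)
open Summit.QuantumFields.BalabanUV.Beta.FP.NestedStepLawTorusInstance (dvd_fine)  open Summit.QuantumFields.BalabanUV.Beta.FP.PackedLegCombSym (kkt_mul_inv_combSym packedLeg_combSym_eq perF_rules_combSym lattice_letters_combSym)  open Summit.QuantumFields.BalabanUV.Beta.FP.TowerKernelLawSymB (hessKer_law_tower_sym)  open Summit.QuantumFields.BalabanUV.Beta.FP.TowerUTopClosedSym (nestedColumn_linear)  open Summit.QuantumFields.BalabanUV.Beta.FP.TowerUTopClosedSymB (torus_uTop_towerSym_closed)  open DressedMomentNormalisation (EKer dressedEntry)  open OneStepKernelFamily (TshotOf TbalOf D1Tel)  open HessianTelescopingKKT (wStep)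
open Summit.QuantumFields.BalabanUV.Beta.SymSecondOrderTablesAn1 (symTablesAn1S2)  open Summit.QuantumFields.BalabanUV.Beta.CombChartJointEnd (JsB12CombShSym)  open Summit.QuantumFields.BalabanUV.Beta.CompositeOneShotJetData (Roots Pins)  open Summit.QuantumFields.BalabanUV.Beta.FP.TorusGaugeCovarianceCoarse (coarsePt)  open Summit.QuantumFields.BalabanUV.Beta.FP.NestedStepLawTorusInstance (coarseSlot_injective coarseSlot_range)
open Summit.QuantumFields.BalabanUV.Beta.FP.TowerKernelLawNamedC (hessKer_law_tower_namedC)  open Summit.QuantumFields.BalabanUV.Beta.FP.TowerHSideRowsClosing (H1f_linear H1f_transpose a1_row)  open InterLevelTransport (SLam)  open StepJetData (wilsonA)  open Summit.QuantumFields.BalabanUV.Beta.SymAveragingHessianCounts (symHessFFAt symLinKerAt)  open Summit.QuantumFields.BalabanUV.Beta.BorderedHessian (bhKStepAt)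
open Summit.QuantumFields.BalabanUV.Beta.FP.TorusCompositeCompanionSumG (compSumSym)  open Summit.QuantumFields.BalabanUV.Beta.FP.TorusCompositeCompanionFamilyG (onTowerFamily)
open Summit.QuantumFields.BalabanUV.Beta.TameKernelCalculus (trK)  open Summit.QuantumFields.BalabanUV.Beta.BorderedHessian (sgnK)  open Summit.QuantumFields.BalabanUV.Beta.GAN24.SecondOrderCarrierParity (vertexFamily₂_evenHalf_of_swap)
open Summit.QuantumFields.BalabanUV.Beta.FP.TowerNSlotLetters (towerSlot_injective towerSlot_range Xbf_linear_of_pin)  open Summit.QuantumFields.BalabanUV.Beta.FP.TowerH2Letters (H2f_linear_left H2f_linear_right H2f_half_symm_eq)  open Summit.QuantumFields.BalabanUV.Beta.FP.TowerH2LettersG (H2f_transpose)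
open Summit.QuantumFields.BalabanUV.Beta.FP.TowerHLinkRows (cf_summable)  open Summit.QuantumFields.BalabanUV.Beta.FP.TowerHLinkRowsLower (kappa_row kappa_top w_top)  open Summit.QuantumFields.BalabanUV.Beta.FP.TorusCompositeNestedJetsSym (nestedRowsSym_eq_compRowsSym nestedQ₁Sym_eq_smul_compIns₁Sym nestedQ₂Sym_symm_eq_smul_compIns₂₂Sym)  open Summit.QuantumFields.BalabanUV.Beta.FP.TorusCompositeCovariance (itRoot)
open Summit.QuantumFields.BalabanUV.Beta.CompositeVertexKernelRec (compLinKer)  open Summit.QuantumFields.BalabanUV.Beta.AxialDressingRooted (one_le_of_neZero)  open Summit.QuantumFields.BalabanUV.Beta.CompositeOneShotJetsGraded (tabsCompG)  open Summit.QuantumFields.BalabanUV.Beta.FP.TorusGaugeCovariancePairing (wrapPt wrapPt_of_mem)  open Summit.QuantumFields.BalabanUV.Beta.NVertexLamCorePeriodised (towerTorus_fine_apply_eq)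
open Summit.QuantumFields.BalabanUV.Beta.CombWilsonT2EvenPairRow (torus_T2evenPair_pureGauge_snd_fun)  open WilsonVertex2Sym (wsym22)  open Summit.QuantumFields.BalabanUV.Beta.FP.TowerK2bStoreyBridge (wardRow_of_defect sum_smul_defect_indicator)  open Summit.QuantumFields.BalabanUV.Beta.FP.TorusWJunctionOfNLeg (hv_single_apply_eq_of_NLeg_sym)  open Summit.QuantumFields.BalabanUV.Beta.FP.TorusCompositeObjects (bigRoot bigRatio towerEquiv)  open Summit.QuantumFields.BalabanUV.Beta.FP.TorusCompositeUnimodular (towerEvalC)  open BalabanStepJets (lamCoeffOf)  open OneStepResolventKernel (KInv)  open WilsonBiStencil (wilsonW₂)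
open BalabanStepW2 (M2Of)  open Summit.QuantumFields.BalabanUV.Beta.FP.KernelPeriodisationFib (perF_scaleK_apply)  open Summit.QuantumFields.BalabanUV.Beta.FP.TowerSigmaLegLetters (perF_dper_scaleK_apply shiftK_scaleK submatrix_ff_perF_dper_fibScale submatrix_perF_dper_fibScale_of_inr trace_perF_scaleK_mul_perF_dper_scaleK abs_fibSigma_le abs_fibSigma'_le one_le_prod_stepScale map_smul_of_lin lin_comp_smul lin_of_lin_comp_smul)
open Literature.MathematicalPhysics.QuantumFieldTheory.Balaban1983to89.Beta.HessKerRate (scaleK hessKer_scaleK decays_scaleK biLoc_scaleK)  open Summit.QuantumFields.BalabanUV.Beta.FP.NestedConstraintScaling (fibreScale_mul_inv)  open Summit.QuantumFields.BalabanUV.Beta.FP.TowerQN2RowCopies (towerTorus_fine_apply)  open Summit.QuantumFields.BalabanUV.Beta.FP.KernelPeriodisationFibWoundLetter (winding_letter_evenHalf_of_swap)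
open Summit.QuantumFields.BalabanUV.Beta.FP.TowerDoorSlotLetters (perF_dper_evenWound_add_wound perF_dper_wound_eq_zero_of_inr_left perF_dper_wound_eq_zero_of_inr_right submatrix_perF_dper_wound_eq_zero_of_inr winding_evenWound_add_wound hessKer_evenHalf_add_apply)
open Summit.QuantumFields.BalabanUV.Beta.FP.SecondOrderTableEvenPart (loc_of_biLoc)  open KernelWard (biLoc_add)  open OneStepResolventKernel (biLoc_mono)  open DecimatedMomentSummable (AbsMoment₂)
open Summit.QuantumFields.BalabanUV.Beta.FP.CompositeOneShotJetDataSym (ANs VNs spr_ANs decays_ANs)  open Summit.QuantumFields.BalabanUV.Beta.FP.CompositeOneShotJetDataSymG (WNsG)  open Summit.QuantumFields.BalabanUV.Beta.FP.StepRecursionSymEnd (ΨL hΨsL)  open Summit.QuantumFields.BalabanUV.Beta.FP.StepRecursionSymEndG (JcSymLG)  open Summit.QuantumFields.BalabanUV.Beta.FP.EndJunctionSecondMomentG (TshotOf_JcSymLG_succ)  open Summit.QuantumFields.BalabanUV.Beta.NVertexChartGenericObjects (VNA)  open Summit.QuantumFields.BalabanUV.Beta.NVertexChartGenericObjectsG 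(WNAG)
open Summit.QuantumFields.BalabanUV.Beta.FP.TowerFTransportRowSymG (d1Tel_JcS_nestedG_of_fedW_pairingCoclosed_wStep)  open Summit.QuantumFields.BalabanUV.Beta.FP.TowerN1ReadersChartGeneric (hb_rescale_of_sigmaA)  open Summit.QuantumFields.BalabanUV.Beta.FP.TowerQN1ReadersChartGeneric (hQN1_family_of_road_dataA submatrix_perF_dper_VNA_of_cVH)  open Summit.QuantumFields.BalabanUV.Beta.FP.TowerHLinkRowsChartGeneric (hlink_rowA)
open Summit.QuantumFields.BalabanUV.Beta.FP.TowerK1RowTopColumnChartGeneric (K1_row_topA)  open Summit.QuantumFields.BalabanUV.Beta.FP.TowerLamSourceDisplayChartGeneric (hΛS_of_road_dataA)  open Summit.QuantumFields.BalabanUV.Beta.FP.TowerN1RowsFamilyChartGeneric.Family (hHN1_family_of_road_dataA)  open Summit.QuantumFields.BalabanUV.Beta.FP.TowerHN2ReadersChartGeneric.MixedDoor (hJΛ2'_of_wardRow_doorA)  open Summit.QuantumFields.BalabanUV.Beta.FP.TowerHN2ReadersChartGenericG.MixedDoor (hJΛ2_of_mixedLock_of_mixedGauge_doorAG)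
open Summit.QuantumFields.BalabanUV.Beta.FP.TowerEvenReadersChartGenericG.EvenJets (WN_swapA)  open Summit.QuantumFields.BalabanUV.Beta.FP.TowerEvenReadersChartGenericG.CB (submatrix_perF_dper_woundEven_of_cBA)  open Summit.QuantumFields.BalabanUV.Beta.FP.TowerEvenReadersChartGenericG.WoundRows (hWNm_rows_woundA hWNt_rows_woundA)  open Summit.QuantumFields.BalabanUV.Beta.FP.TowerEvenPeriodicityChartGenericG (hQN2_family_of_lockA)
open Summit.QuantumFields.BalabanUV.Beta.FP.TowerHN2DoorChartGenericG (hHN2_family_of_locks_of_junctions_doorA)  open Summit.QuantumFields.BalabanUV.Beta.NVertexChartSymLetters (shiftK_ANs_sym trK_ANs_sym)  open Summit.QuantumFields.BalabanUV.Beta.NVertexColumnK1RowSym (curvAdj_curv_colH_ANs ANs_inr_inr_smul)  open Summit.QuantumFields.BalabanUV.Beta.NVertexSectorsChartGeneric (perF_dper_VNA_apply_of_inr_inr perF_dper_VNA_inl_apply_of_inr)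
open Summit.QuantumFields.BalabanUV.Beta.NVertexEvenChartGenericBorder (translate_inv_A')  open Summit.QuantumFields.BalabanUV.Beta.NVertexEvenChartGenericBorderG (vertexFamilies_VNA_WNAG)  open Summit.QuantumFields.BalabanUV.Beta.NVertexLamFoldTorusChartGeneric (sum_perF_A_mul_periodised_cf_eq_tower)

variable {Lc : ℕ} [NeZero Lc]
set_option maxHeartbeats 800000 in
set_option synthInstance.maxSize 1024 in
/-- [folklore] **S-END: v10's END WRAPPER AT THE L-CHART** — v10 `d1Tel_JcComp_ctr_namedI` under `AN ↦ ANs R Ψ̂ˢ`, `VN∕WN ↦ VNA∕WNAG … (ANs …)`, `JcComp ↦ JcSymLG`: from v10's 120 DISPLAYED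
binders (pins [P], locks [L], the one-shot KKT sockets [K] of the N- and F-systems, the jets as functions, the storey data, the door `𝒲Δ` with (T2) `hWΔT`, the F∕G family letters, the
CONTENT rows `hF₁ htr hG hT0 hT1`, the pairing letters (U)(C)(R)(X)) — read the (R4) triples in the module docstring: every displayed row of content is «OPEN by name ∕ individually UNTESTED
at the sym chart, jointly consistent with SYM2 (ii) ✓ at (2,3), zero weight ∕ our object»; (γ) located-false rows: ONE — `a2` ∧ `hM₂` (module docstring, E-FP-73-1) — to `D1Tel Lc (JsB12CombShSym …) (JcSymLG (Roots.ctr Lc) Pn hLc N cΛ cB)`.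
Inside: `TowerKernelLawNamedC` at the σ-conjugated L-chart returns `hessKer (ANs (n+1)) (VNA (n+1)) (WNAG (n+1) + 𝒲Δ (n+1)) = hessKer F + hessKer G` — R-C1's `hlawΔ` — and R-C1
`d1Tel_JcS_nestedG_of_fedW_pairingCoclosed_wStep` closes at `Jc := JcSymLG` (`hJc1 := rfl`, `hN := TshotOf_JcSymLG_succ`).  COUNT: «0∕4; `D1Tel` at `JcSymLG` MODULO `hlawL` MODULO v10's sym rows». -/
theorem d1Tel_JcSymLG_ctr_namedI (hLc : Odd Lc) (N : ℕ) [NeZero N] (hN : 2 ≤ N) (cΛ cB : ℝ) (Pn : Pins)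
    -- the coarse box sequence (any growing one) and END-Comp's F ∕ G systems, storey-indexed
    (Mc : ℕ → (Fin (3 + 1) → ℕ)) [∀ B μ, NeZero (Mc B μ)] (hMc : ∀ K : ℕ, ∀ᶠ B in atTop, ∀ i, K ≤ Mc B i) (AF : ℕ → MKer (3 + 1) (Fib 3)) (𝒱F : ℕ → Fin (3 + 1) → (Fin (3 + 1) → ℤ) → MKer (3 + 1) (Fib 3))
    (𝒲F : ℕ → Fin (3 + 1) → (Fin (3 + 1) → ℤ) → Fin (3 + 1) → (Fin (3 + 1) → ℤ) → MKer (3 + 1) (Fib 3)) (𝒱G : ℕ → Fin (3 + 1) → (Fin (3 + 1) → ℤ) → MKer (3 + 1) (Fib 3)) (𝒲G : ℕ → Fin (3 + 1) → (Fin (3 + 1) → ℤ) → Fin (3 + 1) → (Fin (3 + 1) → ℤ) → MKer (3 + 1) (Fib 3))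
    (𝒲bF 𝒲bG : ℕ → ℕ → Fin (3 + 1) → (Fin (3 + 1) → ℤ) → Fin (3 + 1) → (Fin (3 + 1) → ℤ) → MKer (3 + 1) (Fib 3)) {H₀ : ∀ n : ℕ, ∀ B : ℕ, Matrix (↥(pbox (towerTorus Lc (fine Lc (Mc B)) (n + 1))) × Fin (3 + 1)) (↥(pbox (towerTorus Lc (fine Lc (Mc B)) (n + 1))) × Fin (3 + 1)) ℝ}
    {Q₁₀ : ∀ n : ℕ, ∀ B : ℕ, Matrix (↥(pbox (fine Lc (Mc B))) × Fin (3 + 1)) (↥(pbox (towerTorus Lc (fine Lc (Mc B)) (n + 1))) × Fin (3 + 1)) ℝ}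
    {τ₁ : ∀ n : ℕ, ∀ B : ℕ, Matrix (NParam Lc (fine Lc (fine Lc (Mc B))) (fun k => (fun _ : ℕ => ctrOff (3 + 1) Lc) (k + 1)) n) (↥(pbox (towerTorus Lc (fine Lc (Mc B)) (n + 1))) × Fin (3 + 1)) ℝ}
    (hH₀ : ∀ n : ℕ, ∀ B : ℕ, ((H₀ n) B) = (perF (towerTorus Lc (fine Lc (Mc B)) (n + 1)) (bhKStepSh 3 Lc (Dsh Lc) ((n + 1 - (n + 1))))).submatrix (fun b : (↥(pbox (towerTorus Lc (fine Lc (Mc B)) (n + 1))) × Fin (3 + 1)) => ((b.1, Sum.inl b.2) : Idx (towerTorus Lc (fine Lc (Mc B)) (n + 1)) (Fib 3))) (fun b : (↥(pbox (towerTorus Lc (fine Lc (Mc B)) (n + 1))) × Fin (3 + 1)) => ((b.1, Sum.inl b.2) : Idx (towerTorus Lc (fine Lc (Mc B)) (n + 1)) (Fib 3))))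
    (hQ₁₀ : ∀ n : ℕ, ∀ B : ℕ, ((Q₁₀ n) B) = compRowsSym Lc (fine Lc (Mc B)) (fun i : ℕ => n + 1 - i) (fun _ : ℕ => ctrOff (3 + 1) Lc) (n + 1))
    (hτ₁ : ∀ n : ℕ, ∀ B : ℕ, ((τ₁ n) B) = bigP Lc (fine Lc (fine Lc (Mc B))) (fun k => (fun _ : ℕ => ctrOff (3 + 1) Lc) (k + 1)) (fun _ => toSite_mem_range (ctrOff_mem_box (d := 3 + 1) (Nat.one_le_iff_ne_zero.mpr (NeZero.ne Lc)))) n)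
    {τ₂ : ∀ n : ℕ, ∀ B : ℕ, Matrix (Res (toSite (ctrOff (3 + 1) Lc)) Lc (fine Lc (Mc B))) (↥(pbox (fine Lc (Mc B))) × Fin (3 + 1)) ℝ} (hτ₂ : ∀ n : ℕ, ∀ B : ℕ, ((τ₂ n) B) = combF Lc (fine Lc (Mc B)) ((fun _ : ℕ => ctrOff (3 + 1) Lc) 0))
    -- the top step's (0.4)-symmetrised averaging rows (level `lev 0`), PINNED in (B)'s slot presentation; its comb-KKT `htop` discharged inside
    {Q₂₀ : ∀ n : ℕ, ∀ B : ℕ, Matrix ((↥(pbox (Mc B)) × Fin (3 + 1))) (↥(pbox (fine Lc (Mc B))) × Fin (3 + 1)) ℝ}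
    (hQ₂₀ : ∀ n : ℕ, ∀ B : ℕ, ((Q₂₀ n) B) = (perF (fine Lc (Mc B)) (bhKStepSh 3 Lc (Dsh Lc) ((n + 1 - 0)))).submatrix (fun a : ((↥(pbox (Mc B)) × Fin (3 + 1))) => ((coarsePt (Mc B) Lc a.1, Sum.inr (a.2)) : Idx (fine Lc (Mc B)) (Fib 3))) (fun b : ↥(pbox (fine Lc (Mc B))) × Fin (3 + 1) => ((b.1, Sum.inl b.2) : Idx (fine Lc (Mc B)) (Fib 3))))
    {W₀ : ∀ n : ℕ, ∀ B : ℕ, Matrix (↥(pbox (towerTorus Lc (fine Lc (Mc B)) (n + 1))) × Fin (3 + 1)) (NParam Lc (fine Lc (Mc B)) (fun _ : ℕ => ctrOff (3 + 1) Lc) (n + 1)) ℝ} (hW₀ : ∀ n : ℕ, ∀ B : ℕ, ((W₀ n) B) = towerGen Lc (fine Lc (Mc B)) (fun _ : ℕ => ctrOff (3 + 1) Lc) (n + 1))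
    {P : ∀ n : ℕ, ∀ B : ℕ, Matrix (NParam Lc (fine Lc (Mc B)) (fun _ : ℕ => ctrOff (3 + 1) Lc) (n + 1)) (↥(pbox (towerTorus Lc (fine Lc (Mc B)) (n + 1))) × Fin (3 + 1)) ℝ}
    (hP : ∀ n : ℕ, ∀ B : ℕ, ((P n) B) = bigP Lc (fine Lc (Mc B)) (fun _ : ℕ => ctrOff (3 + 1) Lc) (fun _ => toSite_mem_range (ctrOff_mem_box (d := 3 + 1) (Nat.one_le_iff_ne_zero.mpr (NeZero.ne Lc)))) (n + 1))
    -- the step constant of the chart transport (#21's `c`), the (COV-m) order-0 image PINNED, the one-shot resolvent words and `𝔔₀` NAMED (#21 VERBATIM)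
    (c : ∀ n : ℕ, ℝ)
    -- v9: THE σ-LETTER `sn n = ∏_{ℓ<n+2} stepScale 3 Lc ℓ` (an2 g72 A-1 ∕ PART 35 `NestedConstraintScaling`: the nested coarse constraint `𝔔₀ = Q₂₀·Q₁₀` is `sn n •` the UNIT-border one, so the one-shot inverse reads the chart
    -- through `σ_n = 1 ⊕ (sn n)⁻¹`); THE PINS `r n` OF THE DIRECTIONS (`hr` VERBATIM; the direction family `hdv` carries the source weight `sn n · r n`); THE SCALAR LOCK ROWS — v9: the BORDER locks `hcVH hcB` at the UNIT pins
    -- (`∏ stepScale` gone: R-D1-g66-1 ∕ SPEC-54 §5 read through `σ_n`), `hcΛ hcE₂ hTW` VERBATIM, the MIXED locks `hcM₂ hLk` (PART 3a ∕ 3b) with the factor `sn n` of the one rescaled slot of the mixed word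
    (sn : ℕ → ℝ) (hsn : ∀ n : ℕ, sn n = ∏ ℓ ∈ range (n + 1 + 1), stepScale 3 Lc ℓ) (r : ∀ n : ℕ, ℝ) (hr : ∀ n : ℕ, (-2 * (c n)) * (r n) = Pn.cE (n + 1 + 1)) (hcVH : ∀ n : ℕ, 2 * Pn.cVH (n + 1 + 1) = -(((Lc : ℝ) ^ (3 + 1)) ^ (n + 1 + 1) * Pn.cE (n + 1 + 1)))
    (hcΛ : ∀ n : ℕ, 2 * Pn.cΛ (n + 1 + 1) = ((Lc : ℝ) ^ (3 + 1)) ^ (n + 1 + 1) * Pn.cE (n + 1 + 1)) (hcB : ∀ n : ℕ, (c n) ^ 2 * (r n) * (r n) * ((box (3 + 1) Lc).card : ℝ) ^ (n + 1 + 1) = -(Pn.cB (n + 1 + 1))) (hcE₂ : ∀ n : ℕ, (Pn.cE (n + 1 + 1)) ^ 2 = Pn.cE₂ (n + 1 + 1))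
    (hTW : ∀ n : ℕ, Pn.T (n + 1 + 1) = (8 * (N : ℝ) ^ 2)⁻¹ • wsym22 N) (cM₂ κ₂ : ∀ n : ℕ, ℝ) (hcM₂ : ∀ n : ℕ, (sn n) * (cM₂ n) * (r n) * (r n) = 1) (hLk : ∀ n : ℕ, (c n) * Pn.cΛ (n + 1 + 1) = (sn n) * (cM₂ n) * (r n) * (κ₂ n))
    {Dbar : ∀ n : ℕ, ∀ B : ℕ, Matrix (↥(pbox (fine Lc (Mc B))) × Fin (3 + 1)) (Res (toSite (ctrOff (3 + 1) Lc)) Lc (fine Lc (Mc B))) ℝ}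
    (hDbar : ∀ n : ℕ, ∀ B : ℕ, ((Dbar n) B) = (∏ i ∈ range (n + 1), (stepScale 3 Lc ((n + 1 - (i + 1))) * ((box (3 + 1) Lc).card : ℝ))) • (tgrad (fine Lc (Mc B))).submatrix (fun a : (↥(pbox (fine Lc (Mc B))) × Fin (3 + 1)) => ((a.1, Sum.inl a.2) : Idx (fine Lc (Mc B)) (Fib 3))) (fun t : (Res (toSite (ctrOff (3 + 1) Lc)) Lc (fine Lc (Mc B))) => (t.1 : ↥(pbox (fine Lc (Mc B))))))
    {Γ : ∀ n : ℕ, ∀ B : ℕ, Matrix (↥(pbox (towerTorus Lc (fine Lc (Mc B)) (n + 1))) × Fin (3 + 1)) (↥(pbox (towerTorus Lc (fine Lc (Mc B)) (n + 1))) × Fin (3 + 1)) ℝ}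
    {I : ∀ n : ℕ, ∀ B : ℕ, Matrix (↥(pbox (towerTorus Lc (fine Lc (Mc B)) (n + 1))) × Fin (3 + 1)) ((↥(pbox (fine Lc (Mc B))) × Fin (3 + 1)) ⊕ (NParam Lc (fine Lc (fine Lc (Mc B))) (fun k => (fun _ : ℕ => ctrOff (3 + 1) Lc) (k + 1)) n)) ℝ}
    {L : ∀ n : ℕ, ∀ B : ℕ, Matrix ((↥(pbox (fine Lc (Mc B))) × Fin (3 + 1)) ⊕ (NParam Lc (fine Lc (fine Lc (Mc B))) (fun k => (fun _ : ℕ => ctrOff (3 + 1) Lc) (k + 1)) n)) (↥(pbox (towerTorus Lc (fine Lc (Mc B)) (n + 1))) × Fin (3 + 1)) ℝ}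
    {S : ∀ n : ℕ, ∀ B : ℕ, Matrix ((↥(pbox (fine Lc (Mc B))) × Fin (3 + 1)) ⊕ (NParam Lc (fine Lc (fine Lc (Mc B))) (fun k => (fun _ : ℕ => ctrOff (3 + 1) Lc) (k + 1)) n)) ((↥(pbox (fine Lc (Mc B))) × Fin (3 + 1)) ⊕ (NParam Lc (fine Lc (fine Lc (Mc B))) (fun k => (fun _ : ℕ => ctrOff (3 + 1) Lc) (k + 1)) n)) ℝ}
    (hΓ : ∀ n : ℕ, ∀ B : ℕ, flucCov ((H₀ n) B) (fromRows ((Q₁₀ n) B) ((τ₁ n) B)) = ((Γ n) B)) (hI : ∀ n : ℕ, ∀ B : ℕ, minOp ((H₀ n) B) (fromRows ((Q₁₀ n) B) ((τ₁ n) B)) = ((I n) B)) (hL : ∀ n : ℕ, ∀ B : ℕ, minOpL ((H₀ n) B) (fromRows ((Q₁₀ n) B) ((τ₁ n) B)) = ((L n) B))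
    (hS : ∀ n : ℕ, ∀ B : ℕ, effForm ((H₀ n) B) (fromRows ((Q₁₀ n) B) ((τ₁ n) B)) = ((S n) B)) {𝔔₀ : ∀ n : ℕ, ∀ B : ℕ, Matrix ((↥(pbox (Mc B)) × Fin (3 + 1))) (↥(pbox (towerTorus Lc (fine Lc (Mc B)) (n + 1))) × Fin (3 + 1)) ℝ} (h𝔔₀ : ∀ n : ℕ, ∀ B : ℕ, ((Q₂₀ n) B) * ((Q₁₀ n) B) = ((𝔔₀ n) B))
    -- the direction module FIXED (R-FP-72, SPEC-45 v1.6 §A row 6): directions = TOP one-shot SOURCE weights `v : κ B → ℝ`; finest-level direction `hv B v` PINNED to the NESTED COMPOSITE COLUMN `I · (minOp S₁₁ [Q₂₀; τ₂] · (v, 0), 0)` (leaf-06 G-5's `h`); tree-gauge ∕ top-generator read-outs `lv Xbf` DISPLAYED (linear; enter the one-shot namings only) — v7.1: `lv` PINNED (`hlve`) to g39 `TorusWJunctionOfNLeg.hv_single_apply_eq_of_NLeg_sym`'s explicit read-out (minus the one-shot big-comb integral of the nested column's tower modes); its linearity and the letter (J-W″) `hJW` are THEOREMS inside — v9: (J-W″)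 reads the σ_n-conjugated chart, `hv(e_a) b = (σAσ)(b♭; fN a) − (Dλ_a)_b = (sn n)⁻¹·AN(b♭; a) − (Dλ_a)_b` (K2L-C G3 at n = 0)
    {hv : ∀ n : ℕ, ∀ B : ℕ, ((↥(pbox (Mc B)) × Fin (3 + 1)) → ℝ) → ((↥(pbox (towerTorus Lc (fine Lc (Mc B)) (n + 1))) × Fin (3 + 1)) → ℝ)} (hhv : ∀ n : ℕ, ∀ B : ℕ, ∀ v, ((hv n) B) v = ((I n) B) *ᵥ Sum.elim (minOp ((S n) B).toBlocks₁₁ (fromRows ((Q₂₀ n) B) ((τ₂ n) B)) *ᵥ Sum.elim v 0) 0)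
    (lv : ∀ n : ℕ, ∀ B : ℕ, ((↥(pbox (Mc B)) × Fin (3 + 1)) → ℝ) → (↥(pbox (towerTorus Lc (fine Lc (Mc B)) (n + 1))) → ℝ))
    (hlve : ∀ n : ℕ, ∀ B : ℕ, ∀ (v : ((↥(pbox (Mc B)) × Fin (3 + 1)) → ℝ)) (s : ↥(pbox (towerTorus Lc (fine Lc (Mc B)) (n + 1)))), ((lv n) B) v s = -(∑ x : Res (bigRoot Lc (fun _ : ℕ => ctrOff (3 + 1) Lc) (n + 1)) (bigRatio Lc (n + 1)) (towerTorus Lc (fine Lc (Mc B)) (n + 1)), (if (x.1 : ↥(pbox (towerTorus Lc (fine Lc (Mc B)) (n + 1)))) = s then (towerEvalC Lc (fine Lc (Mc B)) (fun _ : ℕ => ctrOff (3 + 1) Lc) (fun _ => toSite_mem_range (ctrOff_mem_box (d := 3 + 1) (Nat.one_le_iff_ne_zero.mpr (NeZero.ne Lc)))) (n + 1) *ᵥ ((((P n) B) * ((W₀ n) B))⁻¹ *ᵥ (((P n) B) *ᵥ ((hv n) B) v))) (towerEquiv Lc (fine Lc (Mc B)) (fun _ : ℕ => ctrOff (3 +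 1) Lc) (fun _ => toSite_mem_range (ctrOff_mem_box (d := 3 + 1) (Nat.one_le_iff_ne_zero.mpr (NeZero.ne Lc)))) (n + 1) x) else 0)))
    (Xbf : ∀ n : ℕ, ∀ B : ℕ, ((↥(pbox (Mc B)) × Fin (3 + 1)) → ℝ) → Matrix ((↥(pbox (Mc B)) × Fin (3 + 1))) ((↥(pbox (Mc B)) × Fin (3 + 1))) ℝ)
    (hXbf : ∀ n : ℕ, ∀ B : ℕ, ∀ v, ((Xbf n) B) v = (c n) • Matrix.diagonal (fun a : (↥(pbox (Mc B)) × Fin (3 + 1)) => ((lv n) B) v (itRoot Lc (Mc B) (fun _ : ℕ => ctrOff (3 + 1) Lc) (fun _ => (ctrOff_mem_box (d := 3 + 1) (Nat.one_le_iff_ne_zero.mpr (NeZero.ne Lc)))) (n + 1 + 1) a.1)))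
    -- #21's displayed jets AS FUNCTIONS of the direction: first order linear, second order in two slots (linear in each; the door reads the diagonal)
    (H₁f : ∀ n : ℕ, ∀ B : ℕ, ((↥(pbox (Mc B)) × Fin (3 + 1)) → ℝ) → Matrix (↥(pbox (towerTorus Lc (fine Lc (Mc B)) (n + 1))) × Fin (3 + 1)) (↥(pbox (towerTorus Lc (fine Lc (Mc B)) (n + 1))) × Fin (3 + 1)) ℝ)
    {Q₁₁f : ∀ n : ℕ, ∀ B : ℕ, ((↥(pbox (Mc B)) × Fin (3 + 1)) → ℝ) → Matrix (↥(pbox (fine Lc (Mc B))) × Fin (3 + 1)) (↥(pbox (towerTorus Lc (fine Lc (Mc B)) (n + 1))) × Fin (3 + 1)) ℝ}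
    (hQ₁₁f : ∀ n : ℕ, ∀ B : ℕ, ∀ v, ((Q₁₁f n) B) v = (c n) • compIns₁Sym Lc (fine Lc (Mc B)) (fun i : ℕ => n + 1 - i) (fun _ : ℕ => ctrOff (3 + 1) Lc) (n + 1) (((hv n) B) v))
    {Q₂₁f : ∀ n : ℕ, ∀ B : ℕ, ((↥(pbox (Mc B)) × Fin (3 + 1)) → ℝ) → Matrix ((↥(pbox (Mc B)) × Fin (3 + 1))) (↥(pbox (fine Lc (Mc B))) × Fin (3 + 1)) ℝ}
    (hQ₂₁f : ∀ n : ℕ, ∀ B : ℕ, ∀ v, ((Q₂₁f n) B) v = ∑ a' : (↥(pbox (fine Lc (Mc B))) × Fin (3 + 1)), (((c n) * (((Lc : ℝ) ^ (3 + 1) * stepScale 3 Lc ((n + 1 - 0))) * (∏ i ∈ range (n + 1), (stepScale 3 Lc ((n + 1 - (i + 1))) * ((box (3 + 1) Lc).card : ℝ)))⁻¹)) * (compRowsSym Lc (fine Lc (Mc B)) (fun i : ℕ => n + 1 - i) (fun _ : ℕ => ctrOff (3 + 1) Lc) (n + 1) *ᵥ (((hv n) B) v)) a') • (perF (fine Lc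 (Mc B)) (dper (fine Lc (Mc B)) (symVhSAt (ctr (3 + 1) Lc) 3 Lc rfl a'.2 (a'.1 : Site (3 + 1))))).submatrix (fun k : (↥(pbox (Mc B)) × Fin (3 + 1)) => (((coarsePt (Mc B) Lc k.1, Sum.inr (k.2)) : Idx (fine Lc (Mc B)) (Fib 3)))) (fun b : (↥(pbox (fine Lc (Mc B))) × Fin (3 + 1)) => ((b.1, Sum.inl b.2) : Idx (fine Lc (Mc B)) (Fib 3))))
    (H₂f : ∀ n : ℕ, ∀ B : ℕ, ((↥(pbox (Mc B)) × Fin (3 + 1)) → ℝ) → ((↥(pbox (Mc B)) × Fin (3 + 1)) → ℝ) → Matrix (↥(pbox (towerTorus Lc (fine Lc (Mc B)) (n + 1))) × Fin (3 + 1)) (↥(pbox (towerTorus Lc (fine Lc (Mc B)) (n + 1))) × Fin (3 + 1)) ℝ)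
    -- v7: THE SECOND H-JET PINNED (`FP/TowerH2Letters`): Wilson bi-sector over the table `T̂₂` (letter `hT₂`; its Ward row (J-X₂) is DISCHARGED inside by an2 PART 27 under the table pin `hTW`) + mixed sector
    -- over the multiplier-column family `hm` (letter `hJM`) and the wound even mixed table `ℳ̂₂` (letter `hM₂`); v8: NO (K2b) row — its free-remainder form is inhabited by definition (`TowerK2bStoreyBridge.wardRow_of_defect`); v10: its residual row is DOOR-VALUED — the door letters `𝒲Δ … hWΔT` below ((J-ΛS) DISCHARGED inside, `cΛS := Pn.cΛ (n+2)`)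
    (T₂ : ∀ n : ℕ, ∀ B : ℕ, (↥(pbox (towerTorus Lc (fine Lc (Mc B)) (n + 1))) × Fin (3 + 1)) → (↥(pbox (towerTorus Lc (fine Lc (Mc B)) (n + 1))) × Fin (3 + 1)) → Matrix (↥(pbox (towerTorus Lc (fine Lc (Mc B)) (n + 1))) × Fin (3 + 1)) (↥(pbox (towerTorus Lc (fine Lc (Mc B)) (n + 1))) × Fin (3 + 1)) ℝ)
    (hT₂ : ∀ n : ℕ, ∀ B : ℕ, ∀ b b' : ↥(pbox (towerTorus Lc (fine Lc (Mc B)) (n + 1))) × Fin (3 + 1), ((T₂ n) B) b b' = (1 / 2 : ℝ) • ((perF (towerTorus Lc (fine Lc (Mc B)) (n + 1)) (dper (towerTorus Lc (fine Lc (Mc B)) (n + 1)) (fun X Z i₁ i₂ => ∑' m : Site (3 + 1), ((1 / 2 : ℝ) • (wilsonW₂ 3 (Pn.T (n + 1 + 1)) b.2 (b.1 : Site (3 + 1)) b'.2 (translate (towerTorus Lc (fine Lc (Mc B)) (n + 1)) (b'.1 : Site (3 + 1)) m) + sgnK (trK (wilsonW₂ 3 (Pn.T (n + 1 + 1)) b.2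 (b.1 : Site (3 + 1)) b'.2 (translate (towerTorus Lc (fine Lc (Mc B)) (n + 1)) (b'.1 : Site (3 + 1)) m))))) X Z i₁ i₂))).submatrix (fun b : ↥(pbox (towerTorus Lc (fine Lc (Mc B)) (n + 1))) × Fin (3 + 1) => ((b.1, Sum.inl b.2) : Idx (towerTorus Lc (fine Lc (Mc B)) (n + 1)) (Fib 3))) (fun b : ↥(pbox (towerTorus Lc (fine Lc (Mc B)) (n + 1))) × Fin (3 + 1) => ((b.1, Sum.inl b.2) : Idx (towerTorus Lc (fine Lc (Mc B)) (n + 1)) (Fib 3))) + (perF (towerTorus Lc (fine Lc (Mc B)) (n + 1)) (dper (towerTorus Lc (fine Lc (Mc B)) (n + 1)) (fun X Z i₁ i₂ => ∑' m : Site (3 + 1), ((1 / 2 : ℝ) • (wilsonW₂ 3 (Pn.T (n + 1 + 1)) b'.2 (b'.1 : Site (3 + 1)) b.2 (translate (towerTorus Lc (fine Lc (Mc B)) (n + 1)) (b.1 : Site (3 + 1)) m) + sgnK (trK (wilsonW₂ 3 (Pn.T (n + 1 + 1)) b'.2 (b'.1 : Site (3 + 1)) b.2 (translate (towerTorus Lc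 (fine Lc (Mc B)) (n + 1)) (b.1 : Site (3 + 1)) m))))) X Z i₁ i₂))).submatrix (fun b : ↥(pbox (towerTorus Lc (fine Lc (Mc B)) (n + 1))) × Fin (3 + 1) => ((b.1, Sum.inl b.2) : Idx (towerTorus Lc (fine Lc (Mc B)) (n + 1)) (Fib 3))) (fun b : ↥(pbox (towerTorus Lc (fine Lc (Mc B)) (n + 1))) × Fin (3 + 1) => ((b.1, Sum.inl b.2) : Idx (towerTorus Lc (fine Lc (Mc B)) (n + 1)) (Fib 3)))))
    (hm : ∀ n : ℕ, ∀ B : ℕ, ((↥(pbox (Mc B)) × Fin (3 + 1)) → ℝ) → (↥(pbox (Mc B)) × Fin (3 + 1) → ℝ)) (hml : ∀ n : ℕ, ∀ B : ℕ, ∀ (r : ℝ) (x y : ((↥(pbox (Mc B)) × Fin (3 + 1)) → ℝ)), ((hm n) B) (r • x + y) = r • ((hm n) B) x + ((hm n) B) y)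
    (hJM : ∀ n : ℕ, ∀ B : ℕ, ∀ (a : ↥(pbox (Mc B)) × Fin (3 + 1)) (β : ↥(pbox (Mc B)) × Fin (3 + 1)), ((hm n) B) (Pi.single a 1) β = perF (towerTorus Lc (fine Lc (Mc B)) (n + 1)) (ANs (Roots.ctr Lc) (ΨL (Roots.ctr Lc)) (n + 1)) (wrapPt (towerTorus Lc (fine Lc (Mc B)) (n + 1)) (((Lc ^ (n + 1 + 1) : ℕ) : ℤ) • (β.1 : Site (3 + 1))), Sum.inr β.2) (wrapPt (towerTorus Lc (fine Lc (Mc B)) (n + 1)) (((Lc ^ (n + 1 + 1) : ℕ) : ℤ) • (a.1 : Site (3 + 1))), Sum.inr a.2))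
    (M₂ : ∀ n : ℕ, ∀ B : ℕ, (↥(pbox (towerTorus Lc (fine Lc (Mc B)) (n + 1))) × Fin (3 + 1)) → (↥(pbox (Mc B)) × Fin (3 + 1)) → Matrix (↥(pbox (towerTorus Lc (fine Lc (Mc B)) (n + 1))) × Fin (3 + 1)) (↥(pbox (towerTorus Lc (fine Lc (Mc B)) (n + 1))) × Fin (3 + 1)) ℝ)
    (hM₂ : ∀ n : ℕ, ∀ B : ℕ, ∀ (b : ↥(pbox (towerTorus Lc (fine Lc (Mc B)) (n + 1))) × Fin (3 + 1)) (β : ↥(pbox (Mc B)) × Fin (3 + 1)), ((M₂ n) B) b β = (perF (towerTorus Lc (fine Lc (Mc B)) (n + 1)) (dper (towerTorus Lc (fine Lc (Mc B)) (n + 1)) (fun X Z i₁ i₂ => ∑' m : Site (3 + 1), ((1 / 2 : ℝ) • (M2Of 3 (Lc ^ (n + 1 + 1)) (tabsCompG (n + 1 + 1) (one_le_of_neZero Lc) (Roots.ctr Lc).hr (Pn.cM (n + 1 + 1))).mixFF 0 b.2 (b.1 : Site (3 + 1)) β.2 (translate (Mc B) (β.1 : Site (3 + 1)) m) + sgnK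 (trK (M2Of 3 (Lc ^ (n + 1 + 1)) (tabsCompG (n + 1 + 1) (one_le_of_neZero Lc) (Roots.ctr Lc).hr (Pn.cM (n + 1 + 1))).mixFF 0 b.2 (b.1 : Site (3 + 1)) β.2 (translate (Mc B) (β.1 : Site (3 + 1)) m))))) X Z i₁ i₂))).submatrix (fun b : ↥(pbox (towerTorus Lc (fine Lc (Mc B)) (n + 1))) × Fin (3 + 1) => ((b.1, Sum.inl b.2) : Idx (towerTorus Lc (fine Lc (Mc B)) (n + 1)) (Fib 3))) (fun b : ↥(pbox (towerTorus Lc (fine Lc (Mc B)) (n + 1))) × Fin (3 + 1) => ((b.1, Sum.inl b.2) : Idx (towerTorus Lc (fine Lc (Mc B)) (n + 1)) (Fib 3))))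
    (hH₂f : ∀ n : ℕ, ∀ B : ℕ, ∀ v v', ((H₂f n) B) v v' = (-2 * (c n)) ^ 2 • ∑ b : ↥(pbox (towerTorus Lc (fine Lc (Mc B)) (n + 1))) × Fin (3 + 1), ∑ b' : ↥(pbox (towerTorus Lc (fine Lc (Mc B)) (n + 1))) × Fin (3 + 1), (((hv n) B) v b * ((hv n) B) v' b') • ((T₂ n) B) b b' + (cM₂ n) • ∑ b : ↥(pbox (towerTorus Lc (fine Lc (Mc B)) (n + 1))) × Fin (3 + 1), ∑ β : ↥(pbox (Mc B)) × Fin (3 + 1), (((hv n) B) v b * ((hm n) B) v' β + ((hv n) B) v' b * ((hm n) B) v β) • ((M₂ n) B) b β)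
    {Q₁₂f : ∀ n : ℕ, ∀ B : ℕ, ((↥(pbox (Mc B)) × Fin (3 + 1)) → ℝ) → ((↥(pbox (Mc B)) × Fin (3 + 1)) → ℝ) → Matrix (↥(pbox (fine Lc (Mc B))) × Fin (3 + 1)) (↥(pbox (towerTorus Lc (fine Lc (Mc B)) (n + 1))) × Fin (3 + 1)) ℝ}
    (hQ₁₂f : ∀ n : ℕ, ∀ B : ℕ, ∀ v v', ((Q₁₂f n) B) v v' = (c n) ^ 2 • compIns₂₂Sym Lc (fine Lc (Mc B)) (fun i : ℕ => n + 1 - i) (fun _ : ℕ => ctrOff (3 + 1) Lc) (n + 1) (((hv n) B) v) (((hv n) B) v'))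
    {Q₂₂f : ∀ n : ℕ, ∀ B : ℕ, ((↥(pbox (Mc B)) × Fin (3 + 1)) → ℝ) → ((↥(pbox (Mc B)) × Fin (3 + 1)) → ℝ) → Matrix ((↥(pbox (Mc B)) × Fin (3 + 1))) (↥(pbox (fine Lc (Mc B))) × Fin (3 + 1)) ℝ}
    (hQ₂₂f : ∀ n : ℕ, ∀ B : ℕ, ∀ v v', ((Q₂₂f n) B) v v' = ((Lc : ℝ) ^ (3 + 1) * stepScale 3 Lc ((n + 1 - 0)))⁻¹ • ∑ b : (↥(pbox (fine Lc (Mc B))) × Fin (3 + 1)), ∑ b' : (↥(pbox (fine Lc (Mc B))) × Fin (3 + 1)), ((((c n) * (((Lc : ℝ) ^ (3 + 1) * stepScale 3 Lc ((n + 1 - 0))) * (∏ i ∈ range (n + 1), (stepScale 3 Lc ((n + 1 - (i + 1))) * ((box (3 + 1) Lc).card : ℝ)))⁻¹)) * (compRowsSym Lc (fine Lc (Mc B)) (fun i : ℕ => n + 1 - i) (fun _ : ℕ => ctrOff (3 + 1) Lc) (n + 1) *ᵥ (((hv n) B) v)) b) * (((c n) * (((Lc : ℝ) ^ (3 + 1)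 * stepScale 3 Lc ((n + 1 - 0))) * (∏ i ∈ range (n + 1), (stepScale 3 Lc ((n + 1 - (i + 1))) * ((box (3 + 1) Lc).card : ℝ)))⁻¹)) * (compRowsSym Lc (fine Lc (Mc B)) (fun i : ℕ => n + 1 - i) (fun _ : ℕ => ctrOff (3 + 1) Lc) (n + 1) *ᵥ (((hv n) B) v')) b')) • (perF (fine Lc (Mc B)) (dper (fine Lc (Mc B)) (fun x z a e => ∑' m : Site (3 + 1), (1 / 2 : ℝ) * (symVh₂SAt (ctr (3 + 1) Lc) Lc b.2 (b.1 : Site (3 + 1)) b'.2 (translate (fine Lc (Mc B)) (b'.1 : Site (3 + 1)) m) x z a e + symVh₂SAt (ctr (3 + 1) Lc) Lc b'.2 (translate (fine Lc (Mc B)) (b'.1 : Site (3 + 1)) m) b.2 (b.1 : Site (3 + 1)) x z a e)))).submatrix (fun k : (↥(pbox (Mc B)) × Fin (3 + 1)) => (((coarsePt (Mc B) Lc k.1, Sum.inr (k.2)) : Idx (fine Lc (Mc B)) (Fib 3)))) (fun b : (↥(pbox (fine Lc (Mc B))) × Fin (3 + 1)) => ((b.1, Sum.inl b.2) : Idx (fine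 Lc (Mc B)) (Fib 3))))
    -- #21's composite and one-shot NAMINGS as functions (`h𝔔₁ h𝔔₂ k1 k2 q1 q2`; `X := −(c • diagonal (λ ∘ pr))` at `λ := lv v`; order 2 in two slots)
    (𝔔₁f : ∀ n : ℕ, ∀ B : ℕ, ((↥(pbox (Mc B)) × Fin (3 + 1)) → ℝ) → Matrix ((↥(pbox (Mc B)) × Fin (3 + 1))) (↥(pbox (towerTorus Lc (fine Lc (Mc B)) (n + 1))) × Fin (3 + 1)) ℝ) (h𝔔₁ : ∀ n : ℕ, ∀ B : ℕ, ∀ v, ((Q₂₁f n) B) v * ((Q₁₀ n) B) + ((Q₂₀ n) B) * ((Q₁₁f n) B) v = ((𝔔₁f n) B) v)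
    (𝔔₂f : ∀ n : ℕ, ∀ B : ℕ, ((↥(pbox (Mc B)) × Fin (3 + 1)) → ℝ) → ((↥(pbox (Mc B)) × Fin (3 + 1)) → ℝ) → Matrix ((↥(pbox (Mc B)) × Fin (3 + 1))) (↥(pbox (towerTorus Lc (fine Lc (Mc B)) (n + 1))) × Fin (3 + 1)) ℝ)
    (h𝔔₂ : ∀ n : ℕ, ∀ B : ℕ, ∀ v v', ((Q₂₂f n) B) v v' * ((Q₁₀ n) B) + ((Q₂₁f n) B) v * ((Q₁₁f n) B) v' + (((Q₂₁f n) B) v * ((Q₁₁f n) B) v' + ((Q₂₀ n) B) * ((Q₁₂f n) B) v v') = ((𝔔₂f n) B) v v')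
    (H'₁f : ∀ n : ℕ, ∀ B : ℕ, ((↥(pbox (Mc B)) × Fin (3 + 1)) → ℝ) → Matrix (↥(pbox (towerTorus Lc (fine Lc (Mc B)) (n + 1))) × Fin (3 + 1)) (↥(pbox (towerTorus Lc (fine Lc (Mc B)) (n + 1))) × Fin (3 + 1)) ℝ)
    (hH'₁f : ∀ n : ℕ, ∀ B : ℕ, ∀ v, ((H'₁f n) B) v = -((-((c n) • Matrix.diagonal (fun b : (↥(pbox (towerTorus Lc (fine Lc (Mc B)) (n + 1))) × Fin (3 + 1)) => ((lv n) B) v b.1)))ᵀ * ((H₀ n) B)) + ((H₁f n) B) v + ((H₀ n) B) * (-((c n) • Matrix.diagonal (fun b : (↥(pbox (towerTorus Lc (fine Lc (Mc B)) (n + 1))) × Fin (3 + 1)) => ((lv n) B) v b.1))))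
    (H'₂f : ∀ n : ℕ, ∀ B : ℕ, ((↥(pbox (Mc B)) × Fin (3 + 1)) → ℝ) → ((↥(pbox (Mc B)) × Fin (3 + 1)) → ℝ) → Matrix (↥(pbox (towerTorus Lc (fine Lc (Mc B)) (n + 1))) × Fin (3 + 1)) (↥(pbox (towerTorus Lc (fine Lc (Mc B)) (n + 1))) × Fin (3 + 1)) ℝ)
    (hH'₂f : ∀ n : ℕ, ∀ B : ℕ, ∀ v v', ((H'₂f n) B) v v' = ((-((c n) • Matrix.diagonal (fun b : (↥(pbox (towerTorus Lc (fine Lc (Mc B)) (n + 1))) × Fin (3 + 1)) => ((lv n) B) v b.1))) * (-((c n) • Matrix.diagonal (fun b : (↥(pbox (towerTorus Lc (fine Lc (Mc B)) (n + 1))) × Fin (3 + 1)) => ((lv n) B) v' b.1))))ᵀ * ((H₀ n) B) + (-((-((c n) • Matrix.diagonal (fun b : (↥(pbox (towerTorus Lc (fine Lc (Mc B)) (n + 1))) × Fin (3 + 1)) => ((lv n) B) v b.1)))ᵀ * ((H₁f n) B) v') + -((-((c n) • Matrix.diagonal (fun b : (↥(pbox (towerTorus Lc (fine Lc (Mc B))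 (n + 1))) × Fin (3 + 1)) => ((lv n) B) v b.1)))ᵀ * ((H₀ n) B) * (-((c n) • Matrix.diagonal (fun b : (↥(pbox (towerTorus Lc (fine Lc (Mc B)) (n + 1))) × Fin (3 + 1)) => ((lv n) B) v' b.1))))) + ((-((-((c n) • Matrix.diagonal (fun b : (↥(pbox (towerTorus Lc (fine Lc (Mc B)) (n + 1))) × Fin (3 + 1)) => ((lv n) B) v b.1)))ᵀ * ((H₁f n) B) v') + -((-((c n) • Matrix.diagonal (fun b : (↥(pbox (towerTorus Lc (fine Lc (Mc B)) (n + 1))) × Fin (3 + 1)) => ((lv n) B) v b.1)))ᵀ * ((H₀ n) B) * (-((c n) • Matrix.diagonal (fun b : (↥(pbox (towerTorus Lc (fine Lc (Mc B)) (n + 1))) × Fin (3 + 1)) => ((lv n) B) v' b.1))))) + (((H₂f n) B) v v' + ((H₁f n) B) v * (-((c n) • Matrix.diagonal (fun b : (↥(pbox (towerTorus Lc (fine Lc (Mc B)) (n + 1))) × Fin (3 + 1)) => ((lv n) B) v' b.1))) + (((H₁f n) B) v * (-((c n) • Matrix.diagonal (fun b : (↥(pbox (towerTorus Lc (fine Lc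 (Mc B)) (n + 1))) × Fin (3 + 1)) => ((lv n) B) v' b.1))) + ((H₀ n) B) * ((-((c n) • Matrix.diagonal (fun b : (↥(pbox (towerTorus Lc (fine Lc (Mc B)) (n + 1))) × Fin (3 + 1)) => ((lv n) B) v b.1))) * (-((c n) • Matrix.diagonal (fun b : (↥(pbox (towerTorus Lc (fine Lc (Mc B)) (n + 1))) × Fin (3 + 1)) => ((lv n) B) v' b.1))))))))
    (𝔔'₁f : ∀ n : ℕ, ∀ B : ℕ, ((↥(pbox (Mc B)) × Fin (3 + 1)) → ℝ) → Matrix ((↥(pbox (Mc B)) × Fin (3 + 1))) (↥(pbox (towerTorus Lc (fine Lc (Mc B)) (n + 1))) × Fin (3 + 1)) ℝ)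
    (h𝔔'₁f : ∀ n : ℕ, ∀ B : ℕ, ∀ v, ((𝔔'₁f n) B) v = ((Xbf n) B) v * ((𝔔₀ n) B) + ((𝔔₁f n) B) v + ((𝔔₀ n) B) * (-((c n) • Matrix.diagonal (fun b : (↥(pbox (towerTorus Lc (fine Lc (Mc B)) (n + 1))) × Fin (3 + 1)) => ((lv n) B) v b.1))))
    (𝔔'₂f : ∀ n : ℕ, ∀ B : ℕ, ((↥(pbox (Mc B)) × Fin (3 + 1)) → ℝ) → ((↥(pbox (Mc B)) × Fin (3 + 1)) → ℝ) → Matrix ((↥(pbox (Mc B)) × Fin (3 + 1))) (↥(pbox (towerTorus Lc (fine Lc (Mc B)) (n + 1))) × Fin (3 + 1)) ℝ)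
    (h𝔔'₂f : ∀ n : ℕ, ∀ B : ℕ, ∀ v v', ((𝔔'₂f n) B) v v' = ((Xbf n) B) v * ((Xbf n) B) v' * ((𝔔₀ n) B) + (((Xbf n) B) v * ((𝔔₁f n) B) v' + ((Xbf n) B) v * ((𝔔₀ n) B) * (-((c n) • Matrix.diagonal (fun b : (↥(pbox (towerTorus Lc (fine Lc (Mc B)) (n + 1))) × Fin (3 + 1)) => ((lv n) B) v' b.1)))) + ((((Xbf n) B) v * ((𝔔₁f n) B) v' + ((Xbf n) B) v * ((𝔔₀ n) B) * (-((c n) • Matrix.diagonal (fun b : (↥(pbox (towerTorus Lc (fine Lc (Mc B)) (n + 1))) × Fin (3 + 1)) => ((lv n) B) v' b.1)))) + (((𝔔₂f n) B) v v' + ((𝔔₁f n) B) v * (-((c n) • Matrix.diagonal (fun b : (↥(pbox (towerTorus Lc (fine Lc (Mc B)) (n + 1))) × Fin (3 + 1)) => ((lv n) B) v' b.1))) + (((𝔔₁f n) B) v * (-((c n) • Matrix.diagonal (fun b : (↥(pbox (towerTorus Lc (fine Lc (Mc B)) (n + 1))) × Fin (3 + 1)) => ((lv n) B) v' b.1)))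 + ((𝔔₀ n) B) * ((-((c n) • Matrix.diagonal (fun b : (↥(pbox (towerTorus Lc (fine Lc (Mc B)) (n + 1))) × Fin (3 + 1)) => ((lv n) B) v b.1))) * (-((c n) • Matrix.diagonal (fun b : (↥(pbox (towerTorus Lc (fine Lc (Mc B)) (n + 1))) × Fin (3 + 1)) => ((lv n) B) v' b.1))))))))
    -- #21's generator jets by their closed forms at `h := hv v` (weight `h`), per direction
    (W₁f W₂f : ∀ n : ℕ, ∀ B : ℕ, ((↥(pbox (Mc B)) × Fin (3 + 1)) → ℝ) → Matrix (↥(pbox (towerTorus Lc (fine Lc (Mc B)) (n + 1))) × Fin (3 + 1)) (NParam Lc (fine Lc (Mc B)) (fun _ : ℕ => ctrOff (3 + 1) Lc) (n + 1)) ℝ)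
    (hW₁f : ∀ n : ℕ, ∀ B : ℕ, ∀ v, ((W₁f n) B) v = Matrix.of fun (b : (↥(pbox (towerTorus Lc (fine Lc (Mc B)) (n + 1))) × Fin (3 + 1))) (e : (NParam Lc (fine Lc (Mc B)) (fun _ : ℕ => ctrOff (3 + 1) Lc) (n + 1))) => -((c n) * ((hv n) B) v b * evalN Lc (fine Lc (Mc B)) (fun _ : ℕ => ctrOff (3 + 1) Lc) (n + 1) (fun b' : (↥(pbox (towerTorus Lc (fine Lc (Mc B)) (n + 1))) × Fin (3 + 1)) => (b'.1 : Site (3 + 1)) + unitVec b'.2) b e))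
    (hW₂f : ∀ n : ℕ, ∀ B : ℕ, ∀ v, ((W₂f n) B) v = Matrix.of fun (b : (↥(pbox (towerTorus Lc (fine Lc (Mc B)) (n + 1))) × Fin (3 + 1))) (e : (NParam Lc (fine Lc (Mc B)) (fun _ : ℕ => ctrOff (3 + 1) Lc) (n + 1))) => ((c n) * ((hv n) B) v b) ^ 2 * evalN Lc (fine Lc (Mc B)) (fun _ : ℕ => ctrOff (3 + 1) Lc) (n + 1) (fun b' : (↥(pbox (towerTorus Lc (fine Lc (Mc B)) (n + 1))) × Fin (3 + 1)) => (b'.1 : Site (3 + 1)) + unitVec b'.2) b e)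
    -- the (COV-m) order-1∕2 images PINNED (leaf-02 R-22 ∕ R-27's `D̄₁ D̄₂`: tip-type jets of the transported direction `compRowsSym · hv B v`); the (WARD-m) sources free
    {Db₁f Db₂f : ∀ n : ℕ, ∀ B : ℕ, ((↥(pbox (Mc B)) × Fin (3 + 1)) → ℝ) → Matrix (↥(pbox (fine Lc (Mc B))) × Fin (3 + 1)) (Res (toSite (ctrOff (3 + 1) Lc)) Lc (fine Lc (Mc B))) ℝ}
    (hDb₁f : ∀ n : ℕ, ∀ B : ℕ, ∀ v, ((Db₁f n) B) v = Matrix.of fun (a : (↥(pbox (fine Lc (Mc B))) × Fin (3 + 1))) (t : (Res (toSite (ctrOff (3 + 1) Lc)) Lc (fine Lc (Mc B)))) => -((c n) * (compRowsSym Lc (fine Lc (Mc B)) (fun i : ℕ => n + 1 - i) (fun _ : ℕ => ctrOff (3 + 1) Lc) (n + 1) *ᵥ (((hv n) B) v)) a * tdelta (fine Lc (Mc B)) ((a.1 : Site (3 + 1)) + unitVec a.2) t.1))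
    (hDb₂f : ∀ n : ℕ, ∀ B : ℕ, ∀ v, ((Db₂f n) B) v = Matrix.of fun (a : (↥(pbox (fine Lc (Mc B))) × Fin (3 + 1))) (t : (Res (toSite (ctrOff (3 + 1) Lc)) Lc (fine Lc (Mc B)))) => ((c n) ^ 2 * (∏ i ∈ range (n + 1), (stepScale 3 Lc ((n + 1 - (i + 1))) * ((box (3 + 1) Lc).card : ℝ)))⁻¹) * ((compRowsSym Lc (fine Lc (Mc B)) (fun i : ℕ => n + 1 - i) (fun _ : ℕ => ctrOff (3 + 1) Lc) (n + 1) *ᵥ (((hv n) B) v)) a) ^ 2 * tdelta (fine Lc (Mc B)) ((a.1 : Site (3 + 1)) + unitVec a.2) t.1)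
    (Y₂f : ∀ n : ℕ, ∀ B : ℕ, ((↥(pbox (Mc B)) × Fin (3 + 1)) → ℝ) → Matrix ((↥(pbox (Mc B)) × Fin (3 + 1))) (NParam Lc (fine Lc (Mc B)) (fun _ : ℕ => ctrOff (3 + 1) Lc) (n + 1)) ℝ)
    -- the `G`-side DRESSED WORDS, NAMED (#36b's shapes at `B := [Q₁₁f v; 0]`)
    (Gw₁f : ∀ n : ℕ, ∀ B : ℕ, ((↥(pbox (Mc B)) × Fin (3 + 1)) → ℝ) → Matrix (↥(pbox (fine Lc (Mc B))) × Fin (3 + 1)) (↥(pbox (fine Lc (Mc B))) × Fin (3 + 1)) ℝ)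
    (hGw₁f : ∀ n : ℕ, ∀ B : ℕ, ∀ v, ((Gw₁f n) B) v = ((((L n) B) * (((H₁f n) B) v) - ((S n) B) * (fromRows (((Q₁₁f n) B) v) (0 : Matrix (NParam Lc (fine Lc (fine Lc (Mc B))) (fun k => (fun _ : ℕ => ctrOff (3 + 1) Lc) (k + 1)) n) (↥(pbox (towerTorus Lc (fine Lc (Mc B)) (n + 1))) × Fin (3 + 1)) ℝ))) * ((I n) B) + ((L n) B) * (fromRows (((Q₁₁f n) B) v) (0 : Matrix (NParam Lc (fine Lc (fine Lc (Mc B))) (fun k => (fun _ : ℕ => ctrOff (3 + 1) Lc) (k + 1)) n) (↥(pbox (towerTorus Lc (fine Lc (Mc B)) (n + 1))) × Fin (3 + 1)) ℝ))ᵀ * ((S n) B)).toBlocks₁₁)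
    (Gw₂f : ∀ n : ℕ, ∀ B : ℕ, ((↥(pbox (Mc B)) × Fin (3 + 1)) → ℝ) → ((↥(pbox (Mc B)) × Fin (3 + 1)) → ℝ) → Matrix (↥(pbox (fine Lc (Mc B))) × Fin (3 + 1)) (↥(pbox (fine Lc (Mc B))) × Fin (3 + 1)) ℝ)
    (hGw₂f : ∀ n : ℕ, ∀ B : ℕ, ∀ v v', ((Gw₂f n) B) v v' = ((((-((((L n) B) * (((H₁f n) B) v) - ((S n) B) * (fromRows (((Q₁₁f n) B) v) (0 : Matrix (NParam Lc (fine Lc (fine Lc (Mc B))) (fun k => (fun _ : ℕ => ctrOff (3 + 1) Lc) (k + 1)) n) (↥(pbox (towerTorus Lc (fine Lc (Mc B)) (n + 1))) × Fin (3 + 1)) ℝ))) * ((Γ n) B) - ((L n) B) * (fromRows (((Q₁₁f n) B) v) (0 : Matrix (NParam Lc (fine Lc (fine Lc (Mc B))) (fun k => (fun _ : ℕ => ctrOff (3 + 1) Lc) (k + 1)) n) (↥(pbox (towerTorus Lc (fine Lc (Mc B)) (n + 1))) × Fin (3 + 1)) ℝ))ᵀ * ((L n) B)) * (((H₁f n)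 B) v') + ((L n) B) * (((H₂f n) B) v v') - (((((L n) B) * (((H₁f n) B) v) - ((S n) B) * (fromRows (((Q₁₁f n) B) v) (0 : Matrix (NParam Lc (fine Lc (fine Lc (Mc B))) (fun k => (fun _ : ℕ => ctrOff (3 + 1) Lc) (k + 1)) n) (↥(pbox (towerTorus Lc (fine Lc (Mc B)) (n + 1))) × Fin (3 + 1)) ℝ))) * ((I n) B) + ((L n) B) * (fromRows (((Q₁₁f n) B) v) (0 : Matrix (NParam Lc (fine Lc (fine Lc (Mc B))) (fun k => (fun _ : ℕ => ctrOff (3 + 1) Lc) (k + 1)) n) (↥(pbox (towerTorus Lc (fine Lc (Mc B)) (n + 1))) × Fin (3 + 1)) ℝ))ᵀ * ((S n) B)) * (fromRows (((Q₁₁f n) B) v') (0 : Matrix (NParam Lc (fine Lc (fine Lc (Mc B))) (fun k => (fun _ : ℕ => ctrOff (3 + 1) Lc) (k + 1)) n) (↥(pbox (towerTorus Lc (fine Lc (Mc B)) (n + 1))) × Fin (3 + 1)) ℝ)) + ((S n) B) * (fromRows (((Q₁₂f n) B) v v') (0 : Matrix (NParam Lc (fine Lc (fine Lc (Mc B)))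 (fun k => (fun _ : ℕ => ctrOff (3 + 1) Lc) (k + 1)) n) (↥(pbox (towerTorus Lc (fine Lc (Mc B)) (n + 1))) × Fin (3 + 1)) ℝ)))) * ((I n) B) + (((L n) B) * (((H₁f n) B) v) - ((S n) B) * (fromRows (((Q₁₁f n) B) v) (0 : Matrix (NParam Lc (fine Lc (fine Lc (Mc B))) (fun k => (fun _ : ℕ => ctrOff (3 + 1) Lc) (k + 1)) n) (↥(pbox (towerTorus Lc (fine Lc (Mc B)) (n + 1))) × Fin (3 + 1)) ℝ))) * (-((((Γ n) B) * (((H₁f n) B) v') + ((I n) B) * (fromRows (((Q₁₁f n) B) v') (0 : Matrix (NParam Lc (fine Lc (fine Lc (Mc B))) (fun k => (fun _ : ℕ => ctrOff (3 + 1) Lc) (k + 1)) n) (↥(pbox (towerTorus Lc (fine Lc (Mc B)) (n + 1))) × Fin (3 + 1)) ℝ))) * ((I n) B) + ((Γ n) B) * (fromRows (((Q₁₁f n) B) v') (0 : Matrix (NParam Lc (fine Lc (fine Lc (Mc B))) (fun k => (fun _ : ℕ => ctrOff (3 + 1) Lc) (k + 1)) n) (↥(pbox (towerTorus Lc (fine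 Lc (Mc B)) (n + 1))) × Fin (3 + 1)) ℝ))ᵀ * ((S n) B)))) - ((-((((L n) B) * (((H₁f n) B) v) - ((S n) B) * (fromRows (((Q₁₁f n) B) v) (0 : Matrix (NParam Lc (fine Lc (fine Lc (Mc B))) (fun k => (fun _ : ℕ => ctrOff (3 + 1) Lc) (k + 1)) n) (↥(pbox (towerTorus Lc (fine Lc (Mc B)) (n + 1))) × Fin (3 + 1)) ℝ))) * ((Γ n) B) - ((L n) B) * (fromRows (((Q₁₁f n) B) v) (0 : Matrix (NParam Lc (fine Lc (fine Lc (Mc B))) (fun k => (fun _ : ℕ => ctrOff (3 + 1) Lc) (k + 1)) n) (↥(pbox (towerTorus Lc (fine Lc (Mc B)) (n + 1))) × Fin (3 + 1)) ℝ))ᵀ * ((L n) B)) * (-(fromRows (((Q₁₁f n) B) v') (0 : Matrix (NParam Lc (fine Lc (fine Lc (Mc B))) (fun k => (fun _ : ℕ => ctrOff (3 + 1) Lc) (k + 1)) n) (↥(pbox (towerTorus Lc (fine Lc (Mc B)) (n + 1))) × Fin (3 + 1)) ℝ))ᵀ) + ((L n) B) * (fromRows (((Q₁₂f n) B) v v')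 (0 : Matrix (NParam Lc (fine Lc (fine Lc (Mc B))) (fun k => (fun _ : ℕ => ctrOff (3 + 1) Lc) (k + 1)) n) (↥(pbox (towerTorus Lc (fine Lc (Mc B)) (n + 1))) × Fin (3 + 1)) ℝ))ᵀ) * ((S n) B) + ((L n) B) * (-(fromRows (((Q₁₁f n) B) v) (0 : Matrix (NParam Lc (fine Lc (fine Lc (Mc B))) (fun k => (fun _ : ℕ => ctrOff (3 + 1) Lc) (k + 1)) n) (↥(pbox (towerTorus Lc (fine Lc (Mc B)) (n + 1))) × Fin (3 + 1)) ℝ))ᵀ) * ((((L n) B) * (((H₁f n) B) v') - ((S n) B) * (fromRows (((Q₁₁f n) B) v') (0 : Matrix (NParam Lc (fine Lc (fine Lc (Mc B))) (fun k => (fun _ : ℕ => ctrOff (3 + 1) Lc) (k + 1)) n) (↥(pbox (towerTorus Lc (fine Lc (Mc B)) (n + 1))) × Fin (3 + 1)) ℝ))) * ((I n) B) + ((L n) B) * (fromRows (((Q₁₁f n) B) v') (0 : Matrix (NParam Lc (fine Lc (fine Lc (Mc B))) (fun k => (fun _ : ℕ => ctrOff (3 + 1) Lc) (k + 1)) n)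 (↥(pbox (towerTorus Lc (fine Lc (Mc B)) (n + 1))) × Fin (3 + 1)) ℝ))ᵀ * ((S n) B))))).toBlocks₁₁)
    -- #21's H-SIDE ROWS, FOR EVERY DIRECTION — DISPLAYED (R-FP-74∕75: `H₁f ∕ H₂f` are the TOTAL graded slots; their naming is the row's (C1) Hessian-table word): form parities, graded Ward rows
    (a2 : ∀ n : ℕ, ∀ B : ℕ, ∀ v, ((H₂f n) B) v v * ((W₀ n) B) + (2 : ℝ) • (((H₁f n) B) v * ((W₁f n) B) v) + ((H₀ n) B) * ((W₂f n) B) v = -((2 : ℝ) • ((((𝔔₁f n) B) v)ᵀ * (0 : Matrix ((↥(pbox (Mc B)) × Fin (3 + 1))) (NParam Lc (fine Lc (Mc B)) (fun _ : ℕ => ctrOff (3 + 1) Lc) (n + 1)) ℝ))) + ((𝔔₀ n) B)ᵀ * ((Y₂f n) B) v)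
    -- THE H-SIDE AT THE TOTAL SLOT (SPEC-46 §C ∕ SPEC-47 §B): the storey data `cf w κ hb` DISPLAYED by their closed forms `hcfe hwe hκe hhbe` (v6; `TowerHLinkRows`' letters), the PIN `hH₁f`; v5's storey rows `hcf hκ hκn hbl`∕top∕`K1 hlink`, `hH₁l hH₁t a1`, `hHN₁` DISCHARGED inside — v9: the LOWER storey columns of `hhbe` read the chart through `σ_n` (`scaleK σ σ AN`; `K1 ∕ hlink` are homogeneous across storeys and the top storey IS `hv ∝ (sn n)⁻¹`)
    (hLc2 : 2 ≤ Lc) (cf : ∀ n : ℕ, ∀ B : ℕ, ℕ → (Fin (3 + 1) → Site (3 + 1) → Fin (3 + 1) → Site (3 + 1) → ℝ))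
    (hcfe : ∀ n : ℕ, ∀ B : ℕ, ∀ (k : ℕ) (μ : Fin (3 + 1)) (s : Site (3 + 1)) (κ' : Fin (3 + 1)) (x : Site (3 + 1)), (cf n) B k μ s κ' x = if k = n + 1 then ∑ ν : Fin (3 + 1), ∑' w : Site (3 + 1), lamCoeffOf (KInv (N := Lc ^ (n + 1 + 1)) (d := 3)) (Lc ^ (n + 1 + 1)) ν w κ' x * compLinKer (fun _ => symLinKerAt (toSite (Roots.ctr Lc).r) Lc) Lc (n + 1) (μ, s) (ν, w) else (if x = (Lc : ℤ) • s ∧ κ' = μ then (1 : ℝ) else 0))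
    (w κ : ∀ n : ℕ, ℕ → ℝ) (hκe : ∀ n : ℕ, ∀ k, (κ n) k = ∏ i ∈ Finset.Ico k (n + 1), (stepScale 3 Lc (n + 1 - (i + 1)) * ((box (3 + 1) Lc).card : ℝ)))
    (hwe : ∀ n : ℕ, ∀ k, (w n) k = (-((c n) * ((Lc : ℝ) ^ (3 + 1)) ^ (n + 1 + 1)) / ∏ i ∈ Finset.Ico k (n + 1), (stepScale 3 Lc (n + 1 - (i + 1)) * (Lc : ℝ) ^ (3 + 1))) / (κ n) k) {rH : Fin (3 + 1) → ℕ} (hrH : rH ∈ box (3 + 1) Lc)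
    (hb : ∀ n : ℕ, ∀ B : ℕ, (k : ℕ) → ((↥(pbox (Mc B)) × Fin (3 + 1)) → ℝ) → (↥(pbox (towerTorus Lc (fine Lc (Mc B)) k)) × Fin (3 + 1) → ℝ))
    (hhbe : ∀ n : ℕ, ∀ B : ℕ, ∀ (k : ℕ) (v : ((↥(pbox (Mc B)) × Fin (3 + 1)) → ℝ)) (ā : ↥(pbox (towerTorus Lc (fine Lc (Mc B)) k)) × Fin (3 + 1)), ((hb n) B) k v ā = if k = n + 1 then ((hv n) B) v (wrapPt (towerTorus Lc (fine Lc (Mc B)) (n + 1)) (ā.1 : Site (3 + 1)), ā.2) else ∑ y₀ : ↥(pbox (towerTorus Lc (Mc B) k)), (if (ā.1 : Site (3 + 1)) = (Lc : ℤ) • (y₀ : Site (3 + 1)) then ∑ a : ↥(pbox (Mc B)) × Fin (3 + 1), v a * ∑' nn : Site (3 + 1), ∑ ν : Fin (3 + 1), ∑' w : Site (3 + 1), (∑ κ' : Fin (3 + 1), ∑' u' : Site (3 + 1), (scaleK (Sum.elim (fun _ : Fin (3 + 1) => (1 : ℝ)) (fun _ : Fin (3 + 1) => (sn n)⁻¹))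 (Sum.elim (fun _ : Fin (3 + 1) => (1 : ℝ)) (fun _ : Fin (3 + 1) => (sn n)⁻¹)) (ANs (Roots.ctr Lc) (ΨL (Roots.ctr Lc)) (n + 1))) u' (((Lc ^ (n + 1 + 1) : ℕ) : ℤ) • (a.1 : Site (3 + 1))) (Sum.inl κ') (Sum.inr a.2) * lamCoeffOf (KInv (N := Lc ^ (n + 1 + 1)) (d := 3)) (Lc ^ (n + 1 + 1)) ν w κ' u') * compLinKer (fun _ => symLinKerAt (toSite (Roots.ctr Lc).r) Lc) Lc k (ā.2, translate (towerTorus Lc (Mc B) k) (y₀ : Site (3 + 1)) nn) (ν, w) else 0))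
    (hH₁f : ∀ n : ℕ, ∀ B : ℕ, ∀ v, ((H₁f n) B) v = (((-2 * (c n)) • ∑ b : ↥(pbox (towerTorus Lc (fine Lc (Mc B)) (n + 1))) × Fin (3 + 1), ((hb n) B) (n + 1) v b • (perF (towerTorus Lc (fine Lc (Mc B)) (n + 1)) (dper (towerTorus Lc (fine Lc (Mc B)) (n + 1)) (wilsonA 3 b.2 (b.1 : Site (3 + 1))))).submatrix (fun b : ↥(pbox (towerTorus Lc (fine Lc (Mc B)) (n + 1))) × Fin (3 + 1) => ((b.1, Sum.inl b.2) : Idx (towerTorus Lc (fine Lc (Mc B)) (n + 1)) (Fib 3))) (fun b : ↥(pbox (towerTorus Lc (fine Lc (Mc B)) (n + 1))) × Fin (3 + 1) => ((b.1, Sum.inl b.2) : Idx (towerTorus Lc (fine Lc (Mc B)) (n + 1)) (Fib 3)))) + (w n) (n + 1) • ∑ ā : ↥(pbox (towerTorus Lc (fine Lc (Mc B)) (n + 1))) × Fin (3 + 1), ((hb n) B) (n + 1) v ā • (perF (towerTorus Lc (fine Lc (Mc B)) (n + 1)) (dper (towerTorus Lc (fine Lc (Mc B)) (n + 1)) (SLam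 N ((cf n) B (n + 1)) (fun μ y => symHessFFAt (toSite (ctrOff (3 + 1) Lc)) Lc μ y) ā.2 (ā.1 : Site (3 + 1))))).submatrix (fun b : ↥(pbox (towerTorus Lc (fine Lc (Mc B)) (n + 1))) × Fin (3 + 1) => ((b.1, Sum.inl b.2) : Idx (towerTorus Lc (fine Lc (Mc B)) (n + 1)) (Fib 3))) (fun b : ↥(pbox (towerTorus Lc (fine Lc (Mc B)) (n + 1))) × Fin (3 + 1) => ((b.1, Sum.inl b.2) : Idx (towerTorus Lc (fine Lc (Mc B)) (n + 1)) (Fib 3))) + compSumSym Lc (onTowerFamily Lc (fine Lc (Mc B)) (fun k => (w n) k • ∑ ā : ↥(pbox (towerTorus Lc (fine Lc (Mc B)) k)) × Fin (3 + 1), ((hb n) B) k v ā • (perF (towerTorus Lc (fine Lc (Mc B)) k) (dper (towerTorus Lc (fine Lc (Mc B)) k) (SLam N ((cf n) B k) (fun μ y => symHessFFAt (toSite (ctrOff (3 + 1) Lc)) Lc μ y) ā.2 (ā.1 : Site (3 + 1))))).submatrix (fun b : ↥(pbox (towerTorus Lc (fine Lc (Mc B)) k)) × Fin (3 + 1) =>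 ((b.1, Sum.inl b.2) : Idx (towerTorus Lc (fine Lc (Mc B)) k) (Fib 3))) (fun b : ↥(pbox (towerTorus Lc (fine Lc (Mc B)) k)) × Fin (3 + 1) => ((b.1, Sum.inl b.2) : Idx (towerTorus Lc (fine Lc (Mc B)) k) (Fib 3))))) (fine Lc (Mc B)) (fun i : ℕ => n + 1 - i) (fun _ : ℕ => ctrOff (3 + 1) Lc) (n + 1)))
    -- v10 (SPEC-64 §3 (ii-A), V10-PLAN §2, J-NOTE-19 §3): THE DOOR — a storey-indexed second-order LATTICE family `𝒲Δ j` FED INTO THE N-SLOT (`WN j + 𝒲Δ j`), DISPLAYED: `hWΔ₂` localisation (`VertexFamily₂`, blocking `Lc^(j+1)`), `hWΔs` swap symmetry, `hWΔm hWΔm'` NO MULTIPLIER LEGS (pin (β)),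
    -- (T2) `hWΔT`: ITS SOURCE-WOUND TORUS TABLE IS `−(sn·cM₂·r) •` v9's (J-R₂″) word (the symmetrised `Ŝ`-contraction of the Ward DEFECT `Def(λ,β) := Σ_b (Dλ)_b • ℳ̂₂ b β − κ₂•(E_λ·Ĉ_β − Ĉ_β·E_λ)` at `λ = lv ((sn·r)•e_(wrapPt y, μ))`; v9 displayed `… = 0`, located false at n = 0; v10 reads it as the door's DEFINITION — the row's to prove)
    (𝒲Δ : ℕ → Fin (3 + 1) → Site (3 + 1) → Fin (3 + 1) → Site (3 + 1) → MKer (3 + 1) (Fib 3)) (hWΔ₂ : ∀ j : ℕ, ∃ Cw δw : ℝ, 0 < δw ∧ VertexFamily₂ (𝒲Δ j) (Lc ^ (j + 1)) Cw δw) (hWΔs : ∀ (j : ℕ) (μ : Fin (3 + 1)) (y : Site (3 + 1)) (ν : Fin (3 + 1)) (y' : Site (3 + 1)), 𝒲Δ j ν y' μ y = 𝒲Δ j μ y ν y')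
    (hWΔm : ∀ (j : ℕ) (μ : Fin (3 + 1)) (y : Site (3 + 1)) (ν : Fin (3 + 1)) (y' : Site (3 + 1)) (x w : Site (3 + 1)) (m : Fin (3 + 1)) (b : Fib 3), 𝒲Δ j μ y ν y' x w (Sum.inr m) b = 0)
    (hWΔm' : ∀ (j : ℕ) (μ : Fin (3 + 1)) (y : Site (3 + 1)) (ν : Fin (3 + 1)) (y' : Site (3 + 1)) (x w : Site (3 + 1)) (a : Fib 3) (m : Fin (3 + 1)), 𝒲Δ j μ y ν y' x w a (Sum.inr m) = 0)
    (hWΔT : ∀ n : ℕ, ∀ (μ : Fin (3 + 1)) (y : Site (3 + 1)) (ν : Fin (3 + 1)) (y' : Site (3 + 1)), ∀ B : ℕ, (perF (towerTorus Lc (fine Lc (Mc B)) (n + 1)) (dper (towerTorus Lc (fine Lc (Mc B)) (n + 1)) (fun x w a b => ∑' e : Site (3 + 1), 𝒲Δ (n + 1) μ y ν (translate (Mc B) y' e) x w a b))).submatrix (fun b : ↥(pbox (towerTorus Lc (fine Lc (Mc B)) (n + 1))) × Fin (3 + 1) => ((b.1, Sum.inl b.2) : Idx (towerTorus Lc (fine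 Lc (Mc B)) (n + 1)) (Fib 3))) (fun b : ↥(pbox (towerTorus Lc (fine Lc (Mc B)) (n + 1))) × Fin (3 + 1) => ((b.1, Sum.inl b.2) : Idx (towerTorus Lc (fine Lc (Mc B)) (n + 1)) (Fib 3))) = -((sn n) * (cM₂ n) * (r n)) • ∑ β : ↥(pbox (Mc B)) × Fin (3 + 1), (perF (towerTorus Lc (fine Lc (Mc B)) (n + 1)) (ANs (Roots.ctr Lc) (ΨL (Roots.ctr Lc)) (n + 1)) (wrapPt (towerTorus Lc (fine Lc (Mc B)) (n + 1)) (((Lc ^ (n + 1 + 1) : ℕ) : ℤ) • (β.1 : Site (3 + 1))), Sum.inr β.2) (wrapPt (towerTorus Lc (fine Lc (Mc B)) (n + 1)) (((Lc ^ (n + 1 + 1) : ℕ) : ℤ) • ((wrapPt (Mc B) y' : ↥(pbox (Mc B))) : Site (3 + 1))), Sum.inr ν) • (∑ b : ↥(pbox (towerTorus Lc (fine Lc (Mc B)) (n + 1))) × Fin (3 + 1), (∑ s : ↥(pbox (towerTorus Lc (fine Lc (Mc B)) (n + 1))), tgrad (towerTorus Lc (fine Lc (Mc B)) (n + 1)) (b.1,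 Sum.inl b.2) s * ((lv n) B) (((sn n) * (r n)) • (Pi.single (wrapPt (Mc B) y, μ) (1 : ℝ) : ((↥(pbox (Mc B)) × Fin (3 + 1)) → ℝ))) s) • ((M₂ n) B) b β - (κ₂ n) • (Matrix.diagonal (fun b : ↥(pbox (towerTorus Lc (fine Lc (Mc B)) (n + 1))) × Fin (3 + 1) => ((lv n) B) (((sn n) * (r n)) • (Pi.single (wrapPt (Mc B) y, μ) (1 : ℝ) : ((↥(pbox (Mc B)) × Fin (3 + 1)) → ℝ))) b.1) * (perF (towerTorus Lc (fine Lc (Mc B)) (n + 1)) (dper (towerTorus Lc (fine Lc (Mc B)) (n + 1)) ((tabsCompG (n + 1 + 1) (one_le_of_neZero Lc) (Roots.ctr Lc).hr (Pn.cM (n + 1 + 1))).H β.2 (β.1 : Site (3 + 1))))).submatrix (fun b : ↥(pbox (towerTorus Lc (fine Lc (Mc B)) (n + 1))) × Fin (3 + 1) => ((b.1, Sum.inl b.2) : Idx (towerTorus Lc (fine Lc (Mc B)) (n + 1)) (Fib 3))) (fun b : ↥(pbox (towerTorus Lc (fine Lc (Mc B)) (n + 1))) × Fin (3 + 1) =>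 ((b.1, Sum.inl b.2) : Idx (towerTorus Lc (fine Lc (Mc B)) (n + 1)) (Fib 3))) - (perF (towerTorus Lc (fine Lc (Mc B)) (n + 1)) (dper (towerTorus Lc (fine Lc (Mc B)) (n + 1)) ((tabsCompG (n + 1 + 1) (one_le_of_neZero Lc) (Roots.ctr Lc).hr (Pn.cM (n + 1 + 1))).H β.2 (β.1 : Site (3 + 1))))).submatrix (fun b : ↥(pbox (towerTorus Lc (fine Lc (Mc B)) (n + 1))) × Fin (3 + 1) => ((b.1, Sum.inl b.2) : Idx (towerTorus Lc (fine Lc (Mc B)) (n + 1)) (Fib 3))) (fun b : ↥(pbox (towerTorus Lc (fine Lc (Mc B)) (n + 1))) × Fin (3 + 1) => ((b.1, Sum.inl b.2) : Idx (towerTorus Lc (fine Lc (Mc B)) (n + 1)) (Fib 3))) * Matrix.diagonal (fun b : ↥(pbox (towerTorus Lc (fine Lc (Mc B)) (n + 1))) × Fin (3 + 1) => ((lv n) B) (((sn n) * (r n)) • (Pi.single (wrapPt (Mc B) y, μ) (1 : ℝ) : ((↥(pbox (Mc B)) × Fin (3 + 1)) → ℝ))) b.1))) + perF (towerTorus Lc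 (fine Lc (Mc B)) (n + 1)) (ANs (Roots.ctr Lc) (ΨL (Roots.ctr Lc)) (n + 1)) (wrapPt (towerTorus Lc (fine Lc (Mc B)) (n + 1)) (((Lc ^ (n + 1 + 1) : ℕ) : ℤ) • (β.1 : Site (3 + 1))), Sum.inr β.2) (wrapPt (towerTorus Lc (fine Lc (Mc B)) (n + 1)) (((Lc ^ (n + 1 + 1) : ℕ) : ℤ) • ((wrapPt (Mc B) y : ↥(pbox (Mc B))) : Site (3 + 1))), Sum.inr μ) • (∑ b : ↥(pbox (towerTorus Lc (fine Lc (Mc B)) (n + 1))) × Fin (3 + 1), (∑ s : ↥(pbox (towerTorus Lc (fine Lc (Mc B)) (n + 1))), tgrad (towerTorus Lc (fine Lc (Mc B)) (n + 1)) (b.1, Sum.inl b.2) s * ((lv n) B) (((sn n) * (r n)) • (Pi.single (wrapPt (Mc B) y', ν) (1 : ℝ) : ((↥(pbox (Mc B)) × Fin (3 + 1)) → ℝ))) s) • ((M₂ n) B) b β - (κ₂ n) • (Matrix.diagonal (fun b : ↥(pbox (towerTorus Lc (fine Lc (Mc B)) (n + 1))) × Fin (3 + 1) => ((lv n) B) (((sn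 n) * (r n)) • (Pi.single (wrapPt (Mc B) y', ν) (1 : ℝ) : ((↥(pbox (Mc B)) × Fin (3 + 1)) → ℝ))) b.1) * (perF (towerTorus Lc (fine Lc (Mc B)) (n + 1)) (dper (towerTorus Lc (fine Lc (Mc B)) (n + 1)) ((tabsCompG (n + 1 + 1) (one_le_of_neZero Lc) (Roots.ctr Lc).hr (Pn.cM (n + 1 + 1))).H β.2 (β.1 : Site (3 + 1))))).submatrix (fun b : ↥(pbox (towerTorus Lc (fine Lc (Mc B)) (n + 1))) × Fin (3 + 1) => ((b.1, Sum.inl b.2) : Idx (towerTorus Lc (fine Lc (Mc B)) (n + 1)) (Fib 3))) (fun b : ↥(pbox (towerTorus Lc (fine Lc (Mc B)) (n + 1))) × Fin (3 + 1) => ((b.1, Sum.inl b.2) : Idx (towerTorus Lc (fine Lc (Mc B)) (n + 1)) (Fib 3))) - (perF (towerTorus Lc (fine Lc (Mc B)) (n + 1)) (dper (towerTorus Lc (fine Lc (Mc B)) (n + 1)) ((tabsCompG (n + 1 + 1) (one_le_of_neZero Lc) (Roots.ctr Lc).hr (Pn.cM (n + 1 + 1))).H β.2 (β.1 : Site (3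 + 1))))).submatrix (fun b : ↥(pbox (towerTorus Lc (fine Lc (Mc B)) (n + 1))) × Fin (3 + 1) => ((b.1, Sum.inl b.2) : Idx (towerTorus Lc (fine Lc (Mc B)) (n + 1)) (Fib 3))) (fun b : ↥(pbox (towerTorus Lc (fine Lc (Mc B)) (n + 1))) × Fin (3 + 1) => ((b.1, Sum.inl b.2) : Idx (towerTorus Lc (fine Lc (Mc B)) (n + 1)) (Fib 3))) * Matrix.diagonal (fun b : ↥(pbox (towerTorus Lc (fine Lc (Mc B)) (n + 1))) × Fin (3 + 1) => ((lv n) B) (((sn n) * (r n)) • (Pi.single (wrapPt (Mc B) y', ν) (1 : ℝ) : ((↥(pbox (Mc B)) × Fin (3 + 1)) → ℝ))) b.1)))))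
    -- the direction FAMILY (SPEC-46 §B′): one top one-shot source direction per label `(μ, y)`, per storey and per box (the row's transported directions, DISPLAYED)
    (dv : ∀ n : ℕ, ∀ B : ℕ, (Fin (3 + 1) × (Fin (3 + 1) → ℤ)) → ((↥(pbox (Mc B)) × Fin (3 + 1)) → ℝ)) (hdv : ∀ n : ℕ, ∀ B : ℕ, ∀ (μ : Fin (3 + 1)) (y : Site (3 + 1)), ((dv n) B) (μ, y) = ((sn n) * (r n)) • (Pi.single (wrapPt (Mc B) y, μ) (1 : ℝ) : ((↥(pbox (Mc B)) × Fin (3 + 1)) → ℝ)))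
    -- (S3-1) N — per box: the ONE-SHOT system of depth `n+2`, right inverse and LEG — v9 (SPEC-60 (L); an2 g72 A-1 ∕ PART 35; Engine C K2L-C G3): THE LEG READS THE σ_n-CONJUGATED CHART `scaleK σ σ (AN (Roots.ctr Lc) (n+1))`, `σ = 1 ⊕ (sn n)⁻¹` on `Fib 3` (field slots `1`, multiplier slots `(sn n)⁻¹`: `ff` block `AN`, `(f, fN)` blocks `(sn n)⁻¹·AN`, `(fN, fN)` block `(sn n)⁻²·AN`); `hXN`, masks, `fN` VERBATIM (DISPLAYED);
    {XN : ∀ n : ℕ, ∀ B : ℕ, Matrix ((↥(pbox (towerTorus Lc (fine Lc (Mc B)) (n + 1))) × Fin (3 + 1)) ⊕ ((↥(pbox (Mc B)) × Fin (3 + 1)) ⊕ (NParam Lc (fine Lc (Mc B)) (fun _ : ℕ => ctrOff (3 + 1) Lc) (n + 1)))) ((↥(pbox (towerTorus Lc (fine Lc (Mc B)) (n + 1))) × Fin (3 + 1)) ⊕ ((↥(pbox (Mc B)) × Fin (3 + 1)) ⊕ (NParam Lc (fine Lc (Mc B)) (fun _ : ℕ => ctrOff (3 + 1) Lc) (n +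 1)))) ℝ}
    (hXN : ∀ n : ℕ, ∀ B : ℕ, kkt ((H₀ n) B) (fromRows ((𝔔₀ n) B) ((P n) B)) * (XN n) B = 1) (ρN : ∀ n : ℕ, Fin (3 + 1) → ℤ) (fN : ∀ n : ℕ, ∀ B : ℕ, (↥(pbox (Mc B)) × Fin (3 + 1)) → Idx (towerTorus Lc (fine Lc (Mc B)) (n + 1)) (Fib 3))
    (hfN : ∀ n : ℕ, ∀ B : ℕ, ∀ a : ↥(pbox (Mc B)) × Fin (3 + 1), (fN n) B a = (wrapPt (towerTorus Lc (fine Lc (Mc B)) (n + 1)) (((Lc ^ (n + 1 + 1) : ℕ) : ℤ) • (a.1 : Site (3 + 1))), Sum.inr a.2))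
    (hEAN : ∀ n : ℕ, ∀ B : ℕ, perF (towerTorus Lc (fine Lc (Mc B)) (n + 1)) (axEc (ρN n) (Lc ^ (n + 1 + 1))) * perF (towerTorus Lc (fine Lc (Mc B)) (n + 1)) (scaleK (Sum.elim (fun _ : Fin (3 + 1) => (1 : ℝ)) (fun _ : Fin (3 + 1) => (sn n)⁻¹)) (Sum.elim (fun _ : Fin (3 + 1) => (1 : ℝ)) (fun _ : Fin (3 + 1) => (sn n)⁻¹)) (ANs (Roots.ctr Lc) (ΨL (Roots.ctr Lc)) (n + 1))) = perF (towerTorus Lc (fine Lc (Mc B)) (n + 1)) (scaleK (Sum.elim (fun _ : Fin (3 + 1) => (1 : ℝ)) (fun _ : Fin (3 + 1) => (sn n)⁻¹)) (Sum.elim (fun _ : Fin (3 + 1) => (1 : ℝ)) (fun _ : Fin (3 + 1) => (sn n)⁻¹)) (ANs (Roots.ctr Lc) (ΨL (Roots.ctr Lc)) (n + 1))))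
    (hAEN : ∀ n : ℕ, ∀ B : ℕ, perF (towerTorus Lc (fine Lc (Mc B)) (n + 1)) (scaleK (Sum.elim (fun _ : Fin (3 + 1) => (1 : ℝ)) (fun _ : Fin (3 + 1) => (sn n)⁻¹)) (Sum.elim (fun _ : Fin (3 + 1) => (1 : ℝ)) (fun _ : Fin (3 + 1) => (sn n)⁻¹)) (ANs (Roots.ctr Lc) (ΨL (Roots.ctr Lc)) (n + 1))) * perF (towerTorus Lc (fine Lc (Mc B)) (n + 1)) (axEc (ρN n) (Lc ^ (n + 1 + 1))) = perF (towerTorus Lc (fine Lc (Mc B)) (n + 1)) (scaleK (Sum.elim (fun _ : Fin (3 + 1) => (1 : ℝ)) (fun _ : Fin (3 + 1) => (sn n)⁻¹)) (Sum.elim (fun _ : Fin (3 + 1) => (1 : ℝ)) (fun _ : Fin (3 + 1) => (sn n)⁻¹)) (ANs (Roots.ctr Lc) (ΨL (Roots.ctr Lc)) (n + 1))))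
    (hLN : ∀ n : ℕ, ∀ B : ℕ, ((XN n) B).submatrix (Sum.map id Sum.inl) (Sum.map id Sum.inl) = fromBlocks (Matrix.of fun (b b' : (↥(pbox (towerTorus Lc (fine Lc (Mc B)) (n + 1))) × Fin (3 + 1))) => axEc (ρN n) (Lc ^ (n + 1 + 1)) (b.1 : Site (3 + 1)) (b.1 : Site (3 + 1)) (Sum.inl b.2) (Sum.inl b.2) * (axEc (ρN n) (Lc ^ (n + 1 + 1)) (b'.1 : Site (3 + 1)) (b'.1 : Site (3 + 1)) (Sum.inl b'.2) (Sum.inl b'.2) * perF (towerTorus Lc (fine Lc (Mc B)) (n + 1)) (scaleK (Sum.elim (fun _ : Fin (3 + 1) => (1 : ℝ)) (fun _ : Fin (3 + 1) => (sn n)⁻¹)) (Sum.elim (fun _ : Fin (3 + 1) => (1 : ℝ)) (fun _ : Fin (3 + 1) => (sn n)⁻¹)) (ANs (Roots.ctr Lc) (ΨL (Roots.ctr Lc)) (n + 1))) (b.1, Sum.inl b.2) (b'.1, Sum.inl b'.2))) (Matrix.of fun (b : (↥(pbox (towerTorus Lc (fine Lc (Mc B)) (n + 1))) × Fin (3 +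 1))) (a : (↥(pbox (Mc B)) × Fin (3 + 1))) => axEc (ρN n) (Lc ^ (n + 1 + 1)) (b.1 : Site (3 + 1)) (b.1 : Site (3 + 1)) (Sum.inl b.2) (Sum.inl b.2) * perF (towerTorus Lc (fine Lc (Mc B)) (n + 1)) (scaleK (Sum.elim (fun _ : Fin (3 + 1) => (1 : ℝ)) (fun _ : Fin (3 + 1) => (sn n)⁻¹)) (Sum.elim (fun _ : Fin (3 + 1) => (1 : ℝ)) (fun _ : Fin (3 + 1) => (sn n)⁻¹)) (ANs (Roots.ctr Lc) (ΨL (Roots.ctr Lc)) (n + 1))) (b.1, Sum.inl b.2) (((fN n) B) a)) (-Matrix.of fun (a : (↥(pbox (Mc B)) × Fin (3 + 1))) (b : (↥(pbox (towerTorus Lc (fine Lc (Mc B)) (n + 1))) × Fin (3 + 1))) => axEc (ρN n) (Lc ^ (n + 1 + 1)) (b.1 : Site (3 + 1)) (b.1 : Site (3 + 1)) (Sum.inl b.2) (Sum.inl b.2) * perF (towerTorus Lc (fine Lc (Mc B)) (n + 1)) (scaleK (Sum.elim (fun _ : Fin (3 + 1) => (1 : ℝ)) (fun _ : Fin (3 +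 1) => (sn n)⁻¹)) (Sum.elim (fun _ : Fin (3 + 1) => (1 : ℝ)) (fun _ : Fin (3 + 1) => (sn n)⁻¹)) (ANs (Roots.ctr Lc) (ΨL (Roots.ctr Lc)) (n + 1))) (((fN n) B) a) (b.1, Sum.inl b.2)) (-((perF (towerTorus Lc (fine Lc (Mc B)) (n + 1)) (scaleK (Sum.elim (fun _ : Fin (3 + 1) => (1 : ℝ)) (fun _ : Fin (3 + 1) => (sn n)⁻¹)) (Sum.elim (fun _ : Fin (3 + 1) => (1 : ℝ)) (fun _ : Fin (3 + 1) => (sn n)⁻¹)) (ANs (Roots.ctr Lc) (ΨL (Roots.ctr Lc)) (n + 1)))).submatrix ((fN n) B) ((fN n) B))))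
    -- (S3-2) N — an2's record families `VN ∕ WN (n+1)`: their DECAY and PARITY letters are the row's THEOREMS (`NVertexParities.vertexFamilies_VN_WN`, PART 12) and the four content rows `hHN₁ hQN₁ hHN₂ hQN₂` are the road's, the WINDING LETTER is the row's PART 15c `KernelPeriodisationFibWoundLetter.winding_letter_evenHalf_of_swap` — ALL DISCHARGED inside (v6∕v9, at the σ′-conjugated families): NOTHING of the N families is displayed
    -- (S3-1) F — per box: the ONE-SHOT system of the tower below (depth `n+1`, same finest torus), right inverse and LEG over `A_F` (DISPLAYED);
    {XF : ∀ n : ℕ, ∀ B : ℕ, Matrix ((↥(pbox (towerTorus Lc (fine Lc (Mc B)) (n + 1))) × Fin (3 + 1)) ⊕ ((↥(pbox (fine Lc (Mc B))) × Fin (3 + 1)) ⊕ (NParam Lc (fine Lc (fine Lc (Mc B))) (fun k => (fun _ : ℕ => ctrOff (3 + 1) Lc) (k + 1)) n))) ((↥(pbox (towerTorus Lc (fine Lc (Mc B)) (n + 1))) × Fin (3 + 1)) ⊕ ((↥(pbox (fine Lc (Mc B))) × Fin (3 + 1)) ⊕ (NParam Lc (fine Lc (fine Lc (Mc B))) (fun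 k => (fun _ : ℕ => ctrOff (3 + 1) Lc) (k + 1)) n))) ℝ}
    (hXF : ∀ n : ℕ, ∀ B : ℕ, kkt ((H₀ n) B) (fromRows ((Q₁₀ n) B) ((τ₁ n) B)) * (XF n) B = 1) (ρF : ∀ n : ℕ, Fin (3 + 1) → ℤ) (LFc : ∀ n : ℕ, ℕ) (fF : ∀ n : ℕ, ∀ B : ℕ, (↥(pbox (fine Lc (Mc B))) × Fin (3 + 1)) → Idx (towerTorus Lc (fine Lc (Mc B)) (n + 1)) (Fib 3))
    (hfF : ∀ n : ℕ, ∀ B : ℕ, Function.Injective ((fF n) B)) (hmF : ∀ n : ℕ, ∀ B : ℕ, ∀ a : (↥(pbox (fine Lc (Mc B))) × Fin (3 + 1)), ∃ m : Fin (3 + 1), ((fF n) B a).2 = Sum.inr m)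
    (hcF : ∀ n : ℕ, ∀ B : ℕ, ∀ (s : ↥(pbox (towerTorus Lc (fine Lc (Mc B)) (n + 1)))) (m : Fin (3 + 1)), ((s, Sum.inr m) : Idx (towerTorus Lc (fine Lc (Mc B)) (n + 1)) (Fib 3)) ∈ Set.range ((fF n) B) ↔ Torus.proj (LFc n) (s : Site (3 + 1)) = 0) {CAF αF : ∀ n : ℕ, ℝ}
    (hAF : ∀ n : ℕ, Decays (AF (n + 1)) (CAF n) (αF n)) (hαF : ∀ n : ℕ, 0 < (αF n)) (hAFsh : ∀ n : ℕ, ∀ t : Fin (3 + 1) → ℤ, shiftK (((Lc ^ (n + 1) : ℕ) : ℤ) • t) (AF (n + 1)) = (AF (n + 1)))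
    (hEAF : ∀ n : ℕ, ∀ B : ℕ, perF (towerTorus Lc (fine Lc (Mc B)) (n + 1)) (axEc (ρF n) (LFc n)) * perF (towerTorus Lc (fine Lc (Mc B)) (n + 1)) (AF (n + 1)) = perF (towerTorus Lc (fine Lc (Mc B)) (n + 1)) (AF (n + 1)))
    (hAEF : ∀ n : ℕ, ∀ B : ℕ, perF (towerTorus Lc (fine Lc (Mc B)) (n + 1)) (AF (n + 1)) * perF (towerTorus Lc (fine Lc (Mc B)) (n + 1)) (axEc (ρF n) (LFc n)) = perF (towerTorus Lc (fine Lc (Mc B)) (n + 1)) (AF (n + 1)))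
    (hLF : ∀ n : ℕ, ∀ B : ℕ, ((XF n) B).submatrix (Sum.map id Sum.inl) (Sum.map id Sum.inl) = fromBlocks (Matrix.of fun (b b' : (↥(pbox (towerTorus Lc (fine Lc (Mc B)) (n + 1))) × Fin (3 + 1))) => axEc (ρF n) (LFc n) (b.1 : Site (3 + 1)) (b.1 : Site (3 + 1)) (Sum.inl b.2) (Sum.inl b.2) * (axEc (ρF n) (LFc n) (b'.1 : Site (3 + 1)) (b'.1 : Site (3 + 1)) (Sum.inl b'.2) (Sum.inl b'.2) * perF (towerTorus Lc (fine Lc (Mc B)) (n + 1)) (AF (n + 1)) (b.1, Sum.inl b.2) (b'.1, Sum.inl b'.2))) (Matrix.of fun (b : (↥(pbox (towerTorus Lc (fine Lc (Mc B)) (n + 1))) × Fin (3 + 1))) (a : (↥(pbox (fine Lc (Mc B))) × Fin (3 + 1))) => axEc (ρF n) (LFc n) (b.1 : Site (3 + 1)) (b.1 : Site (3 + 1)) (Sum.inl b.2) (Sum.inl b.2) * perF (towerTorus Lc (fine Lc (Mc B)) (n + 1)) (AF (n + 1)) (b.1, Sum.inl b.2) (((fF n) B) a)) (-Matrix.of fun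 (a : (↥(pbox (fine Lc (Mc B))) × Fin (3 + 1))) (b : (↥(pbox (towerTorus Lc (fine Lc (Mc B)) (n + 1))) × Fin (3 + 1))) => axEc (ρF n) (LFc n) (b.1 : Site (3 + 1)) (b.1 : Site (3 + 1)) (Sum.inl b.2) (Sum.inl b.2) * perF (towerTorus Lc (fine Lc (Mc B)) (n + 1)) (AF (n + 1)) (((fF n) B) a) (b.1, Sum.inl b.2)) (-((perF (towerTorus Lc (fine Lc (Mc B)) (n + 1)) (AF (n + 1))).submatrix ((fF n) B) ((fF n) B))))
    -- (S3-2) F — FAMILY FORM: the lattice jets `𝒱F ∕ 𝒲F (n+1)` of the tower below are vertex families at scale `NF n`; PER BOX their periodisations carry the parities and ARE the door's fine jets `H₁f ∕ Q₁₁f` (first order) and the symmetrised `H₂f ∕ Q₁₂f` (second order) along the family `dv n B (μ, y)`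
    {NF : ℕ → ℕ} {CvF CwF δF : ℕ → ℝ} (hVF : ∀ n : ℕ, VertexFamily (𝒱F (n + 1)) (NF n) (CvF n) (δF n)) (hWF : ∀ n : ℕ, VertexFamily₂ (𝒲F (n + 1)) (NF n) (CwF n) (δF n)) (hδF : ∀ n : ℕ, 0 < δF n)
    (hWFw : ∀ (n : ℕ) (μ ν : Fin (3 + 1)) (z : Fin (3 + 1) → ℤ), Tendsto (fun B : ℕ => Matrix.trace (perF (towerTorus Lc (fine Lc (Mc B)) (n + 1)) (AF (n + 1)) * perF (towerTorus Lc (fine Lc (Mc B)) (n + 1)) (dper (towerTorus Lc (fine Lc (Mc B)) (n + 1)) ((𝒲bF (n + 1)) B μ 0 ν z))) - Matrix.trace (perF (towerTorus Lc (fine Lc (Mc B)) (n + 1)) (AF (n + 1)) * perF (towerTorus Lc (fine Lc (Mc B)) (n + 1)) (dper (towerTorus Lc (fine Lc (Mc B)) (n + 1)) ((𝒲F (n + 1)) μ 0 ν z)))) atTop (𝓝 0))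
    (hVFm : ∀ (n : ℕ) (μ : Fin (3 + 1)) (y : Fin (3 + 1) → ℤ), ∀ B : ℕ, ∀ a a' : (↥(pbox (fine Lc (Mc B))) × Fin (3 + 1)), (perF (towerTorus Lc (fine Lc (Mc B)) (n + 1)) (dper (towerTorus Lc (fine Lc (Mc B)) (n + 1)) ((𝒱F (n + 1)) μ y))) (((fF n) B) a) (((fF n) B) a') = 0)
    (hVFt : ∀ (n : ℕ) (μ : Fin (3 + 1)) (y : Fin (3 + 1) → ℤ), ∀ B : ℕ, ∀ (b : (↥(pbox (towerTorus Lc (fine Lc (Mc B)) (n + 1))) × Fin (3 + 1))) (a : (↥(pbox (fine Lc (Mc B))) × Fin (3 + 1))), (perF (towerTorus Lc (fine Lc (Mc B)) (n + 1)) (dper (towerTorus Lc (fine Lc (Mc B)) (n + 1)) ((𝒱F (n + 1)) μ y))) (b.1, Sum.inl b.2) (((fF n) B) a) = (perF (towerTorus Lc (fine Lc (Mc B)) (n + 1)) (dper (towerTorus Lc (fine Lc (Mc B)) (n + 1)) ((𝒱F (n + 1)) μ y))) (((fF n) B) a) (b.1, Sum.inl b.2))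
    (hWFm : ∀ (n : ℕ) (μ : Fin (3 + 1)) (y : Fin (3 + 1) → ℤ) (ν : Fin (3 + 1)) (y' : Fin (3 + 1) → ℤ), ∀ B : ℕ, ∀ a a' : (↥(pbox (fine Lc (Mc B))) × Fin (3 + 1)), (perF (towerTorus Lc (fine Lc (Mc B)) (n + 1)) (dper (towerTorus Lc (fine Lc (Mc B)) (n + 1)) ((𝒲bF (n + 1)) B μ y ν y'))) (((fF n) B) a) (((fF n) B) a') = 0)
    (hWFt : ∀ (n : ℕ) (μ : Fin (3 + 1)) (y : Fin (3 + 1) → ℤ) (ν : Fin (3 + 1)) (y' : Fin (3 + 1) → ℤ), ∀ B : ℕ, ∀ (b : (↥(pbox (towerTorus Lc (fine Lc (Mc B)) (n + 1))) × Fin (3 + 1))) (a : (↥(pbox (fine Lc (Mc B))) × Fin (3 + 1))), (perF (towerTorus Lc (fine Lc (Mc B)) (n + 1)) (dper (towerTorus Lc (fine Lc (Mc B)) (n + 1)) ((𝒲bF (n + 1)) B μ y ν y'))) (b.1, Sum.inl b.2) (((fF n) B) a) = -(perF (towerTorus Lc (fine Lc (Mc B)) (n + 1)) (dper (towerTorus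 Lc (fine Lc (Mc B)) (n + 1)) ((𝒲bF (n + 1)) B μ y ν y'))) (((fF n) B) a) (b.1, Sum.inl b.2))
    (hHF₁ : ∀ (n : ℕ) (μ : Fin (3 + 1)) (y : Fin (3 + 1) → ℤ), ∀ B : ℕ, (H₁f n) B ((dv n) B (μ, y)) = (perF (towerTorus Lc (fine Lc (Mc B)) (n + 1)) (dper (towerTorus Lc (fine Lc (Mc B)) (n + 1)) ((𝒱F (n + 1)) μ y))).submatrix (fun b : (↥(pbox (towerTorus Lc (fine Lc (Mc B)) (n + 1))) × Fin (3 + 1)) => ((b.1, Sum.inl b.2) : Idx (towerTorus Lc (fine Lc (Mc B)) (n + 1)) (Fib 3))) (fun b : (↥(pbox (towerTorus Lc (fine Lc (Mc B)) (n + 1))) × Fin (3 + 1)) => ((b.1, Sum.inl b.2) : Idx (towerTorus Lc (fine Lc (Mc B)) (n + 1)) (Fib 3))))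
    (hQF₁ : ∀ (n : ℕ) (μ : Fin (3 + 1)) (y : Fin (3 + 1) → ℤ), ∀ B : ℕ, (Q₁₁f n) B ((dv n) B (μ, y)) = (perF (towerTorus Lc (fine Lc (Mc B)) (n + 1)) (dper (towerTorus Lc (fine Lc (Mc B)) (n + 1)) ((𝒱F (n + 1)) μ y))).submatrix ((fF n) B) (fun b : (↥(pbox (towerTorus Lc (fine Lc (Mc B)) (n + 1))) × Fin (3 + 1)) => ((b.1, Sum.inl b.2) : Idx (towerTorus Lc (fine Lc (Mc B)) (n + 1)) (Fib 3))))
    (hHF₂ : ∀ (n : ℕ) (μ : Fin (3 + 1)) (y : Fin (3 + 1) → ℤ) (ν : Fin (3 + 1)) (y' : Fin (3 + 1) → ℤ), ∀ B : ℕ, (1 / 2 : ℝ) • ((H₂f n) B ((dv n) B (μ, y)) ((dv n) B (ν, y')) + (H₂f n) B ((dv n) B (ν, y')) ((dv n) B (μ, y))) = (perF (towerTorus Lc (fine Lc (Mc B)) (n + 1)) (dper (towerTorus Lc (fine Lc (Mc B)) (n + 1)) ((𝒲bF (n + 1)) B μ y ν y'))).submatrix (fun b : (↥(pbox (towerTorus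 Lc (fine Lc (Mc B)) (n + 1))) × Fin (3 + 1)) => ((b.1, Sum.inl b.2) : Idx (towerTorus Lc (fine Lc (Mc B)) (n + 1)) (Fib 3))) (fun b : (↥(pbox (towerTorus Lc (fine Lc (Mc B)) (n + 1))) × Fin (3 + 1)) => ((b.1, Sum.inl b.2) : Idx (towerTorus Lc (fine Lc (Mc B)) (n + 1)) (Fib 3))))
    (hQF₂ : ∀ (n : ℕ) (μ : Fin (3 + 1)) (y : Fin (3 + 1) → ℤ) (ν : Fin (3 + 1)) (y' : Fin (3 + 1) → ℤ), ∀ B : ℕ, (1 / 2 : ℝ) • ((Q₁₂f n) B ((dv n) B (μ, y)) ((dv n) B (ν, y')) + (Q₁₂f n) B ((dv n) B (ν, y')) ((dv n) B (μ, y))) = (perF (towerTorus Lc (fine Lc (Mc B)) (n + 1)) (dper (towerTorus Lc (fine Lc (Mc B)) (n + 1)) ((𝒲bF (n + 1)) B μ y ν y'))).submatrix ((fF n) B) (fun b : (↥(pbox (towerTorus Lc (fine Lc (Mc B)) (n + 1))) × Fin (3 + 1)) => ((b.1, Sum.inl b.2) : Idx (towerTorus Lc (fine Lc (Mc B)) (n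 + 1)) (Fib 3))))
    -- (S3-2) G — FAMILY FORM: the lattice jets `𝒱G ∕ 𝒲G (n+1)` of the TOP STEP are vertex families at scale `NG n`; PER BOX their periodisations on `fine Lc (Mc B)` carry the parities and ARE the door's `G` jets `Gw₁f ∕ Q₂₁f`, `Gw₂f ∕ Q₂₂f` (with the tower weight `∏ wVH`) at the slots, along the family `dv n B (μ, y)`
    {NG : ℕ → ℕ} {CvG CwG δG : ℕ → ℝ} (hVG : ∀ n : ℕ, VertexFamily (𝒱G (n + 1)) (NG n) (CvG n) (δG n)) (hWG : ∀ n : ℕ, VertexFamily₂ (𝒲G (n + 1)) (NG n) (CwG n) (δG n)) (hδG : ∀ n : ℕ, 0 < δG n)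
    (hWGw : ∀ (n : ℕ) (μ ν : Fin (3 + 1)) (z : Fin (3 + 1) → ℤ), Tendsto (fun B : ℕ => Matrix.trace (perF (fine Lc (Mc B)) (GcombSh (d := 3) Lc ((n + 1 - 0))) * perF (fine Lc (Mc B)) (dper (fine Lc (Mc B)) ((𝒲bG (n + 1)) B μ 0 ν z))) - Matrix.trace (perF (fine Lc (Mc B)) (GcombSh (d := 3) Lc ((n + 1 - 0))) * perF (fine Lc (Mc B)) (dper (fine Lc (Mc B)) ((𝒲G (n + 1)) μ 0 ν z)))) atTop (𝓝 0))
    (hVGm : ∀ (n : ℕ) (μ : Fin (3 + 1)) (y : Fin (3 + 1) → ℤ), ∀ B : ℕ, ∀ a a' : (↥(pbox (Mc B)) × Fin (3 + 1)), (perF (fine Lc (Mc B)) (dper (fine Lc (Mc B)) ((𝒱G (n + 1)) μ y))) (((coarsePt (Mc B) Lc a.1, Sum.inr (a.2)) : Idx (fine Lc (Mc B)) (Fib 3))) (((coarsePt (Mc B) Lc a'.1, Sum.inr (a'.2)) : Idx (fine Lc (Mc B)) (Fib 3))) = 0)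
    (hVGt : ∀ (n : ℕ) (μ : Fin (3 + 1)) (y : Fin (3 + 1) → ℤ), ∀ B : ℕ, ∀ (b : (↥(pbox (fine Lc (Mc B))) × Fin (3 + 1))) (a : (↥(pbox (Mc B)) × Fin (3 + 1))), (perF (fine Lc (Mc B)) (dper (fine Lc (Mc B)) ((𝒱G (n + 1)) μ y))) (b.1, Sum.inl b.2) (((coarsePt (Mc B) Lc a.1, Sum.inr (a.2)) : Idx (fine Lc (Mc B)) (Fib 3))) = (perF (fine Lc (Mc B)) (dper (fine Lc (Mc B)) ((𝒱G (n + 1)) μ y))) (((coarsePt (Mc B) Lc a.1, Sum.inr (a.2)) : Idx (fine Lc (Mc B)) (Fib 3))) (b.1, Sum.inl b.2))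
    (hWGm : ∀ (n : ℕ) (μ : Fin (3 + 1)) (y : Fin (3 + 1) → ℤ) (ν : Fin (3 + 1)) (y' : Fin (3 + 1) → ℤ), ∀ B : ℕ, ∀ a a' : (↥(pbox (Mc B)) × Fin (3 + 1)), (perF (fine Lc (Mc B)) (dper (fine Lc (Mc B)) ((𝒲bG (n + 1)) B μ y ν y'))) (((coarsePt (Mc B) Lc a.1, Sum.inr (a.2)) : Idx (fine Lc (Mc B)) (Fib 3))) (((coarsePt (Mc B) Lc a'.1, Sum.inr (a'.2)) : Idx (fine Lc (Mc B)) (Fib 3))) = 0)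
    (hWGt : ∀ (n : ℕ) (μ : Fin (3 + 1)) (y : Fin (3 + 1) → ℤ) (ν : Fin (3 + 1)) (y' : Fin (3 + 1) → ℤ), ∀ B : ℕ, ∀ (b : (↥(pbox (fine Lc (Mc B))) × Fin (3 + 1))) (a : (↥(pbox (Mc B)) × Fin (3 + 1))), (perF (fine Lc (Mc B)) (dper (fine Lc (Mc B)) ((𝒲bG (n + 1)) B μ y ν y'))) (b.1, Sum.inl b.2) (((coarsePt (Mc B) Lc a.1, Sum.inr (a.2)) : Idx (fine Lc (Mc B)) (Fib 3))) = -(perF (fine Lc (Mc B)) (dper (fine Lc (Mc B)) ((𝒲bG (n + 1)) B μ y ν y'))) (((coarsePt (Mc B) Lc a.1, Sum.inr (a.2)) : Idx (fine Lc (Mc B)) (Fib 3))) (b.1, Sum.inl b.2))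
    (hHG₁ : ∀ (n : ℕ) (μ : Fin (3 + 1)) (y : Fin (3 + 1) → ℤ), ∀ B : ℕ, (∏ i ∈ range (n + 1), wVH 3 Lc ((n + 1 - i))) • (Gw₁f n) B ((dv n) B (μ, y)) = (perF (fine Lc (Mc B)) (dper (fine Lc (Mc B)) ((𝒱G (n + 1)) μ y))).submatrix (fun b : (↥(pbox (fine Lc (Mc B))) × Fin (3 + 1)) => ((b.1, Sum.inl b.2) : Idx (fine Lc (Mc B)) (Fib 3))) (fun b : (↥(pbox (fine Lc (Mc B))) × Fin (3 + 1)) => ((b.1, Sum.inl b.2) : Idx (fine Lc (Mc B)) (Fib 3))))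
    (hQG₁ : ∀ (n : ℕ) (μ : Fin (3 + 1)) (y : Fin (3 + 1) → ℤ), ∀ B : ℕ, (Q₂₁f n) B ((dv n) B (μ, y)) = (perF (fine Lc (Mc B)) (dper (fine Lc (Mc B)) ((𝒱G (n + 1)) μ y))).submatrix (fun a : (↥(pbox (Mc B)) × Fin (3 + 1)) => (((coarsePt (Mc B) Lc a.1, Sum.inr (a.2)) : Idx (fine Lc (Mc B)) (Fib 3)))) (fun b : (↥(pbox (fine Lc (Mc B))) × Fin (3 + 1)) => ((b.1, Sum.inl b.2) : Idx (fine Lc (Mc B)) (Fib 3))))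
    (hHG₂ : ∀ (n : ℕ) (μ : Fin (3 + 1)) (y : Fin (3 + 1) → ℤ) (ν : Fin (3 + 1)) (y' : Fin (3 + 1) → ℤ), ∀ B : ℕ, (∏ i ∈ range (n + 1), wVH 3 Lc ((n + 1 - i))) • ((1 / 2 : ℝ) • ((Gw₂f n) B ((dv n) B (μ, y)) ((dv n) B (ν, y')) + (Gw₂f n) B ((dv n) B (ν, y')) ((dv n) B (μ, y)))) = (perF (fine Lc (Mc B)) (dper (fine Lc (Mc B)) ((𝒲bG (n + 1)) B μ y ν y'))).submatrix (fun b : (↥(pbox (fine Lc (Mc B))) × Fin (3 + 1)) => ((b.1, Sum.inl b.2) : Idx (fine Lc (Mc B)) (Fib 3))) (fun b : (↥(pbox (fine Lc (Mc B))) × Fin (3 + 1)) => ((b.1, Sum.inl b.2) : Idx (fine Lc (Mc B)) (Fib 3))))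
    (hQG₂ : ∀ (n : ℕ) (μ : Fin (3 + 1)) (y : Fin (3 + 1) → ℤ) (ν : Fin (3 + 1)) (y' : Fin (3 + 1) → ℤ), ∀ B : ℕ, (1 / 2 : ℝ) • ((Q₂₂f n) B ((dv n) B (μ, y)) ((dv n) B (ν, y')) + (Q₂₂f n) B ((dv n) B (ν, y')) ((dv n) B (μ, y))) = (perF (fine Lc (Mc B)) (dper (fine Lc (Mc B)) ((𝒲bG (n + 1)) B μ y ν y'))).submatrix (fun a : (↥(pbox (Mc B)) × Fin (3 + 1)) => (((coarsePt (Mc B) Lc a.1, Sum.inr (a.2)) : Idx (fine Lc (Mc B)) (Fib 3)))) (fun b : (↥(pbox (fine Lc (Mc B))) × Fin (3 + 1)) => ((b.1, Sum.inl b.2) : Idx (fine Lc (Mc B)) (Fib 3))))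
    -- END-Comp's other rows, VERBATIM (the anchor storey, the TRANSPORT clause, the top-step identification at `GcombSh Lc j`, (T0)(T1))
    (hF₁ : ∀ (μ ν : Fin 4) (z : Fin 4 → ℤ), hessKer (AF 1) (𝒱F 1) (𝒲F 1) μ ν z = (Lc : ℝ) ^ 8 * dressedEntry (wStep Lc 1) (TshotOf Lc (JcSymLG (Roots.ctr Lc) Pn hLc N cΛ cB) 1) ((Lc : ℤ) • z) μ ν)
    (htr : ∀ j : ℕ, 1 ≤ j → ∀ (μ ν : Fin 4) (z : Fin 4 → ℤ), hessKer (AF (j + 1)) (𝒱F (j + 1)) (𝒲F (j + 1)) μ ν z = (Lc : ℝ) ^ 8 * dressedEntry (wStep Lc (j + 1)) (hessKer (ANs (Roots.ctr Lc) (ΨL (Roots.ctr Lc)) j) (VNs (Roots.ctr Lc) (ΨL (Roots.ctr Lc)) (hΨsL (Roots.ctr Lc)) Pn j) (WNsG (Roots.ctr Lc) (ΨL (Roots.ctr Lc)) (hΨsL (Roots.ctr Lc)) Pn j)) ((Lc : ℤ) • z) μ ν)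
    (hG : ∀ j : ℕ, 1 ≤ j → ∀ (μ ν : Fin 4) (z : Fin 4 → ℤ), hessKer (GcombSh (d := 3) Lc j) (𝒱G j) (𝒲G j) μ ν z = TbalOf Lc (JsB12CombShSym hLc N (symTablesAn1S2 3 Lc cΛ) cΛ cB) j μ ν z) (hT0 : ∀ j (c e : Fin 4), HasSum (TbalOf Lc (JsB12CombShSym hLc N (symTablesAn1S2 3 Lc cΛ) cΛ cB) j c e) 0)
    (hT1 : ∀ j (c e ρ : Fin 4), HasSum (fun t : Fin 4 → ℤ => t ρ • TbalOf Lc (JsB12CombShSym hLc N (symTablesAn1S2 3 Lc cΛ) cΛ cB) j c e t) 0)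
    -- v10: THE END's DOOR ROWS = p670056 §5's PAIRING LETTERS (storey-indexed): the door tadpole displayed as the covariant symmetrised pairing of read-out columns `Sd j` and door-word functionals `τd j` at gauge data `lamd j` (`cz eu`; covariance `hSd hτd`,
    -- summable cut `hSda hτda`); (U) `hΘ` no door word on the summed gauge column, (C) `hdiv` read-out columns co-closed, (R) mirrors `Rf j ν ρ`, offsets `kf`, (X) `hX` the identification — the row's stubs U∕C∕R∕X (J-NOTE-19 §4), DISPLAYED
    {Vd : ℕ → Type*} [∀ j, AddCommGroup (Vd j)] [∀ j, Module ℝ (Vd j)] (Sd : ℕ → Fin (3 + 1) → Site (3 + 1) → Fin (3 + 1) → Site (3 + 1) → ℝ) (τd : ∀ j : ℕ, Fin (3 + 1) → Site (3 + 1) → Vd j →ₗ[ℝ] ℝ) (lamd : ∀ j : ℕ, Fin (3 + 1) → Site (3 + 1) → Vd j)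
    (cz : Fin (3 + 1) → Site (3 + 1) →+ ℝ) (hcz : ∀ (ρ : Fin (3 + 1)) (z : Site (3 + 1)), cz ρ z = (z ρ : ℝ)) (eu : Fin (3 + 1) → Site (3 + 1)) (heu : ∀ (ρ κ : Fin (3 + 1)), cz ρ (eu κ) = if κ = ρ then 1 else 0)
    (hSd : ∀ j (ν : Fin (3 + 1)) (z : Site (3 + 1)) (κ : Fin (3 + 1)) (y : Site (3 + 1)), Sd j ν z κ y = Sd j ν 0 κ (y - z)) (hτd : ∀ j (κ : Fin (3 + 1)) (y : Site (3 + 1)) (μ : Fin (3 + 1)) (z : Site (3 + 1)), τd j κ y (lamd j μ z) = τd j κ (y - z) (lamd j μ 0))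
    (hSda : ∀ j (ν κ : Fin (3 + 1)), AbsMoment₂ (fun w => Sd j ν 0 κ w)) (hτda : ∀ j (κ μ : Fin (3 + 1)), AbsMoment₂ (fun y => τd j κ y (lamd j μ 0))) (hΘ : ∀ j (κ μ : Fin (3 + 1)), ∑' y, τd j κ y (lamd j μ 0) = 0)
    (hdiv : ∀ j (ν : Fin (3 + 1)) (y : Site (3 + 1)), ∑ κ, (Sd j ν 0 κ y - Sd j ν 0 κ (y - eu κ)) = 0) (Rf : ℕ → Fin (3 + 1) → Fin (3 + 1) → Site (3 + 1) ≃ Site (3 + 1)) (kf : ℕ → Fin (3 + 1) → Fin (3 + 1) → ℝ)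
    (hRA : ∀ j (ν ρ : Fin (3 + 1)), ρ ≠ ν → ∀ κ, κ ≠ ρ → ∀ w, Sd j ν 0 κ (Rf j ν ρ w) = Sd j ν 0 κ w) (hRc : ∀ j (ν ρ : Fin (3 + 1)), ρ ≠ ν → ∀ w, cz ρ (Rf j ν ρ w) = kf j ν ρ - cz ρ w)
    (hX : ∀ j : ℕ, 1 ≤ j → ∀ (μ ν : Fin (3 + 1)) (z : Site (3 + 1)), tadpole (ANs (Roots.ctr Lc) (ΨL (Roots.ctr Lc)) j) (𝒲Δ j μ 0 ν z) = ∑ κ, ∑' y, (Sd j ν z κ y * τd j κ y (lamd j μ 0) + Sd j μ 0 κ y * τd j κ y (lamd j ν z))) :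
    D1Tel Lc (JsB12CombShSym hLc N (symTablesAn1S2 3 Lc cΛ) cΛ cB) (JcSymLG (Roots.ctr Lc) Pn hLc N cΛ cB) := by
  -- S-END: v10's proof VERBATIM under the σ of `S-END-RECIPE-g71.md` §1–§2 — objects `AN ↦ ANs R Ψ̂ˢ`, `VN∕WN ↦ VNA∕WNAG … (ANs …)` (= S-L1 `VNs∕WNsG`, `rfl`), `JcComp ↦ JcSymLG`; the 28 chart-lettered
  -- suppliers ↦ their LANDED twins (road R-C1∕3∕4∕7∕10∕12∕13∕15∕16∕17∕19, row `NVertex*ChartGeneric`, S-L1), each generic twin's chart letters FED BY NAME: `hA := decays_ANs` (S-L1 ⟸ F-L1 `spr_psiKSym`),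
  -- `hAt := shiftK_ANs_sym`, `hAσ := trK_ANs_sym` (row `NVertexChartSymLetters`), `hE := curvAdj_curv_colH_ANs`, `hmm := ANs_inr_inr_smul` (row F-L7b `NVertexColumnK1RowSym`) — theorems, NOT displayed.
  have hL0 : 0 < Lc := Nat.pos_of_ne_zero (NeZero.ne Lc)
  have hL1 : 1 ≤ Lc := hL0
  have hAd : ∀ n : ℕ, ∃ δ C : ℝ, 0 < δ ∧ 0 ≤ C ∧ Decays (ANs (Roots.ctr Lc) (ΨL (Roots.ctr Lc)) (n + 1)) C δ := fun n => decays_ANs (Roots.ctr Lc) (ΨL (Roots.ctr Lc)) (hΨsL (Roots.ctr Lc)) (n + 1)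
  have hAt : ∀ (n : ℕ) (t : Site (3 + 1)), shiftK (-(((Lc ^ (n + 1 + 1) : ℕ) : ℤ) • t)) (ANs (Roots.ctr Lc) (ΨL (Roots.ctr Lc)) (n + 1)) = ANs (Roots.ctr Lc) (ΨL (Roots.ctr Lc)) (n + 1) := fun n t => shiftK_ANs_sym (Roots.ctr Lc) (n + 1) t
  have hAσ : ∀ n : ℕ, trK (ANs (Roots.ctr Lc) (ΨL (Roots.ctr Lc)) (n + 1)) = sgnK (ANs (Roots.ctr Lc) (ΨL (Roots.ctr Lc)) (n + 1)) := fun n => trK_ANs_sym (Roots.ctr Lc) (n + 1)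
  have hfold : ∀ n : ℕ, ∀ B : ℕ, ∀ (μ : Fin (3 + 1)) (y : Site (3 + 1)) (κ₁ : Fin (3 + 1)) (s₁ : Site (3 + 1)), ∑ ā : ↥(pbox (towerTorus Lc (fine Lc (Mc B)) (n + 1))) × Fin (3 + 1), perF (towerTorus Lc (fine Lc (Mc B)) (n + 1)) (ANs (Roots.ctr Lc) (ΨL (Roots.ctr Lc)) (n + 1)) (ā.1, Sum.inl ā.2) (wrapPt (towerTorus Lc (fine Lc (Mc B)) (n + 1)) (((Lc ^ (n + 1 + 1) : ℕ) : ℤ) • y), Sum.inr μ) * (∑' m : Site (3 + 1), ∑ ν : Fin (3 + 1), ∑' w : Site (3 + 1), lamCoeffOf (KInv (N := Lc ^ (n + 1 + 1)) (d := 3)) (Lc ^ (n + 1 + 1)) ν w ā.2 (ā.1 : Site (3 + 1)) * compLinKer (fun _ => symLinKerAt (toSite (Roots.ctr Lc).r) Lc) Lc (n + 1) (κ₁, translate (towerTorus Lc (Mc B) (n + 1)) s₁ m) (ν, w)) = ∑' m : Site (3 + 1), ∑ ν : Fin (3 + 1), ∑' w : Site (3 + 1), (∑ κ' : Fin (3 +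 1), ∑' u' : Site (3 + 1), ANs (Roots.ctr Lc) (ΨL (Roots.ctr Lc)) (n + 1) u' (((Lc ^ (n + 1 + 1) : ℕ) : ℤ) • y) (Sum.inl κ') (Sum.inr μ) * lamCoeffOf (KInv (N := Lc ^ (n + 1 + 1)) (d := 3)) (Lc ^ (n + 1 + 1)) ν w κ' u') * compLinKer (fun _ => symLinKerAt (toSite (Roots.ctr Lc).r) Lc) Lc (n + 1) (κ₁, translate (towerTorus Lc (Mc B) (n + 1)) s₁ m) (ν, w) := fun n B μ y κ₁ s₁ => sum_perF_A_mul_periodised_cf_eq_tower (R := Roots.ctr Lc) (j := n + 1) (A := ANs (Roots.ctr Lc) (ΨL (Roots.ctr Lc)) (n + 1)) (hA := hAd n) (hAt := hAt n) (Mc B) μ κ₁ y s₁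
  have hlv : ∀ n : ℕ, ∀ B : ℕ, ∀ (r : ℝ) (x y : ((↥(pbox (Mc B)) × Fin (3 + 1)) → ℝ)), ((lv n) B) (r • x + y) = r • ((lv n) B) x + ((lv n) B) y := by
    intro n B r' x y; funext s; simp only [Pi.add_apply, Pi.smul_apply, smul_eq_mul]; rw [(hlve n) B, (hlve n) B, (hlve n) B, show ((hv n) B) (r' • x + y) = r' • ((hv n) B) x + ((hv n) B) y from (by rw [(hhv n) B, (hhv n) B, (hhv n) B]; exact nestedColumn_linear _ _ r' x y)]
    simp only [Matrix.mulVec_add, Matrix.mulVec_smul, Pi.add_apply, Pi.smul_apply, smul_eq_mul]; rw [← Finset.sum_neg_distrib, ← Finset.sum_neg_distrib, ← Finset.sum_neg_distrib, Finset.mul_sum, ← Finset.sum_add_distrib]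
    exact Finset.sum_congr rfl fun x _ => by split_ifs <;> ring
  have hsn1 : ∀ n : ℕ, (1 : ℝ) ≤ sn n := fun n => by rw [hsn n]; exact one_le_prod_stepScale Lc (n + 1 + 1)
  have hsn0 : ∀ n : ℕ, sn n ≠ 0 := fun n => (lt_of_lt_of_le one_pos (hsn1 n)).ne'
  have hvl : ∀ n : ℕ, ∀ B : ℕ, ∀ (r : ℝ) (x y : ((↥(pbox (Mc B)) × Fin (3 + 1)) → ℝ)), ((hv n) B) (r • x + y) = r • ((hv n) B) x + ((hv n) B) y := fun n B r' x' y' => by rw [(hhv n) B, (hhv n) B, (hhv n) B]; exact nestedColumn_linear _ _ r' x' y'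
  have hvl8 : ∀ n : ℕ, ∀ B : ℕ, ∀ (r : ℝ) (x y : ((↥(pbox (Mc B)) × Fin (3 + 1)) → ℝ)), ((hv n) B) ((sn n) • (r • x + y)) = r • ((hv n) B) ((sn n) • x) + ((hv n) B) ((sn n) • y) := fun n B => lin_comp_smul ((hv n) B) ((hvl n) B) (sn n)
  have hhb8 := fun (n : ℕ) (B : ℕ) => hb_rescale_of_sigmaA (Roots.ctr Lc) n (Mc B) (ANs (Roots.ctr Lc) (ΨL (Roots.ctr Lc)) (n + 1)) (fun a : ↥(pbox (Mc B)) × Fin (3 + 1) => (a.1 : Site (3 + 1))) (fun a : ↥(pbox (Mc B)) × Fin (3 + 1) => a.2) ((hv n) B) ((hb n) B) (hsn0 n) ((hhbe n) B)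
  have hbtop8 : ∀ n : ℕ, ∀ B : ℕ, ∀ v : ((↥(pbox (Mc B)) × Fin (3 + 1)) → ℝ), ((hb n) B) (n + 1) ((sn n) • v) = ((hv n) B) ((sn n) • v) := fun n B v => by funext ā; rw [hhb8 n B, if_pos rfl, wrapPt_of_mem]
  have hσσ : ∀ n : ℕ, ∀ a : Fib 3, (Sum.elim (fun _ : Fin (3 + 1) => (1 : ℝ)) (fun _ : Fin (3 + 1) => (sn n)⁻¹)) a * (Sum.elim (fun _ : Fin (3 + 1) => (1 : ℝ)) (fun _ : Fin (3 + 1) => (sn n))) a = 1 := fun n a => fibreScale_mul_inv (hsn0 n) a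
  have hcVHd : ∀ n : ℕ, 2 * (⟨Pn.cM, Pn.cE, fun m => (∏ ℓ ∈ range m, stepScale 3 Lc ℓ) * Pn.cVH m, Pn.cΛ, Pn.cE₂, fun m => (∏ ℓ ∈ range m, stepScale 3 Lc ℓ) * Pn.cB m, Pn.T⟩ : Pins).cVH (n + 1 + 1) = -((∏ ℓ ∈ range (n + 1 + 1), (stepScale 3 Lc ℓ * (Lc : ℝ) ^ (3 + 1))) * (⟨Pn.cM, Pn.cE, fun m => (∏ ℓ ∈ range m, stepScale 3 Lc ℓ) * Pn.cVH m, Pn.cΛ, Pn.cE₂, fun m => (∏ ℓ ∈ range m, stepScale 3 Lc ℓ) * Pn.cB m, Pn.T⟩ : Pins).cE (n + 1 + 1)) := fun n => by rw [Finset.prod_mul_distrib, Finset.prod_const, Finset.card_range, show ((⟨Pn.cM, Pn.cE, fun m => (∏ ℓ ∈ range m, stepScale 3 Lc ℓ) * Pn.cVH m, Pn.cΛ, Pn.cE₂, fun m => (∏ ℓ ∈ range m, stepScale 3 Lc ℓ) * Pn.cB m, Pn.T⟩ : Pins)).cVH (n + 1 + 1) = (∏ ℓ ∈ range (n + 1 +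 1), stepScale 3 Lc ℓ) * Pn.cVH (n + 1 + 1) from rfl, show ((⟨Pn.cM, Pn.cE, fun m => (∏ ℓ ∈ range m, stepScale 3 Lc ℓ) * Pn.cVH m, Pn.cΛ, Pn.cE₂, fun m => (∏ ℓ ∈ range m, stepScale 3 Lc ℓ) * Pn.cB m, Pn.T⟩ : Pins)).cE (n + 1 + 1) = Pn.cE (n + 1 + 1) from rfl, mul_left_comm, hcVH n]; ring
  have hcBd : ∀ n : ℕ, (c n) ^ 2 * (r n) * (r n) * ∏ ℓ ∈ range (n + 1 + 1), (stepScale 3 Lc ℓ * ((box (3 + 1) Lc).card : ℝ)) = -((⟨Pn.cM, Pn.cE, fun m => (∏ ℓ ∈ range m, stepScale 3 Lc ℓ) * Pn.cVH m, Pn.cΛ, Pn.cE₂, fun m => (∏ ℓ ∈ range m, stepScale 3 Lc ℓ) * Pn.cB m, Pn.T⟩ : Pins).cB (n + 1 + 1)) := fun n => by rw [Finset.prod_mul_distrib, Finset.prod_const, Finset.card_range, show ((⟨Pn.cM, Pn.cE, fun m => (∏ ℓ ∈ range m, stepScale 3 Lc ℓ) * Pn.cVH m, Pn.cΛ, Pn.cE₂,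 fun m => (∏ ℓ ∈ range m, stepScale 3 Lc ℓ) * Pn.cB m, Pn.T⟩ : Pins)).cB (n + 1 + 1) = (∏ ℓ ∈ range (n + 1 + 1), stepScale 3 Lc ℓ) * Pn.cB (n + 1 + 1) from rfl]; linear_combination (∏ ℓ ∈ range (n + 1 + 1), stepScale 3 Lc ℓ) * hcB n
  have hJW : ∀ n : ℕ, ∀ B : ℕ, ∀ (a : ↥(pbox (Mc B)) × Fin (3 + 1)) (b : ↥(pbox (towerTorus Lc (fine Lc (Mc B)) (n + 1))) × Fin (3 + 1)), ((hv n) B) (Pi.single a 1) b = perF (towerTorus Lc (fine Lc (Mc B)) (n + 1)) (scaleK (Sum.elim (fun _ : Fin (3 + 1) => (1 : ℝ)) (fun _ : Fin (3 + 1) => (sn n)⁻¹)) (Sum.elim (fun _ : Fin (3 + 1) => (1 : ℝ)) (fun _ : Fin (3 + 1) => (sn n)⁻¹)) (ANs (Roots.ctr Lc) (ΨL (Roots.ctr Lc)) (n + 1))) (b.1, Sum.inl b.2) (wrapPt (towerTorus Lc (fine Lc (Mc B)) (n + 1)) (((Lc ^ (n + 1 + 1) : ℕ) : ℤ) • (a.1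 : Site (3 + 1))), Sum.inr a.2) - ∑ s : ↥(pbox (towerTorus Lc (fine Lc (Mc B)) (n + 1))), tgrad (towerTorus Lc (fine Lc (Mc B)) (n + 1)) (b.1, Sum.inl b.2) s * ((lv n) B) (Pi.single a 1) s := by
    intro n B a b; have h := hv_single_apply_eq_of_NLeg_sym (d := 3) (M' := fine Lc (Mc B)) (Lc := Lc) (lev := fun i : ℕ => n + 1 - i) (n := n) (fun _ => (ctrOff_mem_box (d := 3 + 1) (Nat.one_le_iff_ne_zero.mpr (NeZero.ne Lc)))) (fun i hi => by show n + 1 - i = n + 1 - (i + 1) + 1; omega) (fun i => ⟨Mc B i, rfl⟩) (fun a : ↥(pbox (Mc B)) × Fin (3 + 1) => coarsePt (Mc B) Lc a.1) (fun a : ↥(pbox (Mc B)) × Fin (3 + 1) => a.2) (coarseSlot_injective (Mc B)) (coarseSlot_range (Mc B)) ((hH₀ n) B) ((hQ₁₀ n) B) ((hτ₁ n) B) ((hτ₂ n) B) ((hQ₂₀ n) B) ((hW₀ n) B) ((hP n) B) ((h𝔔₀ n) B) ((hI n) B) ((hS n) B) ((hhv n) B) ((hXN n) B) (ρN n) (Lc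 ^ (n + 1 + 1)) (scaleK (Sum.elim (fun _ : Fin (3 + 1) => (1 : ℝ)) (fun _ : Fin (3 + 1) => (sn n)⁻¹)) (Sum.elim (fun _ : Fin (3 + 1) => (1 : ℝ)) (fun _ : Fin (3 + 1) => (sn n)⁻¹)) (ANs (Roots.ctr Lc) (ΨL (Roots.ctr Lc)) (n + 1))) ((fN n) B) ((hEAN n) B) ((hLN n) B) 1 a b
    simp only [one_smul, one_mul] at h; rw [h, (hfN n) B a]; exact congrArg₂ (· - ·) rfl (Finset.sum_congr rfl fun s _ => by rw [(hlve n) B])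
  have hJW8 : ∀ n : ℕ, ∀ B : ℕ, ∀ (a : ↥(pbox (Mc B)) × Fin (3 + 1)) (b : ↥(pbox (towerTorus Lc (fine Lc (Mc B)) (n + 1))) × Fin (3 + 1)), ((hv n) B) ((sn n) • (Pi.single a 1 : ((↥(pbox (Mc B)) × Fin (3 + 1)) → ℝ))) b = perF (towerTorus Lc (fine Lc (Mc B)) (n + 1)) (ANs (Roots.ctr Lc) (ΨL (Roots.ctr Lc)) (n + 1)) (b.1, Sum.inl b.2) (wrapPt (towerTorus Lc (fine Lc (Mc B)) (n + 1)) (((Lc ^ (n + 1 + 1) : ℕ) : ℤ) • (a.1 : Site (3 + 1))), Sum.inr a.2) - ∑ s : ↥(pbox (towerTorus Lc (fine Lc (Mc B)) (n + 1))), tgrad (towerTorus Lc (fine Lc (Mc B)) (n + 1)) (b.1, Sum.inl b.2) s * ((lv n) B) ((sn n) • (Pi.single a 1 : ((↥(pbox (Mc B)) × Fin (3 + 1)) → ℝ))) s := by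
    intro n B a b; rw [map_smul_of_lin ((hv n) B) ((hvl n) B) (sn n) (Pi.single a 1), Pi.smul_apply, smul_eq_mul, (hJW n) B a b, perF_scaleK_apply, map_smul_of_lin ((lv n) B) ((hlv n) B) (sn n) (Pi.single a 1)]
    simp only [Sum.elim_inl, Sum.elim_inr, one_mul, Pi.smul_apply, smul_eq_mul, mul_sub, Finset.mul_sum]; congr 1
    · rw [mul_comm, mul_assoc, inv_mul_cancel₀ (hsn0 n), mul_one]
    · exact Finset.sum_congr rfl fun x _ => by ring
  have hH2f8 : ∀ n : ℕ, ∀ B : ℕ, ∀ v v', ((H₂f n) B) ((sn n) • v) ((sn n) • v') = (-2 * (c n)) ^ 2 • ∑ b : ↥(pbox (towerTorus Lc (fine Lc (Mc B)) (n + 1))) × Fin (3 + 1), ∑ b' : ↥(pbox (towerTorus Lc (fine Lc (Mc B)) (n + 1))) × Fin (3 + 1), (((hv n) B) ((sn n) • v) b * ((hv n) B) ((sn n) • v') b') • ((T₂ n) B) b b' + ((sn n) * (cM₂ n)) • ∑ b : ↥(pbox (towerTorus Lc (fine Lc (Mc B)) (n + 1))) × Fin (3 + 1), ∑ β : ↥(pbox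 (Mc B)) × Fin (3 + 1), (((hv n) B) ((sn n) • v) b * ((hm n) B) v' β + ((hv n) B) ((sn n) • v') b * ((hm n) B) v β) • ((M₂ n) B) b β := by
    intro n B v v'; rw [(hH₂f n) B, map_smul_of_lin ((hm n) B) ((hml n) B) (sn n) v, map_smul_of_lin ((hm n) B) ((hml n) B) (sn n) v']; congr 1
    simp only [Pi.smul_apply, smul_eq_mul, Finset.smul_sum, smul_smul]; exact Finset.sum_congr rfl fun b _ => Finset.sum_congr rfl fun β _ => by congr 1; ring
  have hcf : ∀ n : ℕ, ∀ B : ℕ, ∀ k κ' u μ y, Summable fun m : Site (3 + 1) => (cf n) B k μ (translate (towerTorus Lc (Mc B) k) y m) κ' u := fun n B k κ' u μ y => cf_summable (R := Roots.ctr Lc) (n := n) (M := Mc B) (cfF := (cf n) B) (hcfF := (hcfe n) B) k κ' u μ y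
  have hκ : ∀ n : ℕ, ∀ k, k < n + 1 → (κ n) k = stepScale 3 Lc (n + 1 - (k + 1)) * ((box (3 + 1) Lc).card : ℝ) * (κ n) (k + 1) := fun n k hk => kappa_row n (κ n) (hκe n) k hk
  have hκn : ∀ n : ℕ, (κ n) (n + 1) = 1 := fun n => kappa_top n (κ n) (hκe n)
  have hbl8 : ∀ n : ℕ, ∀ B : ℕ, ∀ (k : ℕ) (r : ℝ) (x y : ((↥(pbox (Mc B)) × Fin (3 + 1)) → ℝ)), ((hb n) B) k ((sn n) • (r • x + y)) = r • ((hb n) B) k ((sn n) • x) + ((hb n) B) k ((sn n) • y) := fun n B k r' x' y' => by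
    -- `TowerHLinkRows.hb_linear`'s proof VERBATIM over `hhb8` (the generic re-typing `hb_linearA` is a gate duplicate of the tree's; g71 lesson: inline)
    funext ā; rw [Pi.add_apply, Pi.smul_apply, smul_eq_mul, hhb8 n B, hhb8 n B, hhb8 n B]
    by_cases hk : k = n + 1
    · rw [if_pos hk, if_pos hk, if_pos hk, (hvl8 n) B r' x' y', Pi.add_apply, Pi.smul_apply, smul_eq_mul]
    · rw [if_neg hk, if_neg hk, if_neg hk, Finset.mul_sum, ← Finset.sum_add_distrib]
      refine Finset.sum_congr rfl fun y₀ _ => ?_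
      split_ifs
      · simp only [Pi.add_apply, Pi.smul_apply, smul_eq_mul, add_mul, Finset.sum_add_distrib, mul_assoc, Finset.mul_sum]
      · simp
  have hbl : ∀ n : ℕ, ∀ B : ℕ, ∀ (k : ℕ) (r : ℝ) (x y : ((↥(pbox (Mc B)) × Fin (3 + 1)) → ℝ)), ((hb n) B) k (r • x + y) = r • ((hb n) B) k x + ((hb n) B) k y := fun n B k => lin_of_lin_comp_smul (((hb n) B) k) (hsn0 n) ((hbl8 n) B k)
  have hbtop : ∀ n : ℕ, ∀ B : ℕ, ∀ v, ((hb n) B) (n + 1) v = ((hv n) B) v := fun n B v => by funext ā; rw [(hhbe n) B, if_pos rfl, wrapPt_of_mem]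
  have K18 : ∀ n : ℕ, ∀ B : ℕ, ∀ v : ((↥(pbox (Mc B)) × Fin (3 + 1)) → ℝ), ∀ u : ↥(pbox (towerTorus Lc (fine Lc (Mc B)) (n + 1))) × Fin (3 + 1), (c n) * ((perF (towerTorus Lc (fine Lc (Mc B)) (n + 1)) (bhKStepAt 3 (toSite rH) Lc 0)).submatrix (fun b : ↥(pbox (towerTorus Lc (fine Lc (Mc B)) (n + 1))) × Fin (3 + 1) => ((b.1, Sum.inl b.2) : Idx (towerTorus Lc (fine Lc (Mc B)) (n + 1)) (Fib 3))) (fun b : ↥(pbox (towerTorus Lc (fine Lc (Mc B)) (n + 1))) × Fin (3 + 1) => ((b.1, Sum.inl b.2) : Idx (towerTorus Lc (fine Lc (Mc B)) (n + 1)) (Fib 3)))).mulVec (((hb n) B) (n + 1) ((sn n) • v)) u = (w n) (n + 1) * ∑ ā : ↥(pbox (towerTorus Lc (fine Lc (Mc B)) (n + 1))) × Fin (3 + 1), ((hb n) B) (n + 1) ((sn n) • v) ā * ∑ μ : Fin (3 + 1), ∑' y : Site (3 + 1), (∑' m : Site (3 + 1), (cf n) B (n + 1) μ (translate (towerTorus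 Lc (Mc B) (n + 1)) y m) ā.2 (ā.1 : Site (3 + 1))) * symLinKerAt (toSite (ctrOff (3 + 1) Lc)) Lc μ y (u.2, (u.1 : Site (3 + 1))) := fun n B v u => by rw [(hbtop8 n) B v]; exact K1_row_topA (R := Roots.ctr Lc) (n := n) (M := Mc B) (A := ANs (Roots.ctr Lc) (ΨL (Roots.ctr Lc)) (n + 1)) (hA := hAd n) (hAt := hAt n) (hE := curvAdj_curv_colH_ANs (Roots.ctr Lc) (n + 1)) (T' := towerTorus Lc (Mc B) (n + 1)) (hT' := fun i => towerTorus_fine_apply_eq (Mc B) (n + 1) i) (hrH := hrH) (ρH := toSite rH) (hρH := rfl) (c := c n) (w₁ := (w n) (n + 1)) (hw₁ := w_top n (c n) (κ n) (w n) (hκe n) (hwe n)) (cf₁ := (cf n) B (n + 1)) (hcf₁ := fun κ₁ s' κ' x => by rw [(hcfe n) B, if_pos rfl]) (yN := fun a : ↥(pbox (Mc B)) × Fin (3 + 1) => (a.1 : Site (3 + 1))) (μN := fun a : ↥(pbox (Mc B)) × Fin (3 + 1) => a.2) (hv := (fun v => ((hv n) B) ((sn n) • v))) (hhvl := ((hvl8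 n) B)) (lam := fun a => ((fun v => ((lv n) B) ((sn n) • v))) (Pi.single a 1)) (hJW := ((hJW8 n) B)) (hfold := (hfold n) B) v u
  have K1 : ∀ n : ℕ, ∀ B : ℕ, ∀ v : ((↥(pbox (Mc B)) × Fin (3 + 1)) → ℝ), ∀ u : ↥(pbox (towerTorus Lc (fine Lc (Mc B)) (n + 1))) × Fin (3 + 1), (c n) * ((perF (towerTorus Lc (fine Lc (Mc B)) (n + 1)) (bhKStepAt 3 (toSite rH) Lc 0)).submatrix (fun b : ↥(pbox (towerTorus Lc (fine Lc (Mc B)) (n + 1))) × Fin (3 + 1) => ((b.1, Sum.inl b.2) : Idx (towerTorus Lc (fine Lc (Mc B)) (n + 1)) (Fib 3))) (fun b : ↥(pbox (towerTorus Lc (fine Lc (Mc B)) (n + 1))) × Fin (3 + 1) => ((b.1, Sum.inl b.2) : Idx (towerTorus Lc (fine Lc (Mc B)) (n + 1)) (Fib 3)))).mulVec (((hb n) B) (n + 1) v) u = (w n) (n + 1) * ∑ ā : ↥(pbox (towerTorus Lc (fine Lc (Mc B)) (n + 1))) × Fin (3 + 1), ((hb n) B) (n + 1) v ā * ∑ μ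 : Fin (3 + 1), ∑' y : Site (3 + 1), (∑' m : Site (3 + 1), (cf n) B (n + 1) μ (translate (towerTorus Lc (Mc B) (n + 1)) y m) ā.2 (ā.1 : Site (3 + 1))) * symLinKerAt (toSite (ctrOff (3 + 1) Lc)) Lc μ y (u.2, (u.1 : Site (3 + 1))) := fun n B v u => by simpa only [smul_inv_smul₀ (hsn0 n)] using (K18 n) B ((sn n)⁻¹ • v) u
  have hlink8 : ∀ n : ℕ, ∀ B : ℕ, ∀ v : ((↥(pbox (Mc B)) × Fin (3 + 1)) → ℝ), ∀ k, k < n + 1 → ∀ a : ↥(pbox (towerTorus Lc (fine Lc (Mc B)) k)) × Fin (3 + 1), (w n) k * (κ n) k * (∑ ā : ↥(pbox (towerTorus Lc (fine Lc (Mc B)) k)) × Fin (3 + 1), ((hb n) B) k ((sn n) • v) ā * ∑ μ : Fin (3 + 1), ∑' y : Site (3 + 1), (∑' m : Site (3 + 1), (cf n) B k μ (translate (towerTorus Lc (Mc B) k) y m) ā.2 (ā.1 : Site (3 + 1))) * symLinKerAt (toSite (ctrOff (3 + 1) Lc)) Lc μ y (a.2, (a.1 : Site (3 + 1)))) = (w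 n) (k + 1) * (κ n) (k + 1) / (stepScale 3 Lc (n + 1 - (k + 1)) * (Lc : ℝ) ^ (3 + 1)) * ∑ ā : ↥(pbox (towerTorus Lc (fine Lc (Mc B)) (k + 1))) × Fin (3 + 1), ((hb n) B) (k + 1) ((sn n) • v) ā * ∑' m : Site (3 + 1), (cf n) B (k + 1) a.2 (translate (towerTorus Lc (fine Lc (Mc B)) k) (a.1 : Site (3 + 1)) m) ā.2 (ā.1 : Site (3 + 1)) := fun n B v k hk a => hlink_rowA (R := Roots.ctr Lc) (n := n) (M := Mc B) (A := ANs (Roots.ctr Lc) (ΨL (Roots.ctr Lc)) (n + 1)) (hA := hAd n) (yN := fun a : ↥(pbox (Mc B)) × Fin (3 + 1) => (a.1 : Site (3 + 1))) (μN := fun a : ↥(pbox (Mc B)) × Fin (3 + 1) => a.2) (hv := (fun v => ((hv n) B) ((sn n) • v))) (cfF := (cf n) B) (hcfF := (hcfe n) B) (hbF := (fun k v => ((hb n) B) k ((sn n) • v))) (hhbF := hhb8 n B) (c := c n) (κF := κ n) (wF := w n) (hκF := hκe n) (hwF := hwe n) (T' := towerTorus Lc (Mc B) (n + 1)) (hT'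 := fun i => towerTorus_fine_apply_eq (Mc B) (n + 1) i) (hhvl := ((hvl8 n) B)) (lam := fun a => ((fun v => ((lv n) B) ((sn n) • v))) (Pi.single a 1)) (hJW := ((hJW8 n) B)) (hfold := (hfold n) B) v k hk a
  have hlink : ∀ n : ℕ, ∀ B : ℕ, ∀ v : ((↥(pbox (Mc B)) × Fin (3 + 1)) → ℝ), ∀ k, k < n + 1 → ∀ a : ↥(pbox (towerTorus Lc (fine Lc (Mc B)) k)) × Fin (3 + 1), (w n) k * (κ n) k * (∑ ā : ↥(pbox (towerTorus Lc (fine Lc (Mc B)) k)) × Fin (3 + 1), ((hb n) B) k v ā * ∑ μ : Fin (3 + 1), ∑' y : Site (3 + 1), (∑' m : Site (3 + 1), (cf n) B k μ (translate (towerTorus Lc (Mc B) k) y m) ā.2 (ā.1 : Site (3 + 1))) * symLinKerAt (toSite (ctrOff (3 + 1) Lc)) Lc μ y (a.2, (a.1 : Site (3 + 1)))) = (w n) (k + 1) * (κ n) (k + 1) / (stepScale 3 Lc (n + 1 - (k + 1)) * (Lc : ℝ) ^ (3 + 1)) * ∑ ā : ↥(pbox (towerTorus Lc (fine Lc (Mc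 B)) (k + 1))) × Fin (3 + 1), ((hb n) B) (k + 1) v ā * ∑' m : Site (3 + 1), (cf n) B (k + 1) a.2 (translate (towerTorus Lc (fine Lc (Mc B)) k) (a.1 : Site (3 + 1)) m) ā.2 (ā.1 : Site (3 + 1)) := fun n B v k hk a => by simpa only [smul_inv_smul₀ (hsn0 n)] using (hlink8 n) B ((sn n)⁻¹ • v) k hk a
  have hXbfl : ∀ n : ℕ, ∀ B : ℕ, ∀ (r : ℝ) (x y : ((↥(pbox (Mc B)) × Fin (3 + 1)) → ℝ)), ((Xbf n) B) (r • x + y) = r • ((Xbf n) B) x + ((Xbf n) B) y := fun n B => Xbf_linear_of_pin (c n) ((lv n) B) ((hlv n) B) (fun a : ↥(pbox (Mc B)) × Fin (3 + 1) => itRoot Lc (Mc B) (fun _ : ℕ => ctrOff (3 + 1) Lc) (fun _ => (ctrOff_mem_box (d := 3 + 1) (Nat.one_le_iff_ne_zero.mpr (NeZero.ne Lc)))) (n + 1 + 1) a.1) ((Xbf n) B) ((hXbf n) B)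
  have hH₂l : ∀ n : ℕ, ∀ B : ℕ, ∀ (r : ℝ) (x y z : ((↥(pbox (Mc B)) × Fin (3 + 1)) → ℝ)), ((H₂f n) B) (r • x + y) z = r • ((H₂f n) B) x z + ((H₂f n) B) y z := fun n B => H2f_linear_left (M := Mc B) (n := n) (c := c n) (hv := (hv n) B) (hhvl := ((hvl n) B)) (T₂ := (T₂ n) B) (hm := (hm n) B) (hml := (hml n) B) (M₂ := (M₂ n) B) (cM₂ := cM₂ n) (H₂f := (H₂f n) B) (hH₂f := (hH₂f n) B)
  have hH₂r : ∀ n : ℕ, ∀ B : ℕ, ∀ (r : ℝ) (x y z : ((↥(pbox (Mc B)) × Fin (3 + 1)) → ℝ)), ((H₂f n) B) z (r • x + y) = r • ((H₂f n) B) z x + ((H₂f n) B) z y := fun n B => H2f_linear_right (M := Mc B) (n := n) (c := c n) (hv := (hv n) B) (hhvl := ((hvl n) B)) (T₂ := (T₂ n) B) (hm := (hm n) B) (hml := (hml n) B) (M₂ := (M₂ n) B) (cM₂ := cM₂ n) (H₂f := (H₂f n) B) (hH₂f := (hH₂f n) B)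
  have hH₂t : ∀ n : ℕ, ∀ B : ℕ, ∀ v, (((H₂f n) B) v v)ᵀ = ((H₂f n) B) v v := fun n B => H2f_transpose (M := Mc B) (n := n) (c := c n) (Pn := Pn) (hv := (hv n) B) (T₂ := (T₂ n) B) (hT₂ := (hT₂ n) B) (hm := (hm n) B) (M₂ := (M₂ n) B) (hM₂ := (hM₂ n) B) (cM₂ := cM₂ n) (H₂f := (H₂f n) B) (hH₂f := (hH₂f n) B)
  have hfNi : ∀ n : ℕ, ∀ B : ℕ, Function.Injective ((fN n) B) := fun n B => by rw [show (fN n) B = _ from funext ((hfN n) B)]; exact towerSlot_injective (Mc B) n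
  have hmN : ∀ n : ℕ, ∀ B : ℕ, ∀ a : (↥(pbox (Mc B)) × Fin (3 + 1)), ∃ m : Fin (3 + 1), ((fN n) B a).2 = Sum.inr m := fun n B a => by rw [(hfN n) B a]; exact ⟨a.2, rfl⟩
  have hcN : ∀ n : ℕ, ∀ B : ℕ, ∀ (s : ↥(pbox (towerTorus Lc (fine Lc (Mc B)) (n + 1)))) (m : Fin (3 + 1)), ((s, Sum.inr m) : Idx (towerTorus Lc (fine Lc (Mc B)) (n + 1)) (Fib 3)) ∈ Set.range ((fN n) B) ↔ Torus.proj (Lc ^ (n + 1 + 1)) (s : Site (3 + 1)) = 0 := fun n B s m => by rw [show (fN n) B = _ from funext ((hfN n) B)]; exact towerSlot_range (Mc B) n s m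
  have hHN₁ : ∀ (n : ℕ) (μ : Fin (3 + 1)) (y : Fin (3 + 1) → ℤ), ∀ B : ℕ, (H'₁f n) B ((dv n) B (μ, y)) = (perF (towerTorus Lc (fine Lc (Mc B)) (n + 1)) (dper (towerTorus Lc (fine Lc (Mc B)) (n + 1)) (scaleK (Sum.elim (fun _ : Fin (3 + 1) => (1 : ℝ)) (fun _ : Fin (3 + 1) => (sn n))) (Sum.elim (fun _ : Fin (3 + 1) => (1 : ℝ)) (fun _ : Fin (3 + 1) => (sn n))) (VNA (Roots.ctr Lc) Pn (ANs (Roots.ctr Lc) (ΨL (Roots.ctr Lc)) (n + 1)) (n + 1) μ y)))).submatrix (fun b : ↥(pbox (towerTorus Lc (fine Lc (Mc B)) (n + 1))) × Fin (3 + 1) => ((b.1, Sum.inl b.2) : Idx (towerTorus Lc (fine Lc (Mc B)) (n + 1)) (Fib 3))) (fun b : ↥(pbox (towerTorus Lc (fine Lc (Mc B)) (n + 1))) × Fin (3 + 1) => ((b.1, Sum.inl b.2) : Idx (towerTorus Lc (fine Lc (Mc B)) (n + 1)) (Fib 3))) := fun n μ y B => by rw [(hdv n) B μ y, mul_smul,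 submatrix_ff_perF_dper_fibScale]; exact hHN1_family_of_road_dataA (n := n) (M := Mc B) (A := ANs (Roots.ctr Lc) (ΨL (Roots.ctr Lc)) (n + 1)) (hA := hAd n) (hAt := hAt n) (P := Pn) (N₁ := N) (lev := fun i : ℕ => n + 1 - i) (hlev := fun i _ => rfl) (rs := fun _ : ℕ => ctrOff (3 + 1) Lc) (c := c n) (hv := (fun v => ((hv n) B) ((sn n) • v))) (hhvl := ((hvl8 n) B)) (lv := (fun v => ((lv n) B) ((sn n) • v))) (hlv := (lin_comp_smul ((lv n) B) ((hlv n) B) (sn n))) (hJW := ((hJW8 n) B)) (r := r n) (hr := hr n) (dv := (fun p : Fin (3 + 1) × (Fin (3 + 1) → ℤ) => (r n) • (Pi.single (wrapPt (Mc B) p.2, p.1) (1 : ℝ) : ((↥(pbox (Mc B)) × Fin (3 + 1)) → ℝ)))) (hdv := (fun μ y => rfl)) (cfF := (cf n) B) (hcfF := (hcfe n) B) (hbF := (fun k v => ((hb n) B) k ((sn n) • v))) (hhbF := hhb8 n B) (κF := κ n) (wF := w n) (hκF := hκe n) (hwF := hwe n) (T' := towerTorus Lc (Mc B) (n + 1))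 (hT' := fun i => towerTorus_fine_apply_eq (Mc B) (n + 1) i) (hfold := (hfold n) B) (hcΛ := hcΛ n) (hH₀ := by rw [(hH₀ n) B, Nat.sub_self]) (hLc := hLc2) (H₁f := (fun v => ((H₁f n) B) ((sn n) • v))) (H'₁f := (fun v => ((H'₁f n) B) ((sn n) • v))) (hH₁f := (fun v => (hH₁f n) B ((sn n) • v))) (hH'₁f := (fun v => (hH'₁f n) B ((sn n) • v))) μ y
  have hQN₁ : ∀ (n : ℕ) (μ : Fin (3 + 1)) (y : Fin (3 + 1) → ℤ), ∀ B : ℕ, (𝔔'₁f n) B ((dv n) B (μ, y)) = (perF (towerTorus Lc (fine Lc (Mc B)) (n + 1)) (dper (towerTorus Lc (fine Lc (Mc B)) (n + 1)) (scaleK (Sum.elim (fun _ : Fin (3 + 1) => (1 : ℝ)) (fun _ : Fin (3 + 1) => (sn n))) (Sum.elim (fun _ : Fin (3 + 1) => (1 : ℝ)) (fun _ : Fin (3 + 1) => (sn n))) (VNA (Roots.ctr Lc) Pn (ANs (Roots.ctr Lc) (ΨL (Roots.ctr Lc)) (n + 1)) (n + 1) μ y)))).submatrix ((fN n) B) (fun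 b : ↥(pbox (towerTorus Lc (fine Lc (Mc B)) (n + 1))) × Fin (3 + 1) => ((b.1, Sum.inl b.2) : Idx (towerTorus Lc (fine Lc (Mc B)) (n + 1)) (Fib 3))) := fun n μ y B => by rw [(hdv n) B μ y, mul_smul, submatrix_perF_dper_fibScale_of_inr _ _ _ _ ((hmN n) B), ← submatrix_perF_dper_VNA_of_cVH (Roots.ctr Lc) Pn (⟨Pn.cM, Pn.cE, fun m => (∏ ℓ ∈ range m, stepScale 3 Lc ℓ) * Pn.cVH m, Pn.cΛ, Pn.cE₂, fun m => (∏ ℓ ∈ range m, stepScale 3 Lc ℓ) * Pn.cB m, Pn.T⟩ : Pins) (n + 1) (towerTorus Lc (fine Lc (Mc B)) (n + 1)) (ANs (Roots.ctr Lc) (ΨL (Roots.ctr Lc)) (n + 1)) (hAd n) (t := sn n) (by rw [hsn n]) ((fN n) B) ((hmN n) B) (fun b : ↥(pbox (towerTorus Lc (fine Lc (Mc B)) (n + 1))) × Fin (3 + 1) => ((b.1, Sum.inl b.2) : Idx (towerTorus Lc (fine Lc (Mc B)) (n + 1)) (Fib 3))) μ y]; exact hQN1_family_of_road_dataA (n :=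 n) (M := Mc B) (A := ANs (Roots.ctr Lc) (ΨL (Roots.ctr Lc)) (n + 1)) (hA := hAd n) (hAt := hAt n) (P := (⟨Pn.cM, Pn.cE, fun m => (∏ ℓ ∈ range m, stepScale 3 Lc ℓ) * Pn.cVH m, Pn.cΛ, Pn.cE₂, fun m => (∏ ℓ ∈ range m, stepScale 3 Lc ℓ) * Pn.cB m, Pn.T⟩ : Pins)) (c := c n) (hc := (ctrOff_mem_box (d := 3 + 1) (Nat.one_le_iff_ne_zero.mpr (NeZero.ne Lc)))) (hv := (fun v => ((hv n) B) ((sn n) • v))) (hhvl := ((hvl8 n) B)) (lv := (fun v => ((lv n) B) ((sn n) • v))) (hlv := (lin_comp_smul ((lv n) B) ((hlv n) B) (sn n))) (hJW := ((hJW8 n) B)) (r := r n) (hr := hr n) (dv := (fun p : Fin (3 + 1) × (Fin (3 + 1) → ℤ) => (r n) • (Pi.single (wrapPt (Mc B) p.2, p.1) (1 : ℝ) : ((↥(pbox (Mc B)) × Fin (3 + 1)) → ℝ)))) (hdv := (fun μ y => rfl)) (Q₁₀ := (Q₁₀ n) B) (hQ₁₀ := (hQ₁₀ n) B) (Q₂₀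 := (Q₂₀ n) B) (hQ₂₀ := (hQ₂₀ n) B) (Q₁₁f := (fun v => ((Q₁₁f n) B) ((sn n) • v))) (hQ₁₁f := (fun v => (hQ₁₁f n) B ((sn n) • v))) (Q₂₁f := (fun v => ((Q₂₁f n) B) ((sn n) • v))) (hQ₂₁f := (fun v => (hQ₂₁f n) B ((sn n) • v))) (𝔔₀ := (𝔔₀ n) B) (h𝔔₀ := (h𝔔₀ n) B) (𝔔₁f := (fun v => ((𝔔₁f n) B) ((sn n) • v))) (h𝔔₁ := (fun v => (h𝔔₁ n) B ((sn n) • v))) (Xbf := (fun v => ((Xbf n) B) ((sn n) • v))) (hXbf := (fun v => (hXbf n) B ((sn n) • v))) (𝔔'₁f := (fun v => ((𝔔'₁f n) B) ((sn n) • v))) (h𝔔'₁f := (fun v => (h𝔔'₁f n) B ((sn n) • v))) (fN := (fN n) B) (hfN := (hfN n) B) (hcVH := hcVHd n) μ y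
  have hHN₂ : ∀ (n : ℕ) (μ : Fin (3 + 1)) (y : Fin (3 + 1) → ℤ) (ν : Fin (3 + 1)) (y' : Fin (3 + 1) → ℤ), ∀ B : ℕ, (1 / 2 : ℝ) • ((H'₂f n) B ((dv n) B (μ, y)) ((dv n) B (ν, y')) + (H'₂f n) B ((dv n) B (ν, y')) ((dv n) B (μ, y))) = (perF (towerTorus Lc (fine Lc (Mc B)) (n + 1)) (dper (towerTorus Lc (fine Lc (Mc B)) (n + 1)) (scaleK (Sum.elim (fun _ : Fin (3 + 1) => (1 : ℝ)) (fun _ : Fin (3 + 1) => (sn n))) (Sum.elim (fun _ : Fin (3 + 1) => (1 : ℝ)) (fun _ : Fin (3 + 1) => (sn n))) ((fun x w a b => ∑' e : Site (3 + 1), ((1 / 2 : ℝ) • (WNAG (Roots.ctr Lc) Pn (ANs (Roots.ctr Lc) (ΨL (Roots.ctr Lc)) (n + 1)) (n + 1) μ y ν (translate (Mc B) y' e) + sgnK (trK (WNAG (Roots.ctr Lc) Pn (ANs (Roots.ctr Lc) (ΨL (Roots.ctr Lc)) (n + 1)) (n + 1) μ y ν (translate (Mc B) y' e))))) x w a b)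 + (fun x w a b => ∑' e : Site (3 + 1), 𝒲Δ (n + 1) μ y ν (translate (Mc B) y' e) x w a b))))).submatrix (fun b : ↥(pbox (towerTorus Lc (fine Lc (Mc B)) (n + 1))) × Fin (3 + 1) => ((b.1, Sum.inl b.2) : Idx (towerTorus Lc (fine Lc (Mc B)) (n + 1)) (Fib 3))) (fun b : ↥(pbox (towerTorus Lc (fine Lc (Mc B)) (n + 1))) × Fin (3 + 1) => ((b.1, Sum.inl b.2) : Idx (towerTorus Lc (fine Lc (Mc B)) (n + 1)) (Fib 3))) := fun n μ y ν y' B => by obtain ⟨CvN, CwN, δN, hδN, hVN, hWN⟩ := vertexFamilies_VNA_WNAG (Roots.ctr Lc) Pn (ANs (Roots.ctr Lc) (ΨL (Roots.ctr Lc)) (n + 1)) (n + 1) (hAd n); obtain ⟨CwΔ, δΔ, hδΔ, hWΔv⟩ := hWΔ₂ (n + 1); rw [(hdv n) B μ y, (hdv n) B ν y', mul_smul, mul_smul, submatrix_ff_perF_dper_fibScale, perF_dper_evenWound_add_wound (towerTorus Lc (fine Lc (Mc B)) (n + 1)) (towerTorus_fine_apply (Mc B) n) (fun μ' y' ν' y''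 => WN_swapA (Roots.ctr Lc) Pn (ANs (Roots.ctr Lc) (ΨL (Roots.ctr Lc)) (n + 1)) (n + 1) μ' y' ν' y'') hWN hδN (hWΔs (n + 1)) hWΔv hδΔ μ y ν y', Matrix.submatrix_add, Pi.add_apply, Pi.add_apply, hWΔT n μ y ν y' B]; exact hHN2_family_of_locks_of_junctions_doorA (M := Mc B) (n := n) (c := c n) (Pn := Pn) (A := ANs (Roots.ctr Lc) (ΨL (Roots.ctr Lc)) (n + 1)) (hA := hAd n) (hAσ := hAσ n) (hAt := hAt n) (hv := (fun v => ((hv n) B) ((sn n) • v))) (hhvl := ((hvl8 n) B)) (lv := (fun v => ((lv n) B) ((sn n) • v))) (hlv := (lin_comp_smul ((lv n) B) ((hlv n) B) (sn n))) (hJW := ((hJW8 n) B)) (hH₀ := by rw [(hH₀ n) B, Nat.sub_self]) (T₂ := (T₂ n) B) (hT₂ := (hT₂ n) B) (hX₂ := fun b lam => torus_T2evenPair_pureGauge_snd_fun (M := towerTorus Lc (fine Lc (Mc B)) (n + 1)) (N := N) hN (T₂ := (T₂ n) B) (fun b₁ b₂ => by rw [(hT₂ n) B b₁ b₂, hTW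 n]) b lam) (Λ₁ := fun v => ((w n) (n + 1) • ∑ ā : ↥(pbox (towerTorus Lc (fine Lc (Mc B)) (n + 1))) × Fin (3 + 1), ((fun v => ((hv n) B) ((sn n) • v))) v ā • (perF (towerTorus Lc (fine Lc (Mc B)) (n + 1)) (dper (towerTorus Lc (fine Lc (Mc B)) (n + 1)) (SLam N ((cf n) B (n + 1)) (fun μ y => symHessFFAt (toSite (ctrOff (3 + 1) Lc)) Lc μ y) ā.2 (ā.1 : Site (3 + 1))))).submatrix (fun b : ↥(pbox (towerTorus Lc (fine Lc (Mc B)) (n + 1))) × Fin (3 + 1) => ((b.1, Sum.inl b.2) : Idx (towerTorus Lc (fine Lc (Mc B)) (n + 1)) (Fib 3))) (fun b : ↥(pbox (towerTorus Lc (fine Lc (Mc B)) (n + 1))) × Fin (3 + 1) => ((b.1, Sum.inl b.2) : Idx (towerTorus Lc (fine Lc (Mc B)) (n + 1)) (Fib 3))) + compSumSym Lc (onTowerFamily Lc (fine Lc (Mc B)) (fun k => (w n) k • ∑ ā : ↥(pbox (towerTorus Lc (fine Lc (Mc B)) k)) × Fin (3 + 1), ((fun k v => ((hb n) B) k ((sn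 n) • v))) k v ā • (perF (towerTorus Lc (fine Lc (Mc B)) k) (dper (towerTorus Lc (fine Lc (Mc B)) k) (SLam N ((cf n) B k) (fun μ y => symHessFFAt (toSite (ctrOff (3 + 1) Lc)) Lc μ y) ā.2 (ā.1 : Site (3 + 1))))).submatrix (fun b : ↥(pbox (towerTorus Lc (fine Lc (Mc B)) k)) × Fin (3 + 1) => ((b.1, Sum.inl b.2) : Idx (towerTorus Lc (fine Lc (Mc B)) k) (Fib 3))) (fun b : ↥(pbox (towerTorus Lc (fine Lc (Mc B)) k)) × Fin (3 + 1) => ((b.1, Sum.inl b.2) : Idx (towerTorus Lc (fine Lc (Mc B)) k) (Fib 3))))) (fine Lc (Mc B)) (fun i : ℕ => n + 1 - i) (fun _ : ℕ => ctrOff (3 + 1) Lc) (n + 1))) (H₁f := (fun v => ((H₁f n) B) ((sn n) • v))) (hH₁ := (fun v => by rw [(fun v => (hH₁f n) B ((sn n) • v)) v, (hbtop8 n) B v, add_assoc])) (Λ₂ := fun v v' => ((sn n) * (cM₂ n)) • ∑ b : ↥(pbox (towerTorus Lc (fine Lc (Mc B)) (n + 1))) × Fin (3 + 1), ∑ β :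 ↥(pbox (Mc B)) × Fin (3 + 1), (((fun v => ((hv n) B) ((sn n) • v))) v b * ((hm n) B) v' β + ((fun v => ((hv n) B) ((sn n) • v))) v' b * ((hm n) B) v β) • ((M₂ n) B) b β) (H₂f := (fun v v' => ((H₂f n) B) ((sn n) • v) ((sn n) • v'))) (hH₂ := (fun v v' => H2f_half_symm_eq (M := Mc B) (n := n) (c := c n) (Pn := Pn) (hv := (fun v => ((hv n) B) ((sn n) • v))) (T₂ := (T₂ n) B) (hT₂ := (hT₂ n) B) (hm := (hm n) B) (M₂ := (M₂ n) B) (cM₂ := (sn n) * (cM₂ n)) (H₂f := (fun v v' => ((H₂f n) B) ((sn n) • v) ((sn n) • v'))) (hH₂f := ((hH2f8 n) B)) v v')) (H'₂f := (fun v v' => ((H'₂f n) B) ((sn n) • v) ((sn n) • v'))) (hH'₂f := (fun v v' => (hH'₂f n) B ((sn n) • v) ((sn n) • v'))) (r := r n) (hr := hr n) (dv := (fun p : Fin (3 + 1) × (Fin (3 + 1) → ℤ) => (r n) • (Pi.single (wrapPt (Mc B) p.2, p.1) (1 : ℝ) : ((↥(pbox (Mc B)) × Fin (3 + 1)) → ℝ))))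 (hdv := (fun μ y => rfl)) (hcE₂ := hcE₂ n) (D := fun a a' => -((sn n) * (cM₂ n) * (r n)) • ∑ β : ↥(pbox (Mc B)) × Fin (3 + 1), (perF (towerTorus Lc (fine Lc (Mc B)) (n + 1)) (ANs (Roots.ctr Lc) (ΨL (Roots.ctr Lc)) (n + 1)) (wrapPt (towerTorus Lc (fine Lc (Mc B)) (n + 1)) (((Lc ^ (n + 1 + 1) : ℕ) : ℤ) • (β.1 : Site (3 + 1))), Sum.inr β.2) (wrapPt (towerTorus Lc (fine Lc (Mc B)) (n + 1)) (((Lc ^ (n + 1 + 1) : ℕ) : ℤ) • (a'.1 : Site (3 + 1))), Sum.inr a'.2) • (∑ b : ↥(pbox (towerTorus Lc (fine Lc (Mc B)) (n + 1))) × Fin (3 + 1), (∑ s : ↥(pbox (towerTorus Lc (fine Lc (Mc B)) (n + 1))), tgrad (towerTorus Lc (fine Lc (Mc B)) (n + 1)) (b.1, Sum.inl b.2) s * ((lv n) B) (((sn n) * (r n)) • (Pi.single a (1 : ℝ) : ((↥(pbox (Mc B)) × Fin (3 + 1)) → ℝ))) s) • ((M₂ n) B) b β - (κ₂ n) • (Matrix.diagonal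 (fun b : ↥(pbox (towerTorus Lc (fine Lc (Mc B)) (n + 1))) × Fin (3 + 1) => ((lv n) B) (((sn n) * (r n)) • (Pi.single a (1 : ℝ) : ((↥(pbox (Mc B)) × Fin (3 + 1)) → ℝ))) b.1) * (perF (towerTorus Lc (fine Lc (Mc B)) (n + 1)) (dper (towerTorus Lc (fine Lc (Mc B)) (n + 1)) ((tabsCompG (n + 1 + 1) (one_le_of_neZero Lc) (Roots.ctr Lc).hr (Pn.cM (n + 1 + 1))).H β.2 (β.1 : Site (3 + 1))))).submatrix (fun b : ↥(pbox (towerTorus Lc (fine Lc (Mc B)) (n + 1))) × Fin (3 + 1) => ((b.1, Sum.inl b.2) : Idx (towerTorus Lc (fine Lc (Mc B)) (n + 1)) (Fib 3))) (fun b : ↥(pbox (towerTorus Lc (fine Lc (Mc B)) (n + 1))) × Fin (3 + 1) => ((b.1, Sum.inl b.2) : Idx (towerTorus Lc (fine Lc (Mc B)) (n + 1)) (Fib 3))) - (perF (towerTorus Lc (fine Lc (Mc B)) (n + 1)) (dper (towerTorus Lc (fine Lc (Mc B)) (n + 1)) ((tabsCompG (n + 1 + 1) (one_le_of_neZero Lc)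 (Roots.ctr Lc).hr (Pn.cM (n + 1 + 1))).H β.2 (β.1 : Site (3 + 1))))).submatrix (fun b : ↥(pbox (towerTorus Lc (fine Lc (Mc B)) (n + 1))) × Fin (3 + 1) => ((b.1, Sum.inl b.2) : Idx (towerTorus Lc (fine Lc (Mc B)) (n + 1)) (Fib 3))) (fun b : ↥(pbox (towerTorus Lc (fine Lc (Mc B)) (n + 1))) × Fin (3 + 1) => ((b.1, Sum.inl b.2) : Idx (towerTorus Lc (fine Lc (Mc B)) (n + 1)) (Fib 3))) * Matrix.diagonal (fun b : ↥(pbox (towerTorus Lc (fine Lc (Mc B)) (n + 1))) × Fin (3 + 1) => ((lv n) B) (((sn n) * (r n)) • (Pi.single a (1 : ℝ) : ((↥(pbox (Mc B)) × Fin (3 + 1)) → ℝ))) b.1))) + perF (towerTorus Lc (fine Lc (Mc B)) (n + 1)) (ANs (Roots.ctr Lc) (ΨL (Roots.ctr Lc)) (n + 1)) (wrapPt (towerTorus Lc (fine Lc (Mc B)) (n + 1)) (((Lc ^ (n + 1 + 1) : ℕ) : ℤ) • (β.1 : Site (3 + 1))), Sum.inr β.2) (wrapPt (towerTorus Lc (fine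 Lc (Mc B)) (n + 1)) (((Lc ^ (n + 1 + 1) : ℕ) : ℤ) • (a.1 : Site (3 + 1))), Sum.inr a.2) • (∑ b : ↥(pbox (towerTorus Lc (fine Lc (Mc B)) (n + 1))) × Fin (3 + 1), (∑ s : ↥(pbox (towerTorus Lc (fine Lc (Mc B)) (n + 1))), tgrad (towerTorus Lc (fine Lc (Mc B)) (n + 1)) (b.1, Sum.inl b.2) s * ((lv n) B) (((sn n) * (r n)) • (Pi.single a' (1 : ℝ) : ((↥(pbox (Mc B)) × Fin (3 + 1)) → ℝ))) s) • ((M₂ n) B) b β - (κ₂ n) • (Matrix.diagonal (fun b : ↥(pbox (towerTorus Lc (fine Lc (Mc B)) (n + 1))) × Fin (3 + 1) => ((lv n) B) (((sn n) * (r n)) • (Pi.single a' (1 : ℝ) : ((↥(pbox (Mc B)) × Fin (3 + 1)) → ℝ))) b.1) * (perF (towerTorus Lc (fine Lc (Mc B)) (n + 1)) (dper (towerTorus Lc (fine Lc (Mc B)) (n + 1)) ((tabsCompG (n + 1 + 1) (one_le_of_neZero Lc) (Roots.ctr Lc).hr (Pn.cM (n + 1 + 1))).H β.2 (β.1 : Site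 (3 + 1))))).submatrix (fun b : ↥(pbox (towerTorus Lc (fine Lc (Mc B)) (n + 1))) × Fin (3 + 1) => ((b.1, Sum.inl b.2) : Idx (towerTorus Lc (fine Lc (Mc B)) (n + 1)) (Fib 3))) (fun b : ↥(pbox (towerTorus Lc (fine Lc (Mc B)) (n + 1))) × Fin (3 + 1) => ((b.1, Sum.inl b.2) : Idx (towerTorus Lc (fine Lc (Mc B)) (n + 1)) (Fib 3))) - (perF (towerTorus Lc (fine Lc (Mc B)) (n + 1)) (dper (towerTorus Lc (fine Lc (Mc B)) (n + 1)) ((tabsCompG (n + 1 + 1) (one_le_of_neZero Lc) (Roots.ctr Lc).hr (Pn.cM (n + 1 + 1))).H β.2 (β.1 : Site (3 + 1))))).submatrix (fun b : ↥(pbox (towerTorus Lc (fine Lc (Mc B)) (n + 1))) × Fin (3 + 1) => ((b.1, Sum.inl b.2) : Idx (towerTorus Lc (fine Lc (Mc B)) (n + 1)) (Fib 3))) (fun b : ↥(pbox (towerTorus Lc (fine Lc (Mc B)) (n + 1))) × Fin (3 + 1) => ((b.1, Sum.inl b.2) : Idx (towerTorus Lc (fine Lc (Mc B)) (n + 1))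 (Fib 3))) * Matrix.diagonal (fun b : ↥(pbox (towerTorus Lc (fine Lc (Mc B)) (n + 1))) × Fin (3 + 1) => ((lv n) B) (((sn n) * (r n)) • (Pi.single a' (1 : ℝ) : ((↥(pbox (Mc B)) × Fin (3 + 1)) → ℝ))) b.1))))) (hJΛ₂ := fun a a' p q α β => hJΛ2_of_mixedLock_of_mixedGauge_doorAG (M := Mc B) (n := n) (c := c n) (Pn := Pn) (A := ANs (Roots.ctr Lc) (ΨL (Roots.ctr Lc)) (n + 1)) (yN := fun a₁ : ↥(pbox (Mc B)) × Fin (3 + 1) => (a₁.1 : Site (3 + 1))) (μN := fun a₁ : ↥(pbox (Mc B)) × Fin (3 + 1) => a₁.2) (hv := (fun v => ((hv n) B) ((sn n) • v))) (hhvl := ((hvl8 n) B)) (lv := (fun v => ((lv n) B) ((sn n) • v))) (hlv := (lin_comp_smul ((lv n) B) ((hlv n) B) (sn n))) (hJW := ((hJW8 n) B)) (hm := (hm n) B) (hml := (hml n) B) (hJM := (hJM n) B) (M₂ := (M₂ n) B) (hM₂ := (hM₂ n) B) (Λ₁ := fun v => ((w n) (n + 1) • ∑ ā : ↥(pbox (towerTorus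 Lc (fine Lc (Mc B)) (n + 1))) × Fin (3 + 1), ((fun v => ((hv n) B) ((sn n) • v))) v ā • (perF (towerTorus Lc (fine Lc (Mc B)) (n + 1)) (dper (towerTorus Lc (fine Lc (Mc B)) (n + 1)) (SLam N ((cf n) B (n + 1)) (fun μ y => symHessFFAt (toSite (ctrOff (3 + 1) Lc)) Lc μ y) ā.2 (ā.1 : Site (3 + 1))))).submatrix (fun b : ↥(pbox (towerTorus Lc (fine Lc (Mc B)) (n + 1))) × Fin (3 + 1) => ((b.1, Sum.inl b.2) : Idx (towerTorus Lc (fine Lc (Mc B)) (n + 1)) (Fib 3))) (fun b : ↥(pbox (towerTorus Lc (fine Lc (Mc B)) (n + 1))) × Fin (3 + 1) => ((b.1, Sum.inl b.2) : Idx (towerTorus Lc (fine Lc (Mc B)) (n + 1)) (Fib 3))) + compSumSym Lc (onTowerFamily Lc (fine Lc (Mc B)) (fun k => (w n) k • ∑ ā : ↥(pbox (towerTorus Lc (fine Lc (Mc B)) k)) × Fin (3 + 1), ((fun k v => ((hb n) B) k ((sn n) • v))) k v ā • (perF (towerTorus Lc (fine Lc (Mc B)) k) (dper (towerTorus Lc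 (fine Lc (Mc B)) k) (SLam N ((cf n) B k) (fun μ y => symHessFFAt (toSite (ctrOff (3 + 1) Lc)) Lc μ y) ā.2 (ā.1 : Site (3 + 1))))).submatrix (fun b : ↥(pbox (towerTorus Lc (fine Lc (Mc B)) k)) × Fin (3 + 1) => ((b.1, Sum.inl b.2) : Idx (towerTorus Lc (fine Lc (Mc B)) k) (Fib 3))) (fun b : ↥(pbox (towerTorus Lc (fine Lc (Mc B)) k)) × Fin (3 + 1) => ((b.1, Sum.inl b.2) : Idx (towerTorus Lc (fine Lc (Mc B)) k) (Fib 3))))) (fine Lc (Mc B)) (fun i : ℕ => n + 1 - i) (fun _ : ℕ => ctrOff (3 + 1) Lc) (n + 1))) (Λ₂ := fun v v' => ((sn n) * (cM₂ n)) • ∑ b : ↥(pbox (towerTorus Lc (fine Lc (Mc B)) (n + 1))) × Fin (3 + 1), ∑ β : ↥(pbox (Mc B)) × Fin (3 + 1), (((fun v => ((hv n) B) ((sn n) • v))) v b * ((hm n) B) v' β + ((fun v => ((hv n) B) ((sn n) • v))) v' b * ((hm n) B) v β) • ((M₂ n) B) b β) (cM₂ := (sn n) * (cM₂ n)) (hΛ₂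 := fun v v' => rfl) (r := r n) (a := a) (a' := a') (hcM₂ := hcM₂ n) (D := ∑ β : ↥(pbox (Mc B)) × Fin (3 + 1), (perF (towerTorus Lc (fine Lc (Mc B)) (n + 1)) (ANs (Roots.ctr Lc) (ΨL (Roots.ctr Lc)) (n + 1)) (wrapPt (towerTorus Lc (fine Lc (Mc B)) (n + 1)) (((Lc ^ (n + 1 + 1) : ℕ) : ℤ) • (β.1 : Site (3 + 1))), Sum.inr β.2) (wrapPt (towerTorus Lc (fine Lc (Mc B)) (n + 1)) (((Lc ^ (n + 1 + 1) : ℕ) : ℤ) • (a'.1 : Site (3 + 1))), Sum.inr a'.2) • (∑ b : ↥(pbox (towerTorus Lc (fine Lc (Mc B)) (n + 1))) × Fin (3 + 1), (∑ s : ↥(pbox (towerTorus Lc (fine Lc (Mc B)) (n + 1))), tgrad (towerTorus Lc (fine Lc (Mc B)) (n + 1)) (b.1, Sum.inl b.2) s * ((lv n) B) (((sn n) * (r n)) • (Pi.single a (1 : ℝ) : ((↥(pbox (Mc B)) × Fin (3 + 1)) → ℝ))) s) • ((M₂ n) B) b β - (κ₂ n) • (Matrix.diagonal (fun b : ↥(pbox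 (towerTorus Lc (fine Lc (Mc B)) (n + 1))) × Fin (3 + 1) => ((lv n) B) (((sn n) * (r n)) • (Pi.single a (1 : ℝ) : ((↥(pbox (Mc B)) × Fin (3 + 1)) → ℝ))) b.1) * (perF (towerTorus Lc (fine Lc (Mc B)) (n + 1)) (dper (towerTorus Lc (fine Lc (Mc B)) (n + 1)) ((tabsCompG (n + 1 + 1) (one_le_of_neZero Lc) (Roots.ctr Lc).hr (Pn.cM (n + 1 + 1))).H β.2 (β.1 : Site (3 + 1))))).submatrix (fun b : ↥(pbox (towerTorus Lc (fine Lc (Mc B)) (n + 1))) × Fin (3 + 1) => ((b.1, Sum.inl b.2) : Idx (towerTorus Lc (fine Lc (Mc B)) (n + 1)) (Fib 3))) (fun b : ↥(pbox (towerTorus Lc (fine Lc (Mc B)) (n + 1))) × Fin (3 + 1) => ((b.1, Sum.inl b.2) : Idx (towerTorus Lc (fine Lc (Mc B)) (n + 1)) (Fib 3))) - (perF (towerTorus Lc (fine Lc (Mc B)) (n + 1)) (dper (towerTorus Lc (fine Lc (Mc B)) (n + 1)) ((tabsCompG (n + 1 + 1) (one_le_of_neZero Lc) (Roots.ctr Lc).hr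 (Pn.cM (n + 1 + 1))).H β.2 (β.1 : Site (3 + 1))))).submatrix (fun b : ↥(pbox (towerTorus Lc (fine Lc (Mc B)) (n + 1))) × Fin (3 + 1) => ((b.1, Sum.inl b.2) : Idx (towerTorus Lc (fine Lc (Mc B)) (n + 1)) (Fib 3))) (fun b : ↥(pbox (towerTorus Lc (fine Lc (Mc B)) (n + 1))) × Fin (3 + 1) => ((b.1, Sum.inl b.2) : Idx (towerTorus Lc (fine Lc (Mc B)) (n + 1)) (Fib 3))) * Matrix.diagonal (fun b : ↥(pbox (towerTorus Lc (fine Lc (Mc B)) (n + 1))) × Fin (3 + 1) => ((lv n) B) (((sn n) * (r n)) • (Pi.single a (1 : ℝ) : ((↥(pbox (Mc B)) × Fin (3 + 1)) → ℝ))) b.1))) + perF (towerTorus Lc (fine Lc (Mc B)) (n + 1)) (ANs (Roots.ctr Lc) (ΨL (Roots.ctr Lc)) (n + 1)) (wrapPt (towerTorus Lc (fine Lc (Mc B)) (n + 1)) (((Lc ^ (n + 1 + 1) : ℕ) : ℤ) • (β.1 : Site (3 + 1))), Sum.inr β.2) (wrapPt (towerTorus Lc (fine Lc (Mc B)) (n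 + 1)) (((Lc ^ (n + 1 + 1) : ℕ) : ℤ) • (a.1 : Site (3 + 1))), Sum.inr a.2) • (∑ b : ↥(pbox (towerTorus Lc (fine Lc (Mc B)) (n + 1))) × Fin (3 + 1), (∑ s : ↥(pbox (towerTorus Lc (fine Lc (Mc B)) (n + 1))), tgrad (towerTorus Lc (fine Lc (Mc B)) (n + 1)) (b.1, Sum.inl b.2) s * ((lv n) B) (((sn n) * (r n)) • (Pi.single a' (1 : ℝ) : ((↥(pbox (Mc B)) × Fin (3 + 1)) → ℝ))) s) • ((M₂ n) B) b β - (κ₂ n) • (Matrix.diagonal (fun b : ↥(pbox (towerTorus Lc (fine Lc (Mc B)) (n + 1))) × Fin (3 + 1) => ((lv n) B) (((sn n) * (r n)) • (Pi.single a' (1 : ℝ) : ((↥(pbox (Mc B)) × Fin (3 + 1)) → ℝ))) b.1) * (perF (towerTorus Lc (fine Lc (Mc B)) (n + 1)) (dper (towerTorus Lc (fine Lc (Mc B)) (n + 1)) ((tabsCompG (n + 1 + 1) (one_le_of_neZero Lc) (Roots.ctr Lc).hr (Pn.cM (n + 1 + 1))).H β.2 (β.1 : Site (3 + 1))))).submatrix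 (fun b : ↥(pbox (towerTorus Lc (fine Lc (Mc B)) (n + 1))) × Fin (3 + 1) => ((b.1, Sum.inl b.2) : Idx (towerTorus Lc (fine Lc (Mc B)) (n + 1)) (Fib 3))) (fun b : ↥(pbox (towerTorus Lc (fine Lc (Mc B)) (n + 1))) × Fin (3 + 1) => ((b.1, Sum.inl b.2) : Idx (towerTorus Lc (fine Lc (Mc B)) (n + 1)) (Fib 3))) - (perF (towerTorus Lc (fine Lc (Mc B)) (n + 1)) (dper (towerTorus Lc (fine Lc (Mc B)) (n + 1)) ((tabsCompG (n + 1 + 1) (one_le_of_neZero Lc) (Roots.ctr Lc).hr (Pn.cM (n + 1 + 1))).H β.2 (β.1 : Site (3 + 1))))).submatrix (fun b : ↥(pbox (towerTorus Lc (fine Lc (Mc B)) (n + 1))) × Fin (3 + 1) => ((b.1, Sum.inl b.2) : Idx (towerTorus Lc (fine Lc (Mc B)) (n + 1)) (Fib 3))) (fun b : ↥(pbox (towerTorus Lc (fine Lc (Mc B)) (n + 1))) × Fin (3 + 1) => ((b.1, Sum.inl b.2) : Idx (towerTorus Lc (fine Lc (Mc B)) (n + 1)) (Fib 3))) * Matrix.diagonal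 (fun b : ↥(pbox (towerTorus Lc (fine Lc (Mc B)) (n + 1))) × Fin (3 + 1) => ((lv n) B) (((sn n) * (r n)) • (Pi.single a' (1 : ℝ) : ((↥(pbox (Mc B)) × Fin (3 + 1)) → ℝ))) b.1))))) (hJΛ₂' := hJΛ2'_of_wardRow_doorA (M := Mc B) (n := n) (c := c n) (Pn := Pn) (A := ANs (Roots.ctr Lc) (ΨL (Roots.ctr Lc)) (n + 1)) (yN := fun a₁ : ↥(pbox (Mc B)) × Fin (3 + 1) => (a₁.1 : Site (3 + 1))) (μN := fun a₁ : ↥(pbox (Mc B)) × Fin (3 + 1) => a₁.2) (lv := (fun v => ((lv n) B) ((sn n) • v))) (Λ₁ := fun v => ((w n) (n + 1) • ∑ ā : ↥(pbox (towerTorus Lc (fine Lc (Mc B)) (n + 1))) × Fin (3 + 1), ((fun v => ((hv n) B) ((sn n) • v))) v ā • (perF (towerTorus Lc (fine Lc (Mc B)) (n + 1)) (dper (towerTorus Lc (fine Lc (Mc B)) (n + 1)) (SLam N ((cf n) B (n + 1)) (fun μ y => symHessFFAt (toSite (ctrOff (3 + 1) Lc)) Lc μ y) ā.2 (ā.1 :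 Site (3 + 1))))).submatrix (fun b : ↥(pbox (towerTorus Lc (fine Lc (Mc B)) (n + 1))) × Fin (3 + 1) => ((b.1, Sum.inl b.2) : Idx (towerTorus Lc (fine Lc (Mc B)) (n + 1)) (Fib 3))) (fun b : ↥(pbox (towerTorus Lc (fine Lc (Mc B)) (n + 1))) × Fin (3 + 1) => ((b.1, Sum.inl b.2) : Idx (towerTorus Lc (fine Lc (Mc B)) (n + 1)) (Fib 3))) + compSumSym Lc (onTowerFamily Lc (fine Lc (Mc B)) (fun k => (w n) k • ∑ ā : ↥(pbox (towerTorus Lc (fine Lc (Mc B)) k)) × Fin (3 + 1), ((fun k v => ((hb n) B) k ((sn n) • v))) k v ā • (perF (towerTorus Lc (fine Lc (Mc B)) k) (dper (towerTorus Lc (fine Lc (Mc B)) k) (SLam N ((cf n) B k) (fun μ y => symHessFFAt (toSite (ctrOff (3 + 1) Lc)) Lc μ y) ā.2 (ā.1 : Site (3 + 1))))).submatrix (fun b : ↥(pbox (towerTorus Lc (fine Lc (Mc B)) k)) × Fin (3 + 1) => ((b.1, Sum.inl b.2) : Idx (towerTorus Lc (fine Lc (Mc B)) k) (Fib 3)))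 (fun b : ↥(pbox (towerTorus Lc (fine Lc (Mc B)) k)) × Fin (3 + 1) => ((b.1, Sum.inl b.2) : Idx (towerTorus Lc (fine Lc (Mc B)) k) (Fib 3))))) (fine Lc (Mc B)) (fun i : ℕ => n + 1 - i) (fun _ : ℕ => ctrOff (3 + 1) Lc) (n + 1))) (M₂ := (M₂ n) B) (cM₂ := (sn n) * (cM₂ n)) (r := r n) (a := a) (a' := a') (cΛS := Pn.cΛ (n + 1 + 1)) (κ₂ := κ₂ n) (hΛS := fun a₀ => hΛS_of_road_dataA (n := n) (M := Mc B) (A := ANs (Roots.ctr Lc) (ΨL (Roots.ctr Lc)) (n + 1)) (hA := hAd n) (hAt := hAt n) (hE := curvAdj_curv_colH_ANs (Roots.ctr Lc) (n + 1)) (hmm := ANs_inr_inr_smul (Roots.ctr Lc) (n + 1)) (P := Pn) (N₁ := N) (lev := fun i : ℕ => n + 1 - i) (hlev := fun i _ => rfl) (rs := fun _ : ℕ => ctrOff (3 + 1) Lc) (yN := fun a₁ : ↥(pbox (Mc B)) × Fin (3 + 1) => (a₁.1 : Site (3 + 1))) (μN := fun a₁ : ↥(pbox (Mc B)) × Fin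 (3 + 1) => a₁.2) (hv := (fun v => ((hv n) B) ((sn n) • v))) (cfF := (cf n) B) (hcfF := (hcfe n) B) (hbF := (fun k v => ((hb n) B) k ((sn n) • v))) (hhbF := hhb8 n B) (c := c n) (κF := κ n) (wF := w n) (hκF := hκe n) (hwF := hwe n) (T' := towerTorus Lc (Mc B) (n + 1)) (hT' := fun i => towerTorus_fine_apply_eq (Mc B) (n + 1) i) (hhvl := ((hvl8 n) B)) (lv := (fun v => ((lv n) B) ((sn n) • v))) (hJW := ((hJW8 n) B)) (hfold := (hfold n) B) (r := r n) (hr := hr n) (hcΛ := hcΛ n) (a := a₀) (hLc := hLc2)) (Rs := fun s β => ∑ b : ↥(pbox (towerTorus Lc (fine Lc (Mc B)) (n + 1))) × Fin (3 + 1), (∑ s' : ↥(pbox (towerTorus Lc (fine Lc (Mc B)) (n + 1))), tgrad (towerTorus Lc (fine Lc (Mc B)) (n + 1)) (b.1, Sum.inl b.2) s' * (if s' = s then (1 : ℝ) else 0)) • ((M₂ n) B) b β - (κ₂ n) • (Matrix.diagonal (fun b : ↥(pbox (towerTorus Lc (fine Lc (Mc B)) (n + 1))) × Fin (3 + 1)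 => if b.1 = s then (1 : ℝ) else 0) * (perF (towerTorus Lc (fine Lc (Mc B)) (n + 1)) (dper (towerTorus Lc (fine Lc (Mc B)) (n + 1)) ((tabsCompG (n + 1 + 1) (one_le_of_neZero Lc) (Roots.ctr Lc).hr (Pn.cM (n + 1 + 1))).H β.2 (β.1 : Site (3 + 1))))).submatrix (fun b : ↥(pbox (towerTorus Lc (fine Lc (Mc B)) (n + 1))) × Fin (3 + 1) => ((b.1, Sum.inl b.2) : Idx (towerTorus Lc (fine Lc (Mc B)) (n + 1)) (Fib 3))) (fun b : ↥(pbox (towerTorus Lc (fine Lc (Mc B)) (n + 1))) × Fin (3 + 1) => ((b.1, Sum.inl b.2) : Idx (towerTorus Lc (fine Lc (Mc B)) (n + 1)) (Fib 3))) - (perF (towerTorus Lc (fine Lc (Mc B)) (n + 1)) (dper (towerTorus Lc (fine Lc (Mc B)) (n + 1)) ((tabsCompG (n + 1 + 1) (one_le_of_neZero Lc) (Roots.ctr Lc).hr (Pn.cM (n + 1 + 1))).H β.2 (β.1 : Site (3 + 1))))).submatrix (fun b : ↥(pbox (towerTorus Lc (fine Lc (Mc B)) (n + 1))) × Fin (3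 + 1) => ((b.1, Sum.inl b.2) : Idx (towerTorus Lc (fine Lc (Mc B)) (n + 1)) (Fib 3))) (fun b : ↥(pbox (towerTorus Lc (fine Lc (Mc B)) (n + 1))) × Fin (3 + 1) => ((b.1, Sum.inl b.2) : Idx (towerTorus Lc (fine Lc (Mc B)) (n + 1)) (Fib 3))) * Matrix.diagonal (fun b : ↥(pbox (towerTorus Lc (fine Lc (Mc B)) (n + 1))) × Fin (3 + 1) => if b.1 = s then (1 : ℝ) else 0))) (hK2b := fun lam β => wardRow_of_defect (fun b : ↥(pbox (towerTorus Lc (fine Lc (Mc B)) (n + 1))) × Fin (3 + 1) => b.1) (fun (b : ↥(pbox (towerTorus Lc (fine Lc (Mc B)) (n + 1))) × Fin (3 + 1)) (s : ↥(pbox (towerTorus Lc (fine Lc (Mc B)) (n + 1)))) => tgrad (towerTorus Lc (fine Lc (Mc B)) (n + 1)) (b.1, Sum.inl b.2) s) (fun b : ↥(pbox (towerTorus Lc (fine Lc (Mc B)) (n + 1))) × Fin (3 + 1) => ((M₂ n) B) b β) ((perF (towerTorus Lc (fine Lc (Mc B)) (n + 1)) (dper (towerTorus Lc (fine Lc (Mc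 B)) (n + 1)) ((tabsCompG (n + 1 + 1) (one_le_of_neZero Lc) (Roots.ctr Lc).hr (Pn.cM (n + 1 + 1))).H β.2 (β.1 : Site (3 + 1))))).submatrix (fun b : ↥(pbox (towerTorus Lc (fine Lc (Mc B)) (n + 1))) × Fin (3 + 1) => ((b.1, Sum.inl b.2) : Idx (towerTorus Lc (fine Lc (Mc B)) (n + 1)) (Fib 3))) (fun b : ↥(pbox (towerTorus Lc (fine Lc (Mc B)) (n + 1))) × Fin (3 + 1) => ((b.1, Sum.inl b.2) : Idx (towerTorus Lc (fine Lc (Mc B)) (n + 1)) (Fib 3)))) (κ₂ n) lam) (hL := hLk n) (D := ∑ β : ↥(pbox (Mc B)) × Fin (3 + 1), (perF (towerTorus Lc (fine Lc (Mc B)) (n + 1)) (ANs (Roots.ctr Lc) (ΨL (Roots.ctr Lc)) (n + 1)) (wrapPt (towerTorus Lc (fine Lc (Mc B)) (n + 1)) (((Lc ^ (n + 1 + 1) : ℕ) : ℤ) • (β.1 : Site (3 + 1))), Sum.inr β.2) (wrapPt (towerTorus Lc (fine Lc (Mc B)) (n + 1)) (((Lc ^ (n + 1 + 1) : ℕ)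 : ℤ) • (a'.1 : Site (3 + 1))), Sum.inr a'.2) • (∑ b : ↥(pbox (towerTorus Lc (fine Lc (Mc B)) (n + 1))) × Fin (3 + 1), (∑ s : ↥(pbox (towerTorus Lc (fine Lc (Mc B)) (n + 1))), tgrad (towerTorus Lc (fine Lc (Mc B)) (n + 1)) (b.1, Sum.inl b.2) s * ((lv n) B) (((sn n) * (r n)) • (Pi.single a (1 : ℝ) : ((↥(pbox (Mc B)) × Fin (3 + 1)) → ℝ))) s) • ((M₂ n) B) b β - (κ₂ n) • (Matrix.diagonal (fun b : ↥(pbox (towerTorus Lc (fine Lc (Mc B)) (n + 1))) × Fin (3 + 1) => ((lv n) B) (((sn n) * (r n)) • (Pi.single a (1 : ℝ) : ((↥(pbox (Mc B)) × Fin (3 + 1)) → ℝ))) b.1) * (perF (towerTorus Lc (fine Lc (Mc B)) (n + 1)) (dper (towerTorus Lc (fine Lc (Mc B)) (n + 1)) ((tabsCompG (n + 1 + 1) (one_le_of_neZero Lc) (Roots.ctr Lc).hr (Pn.cM (n + 1 + 1))).H β.2 (β.1 : Site (3 + 1))))).submatrix (fun b : ↥(pbox (towerTorus Lc (fine Lc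 (Mc B)) (n + 1))) × Fin (3 + 1) => ((b.1, Sum.inl b.2) : Idx (towerTorus Lc (fine Lc (Mc B)) (n + 1)) (Fib 3))) (fun b : ↥(pbox (towerTorus Lc (fine Lc (Mc B)) (n + 1))) × Fin (3 + 1) => ((b.1, Sum.inl b.2) : Idx (towerTorus Lc (fine Lc (Mc B)) (n + 1)) (Fib 3))) - (perF (towerTorus Lc (fine Lc (Mc B)) (n + 1)) (dper (towerTorus Lc (fine Lc (Mc B)) (n + 1)) ((tabsCompG (n + 1 + 1) (one_le_of_neZero Lc) (Roots.ctr Lc).hr (Pn.cM (n + 1 + 1))).H β.2 (β.1 : Site (3 + 1))))).submatrix (fun b : ↥(pbox (towerTorus Lc (fine Lc (Mc B)) (n + 1))) × Fin (3 + 1) => ((b.1, Sum.inl b.2) : Idx (towerTorus Lc (fine Lc (Mc B)) (n + 1)) (Fib 3))) (fun b : ↥(pbox (towerTorus Lc (fine Lc (Mc B)) (n + 1))) × Fin (3 + 1) => ((b.1, Sum.inl b.2) : Idx (towerTorus Lc (fine Lc (Mc B)) (n + 1)) (Fib 3))) * Matrix.diagonal (fun b : ↥(pbox (towerTorus Lc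 (fine Lc (Mc B)) (n + 1))) × Fin (3 + 1) => ((lv n) B) (((sn n) * (r n)) • (Pi.single a (1 : ℝ) : ((↥(pbox (Mc B)) × Fin (3 + 1)) → ℝ))) b.1))) + perF (towerTorus Lc (fine Lc (Mc B)) (n + 1)) (ANs (Roots.ctr Lc) (ΨL (Roots.ctr Lc)) (n + 1)) (wrapPt (towerTorus Lc (fine Lc (Mc B)) (n + 1)) (((Lc ^ (n + 1 + 1) : ℕ) : ℤ) • (β.1 : Site (3 + 1))), Sum.inr β.2) (wrapPt (towerTorus Lc (fine Lc (Mc B)) (n + 1)) (((Lc ^ (n + 1 + 1) : ℕ) : ℤ) • (a.1 : Site (3 + 1))), Sum.inr a.2) • (∑ b : ↥(pbox (towerTorus Lc (fine Lc (Mc B)) (n + 1))) × Fin (3 + 1), (∑ s : ↥(pbox (towerTorus Lc (fine Lc (Mc B)) (n + 1))), tgrad (towerTorus Lc (fine Lc (Mc B)) (n + 1)) (b.1, Sum.inl b.2) s * ((lv n) B) (((sn n) * (r n)) • (Pi.single a' (1 : ℝ) : ((↥(pbox (Mc B)) × Fin (3 + 1)) → ℝ))) s) • ((M₂ n) B) b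 β - (κ₂ n) • (Matrix.diagonal (fun b : ↥(pbox (towerTorus Lc (fine Lc (Mc B)) (n + 1))) × Fin (3 + 1) => ((lv n) B) (((sn n) * (r n)) • (Pi.single a' (1 : ℝ) : ((↥(pbox (Mc B)) × Fin (3 + 1)) → ℝ))) b.1) * (perF (towerTorus Lc (fine Lc (Mc B)) (n + 1)) (dper (towerTorus Lc (fine Lc (Mc B)) (n + 1)) ((tabsCompG (n + 1 + 1) (one_le_of_neZero Lc) (Roots.ctr Lc).hr (Pn.cM (n + 1 + 1))).H β.2 (β.1 : Site (3 + 1))))).submatrix (fun b : ↥(pbox (towerTorus Lc (fine Lc (Mc B)) (n + 1))) × Fin (3 + 1) => ((b.1, Sum.inl b.2) : Idx (towerTorus Lc (fine Lc (Mc B)) (n + 1)) (Fib 3))) (fun b : ↥(pbox (towerTorus Lc (fine Lc (Mc B)) (n + 1))) × Fin (3 + 1) => ((b.1, Sum.inl b.2) : Idx (towerTorus Lc (fine Lc (Mc B)) (n + 1)) (Fib 3))) - (perF (towerTorus Lc (fine Lc (Mc B)) (n + 1)) (dper (towerTorus Lc (fine Lc (Mc B)) (n + 1)) ((tabsCompG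 (n + 1 + 1) (one_le_of_neZero Lc) (Roots.ctr Lc).hr (Pn.cM (n + 1 + 1))).H β.2 (β.1 : Site (3 + 1))))).submatrix (fun b : ↥(pbox (towerTorus Lc (fine Lc (Mc B)) (n + 1))) × Fin (3 + 1) => ((b.1, Sum.inl b.2) : Idx (towerTorus Lc (fine Lc (Mc B)) (n + 1)) (Fib 3))) (fun b : ↥(pbox (towerTorus Lc (fine Lc (Mc B)) (n + 1))) × Fin (3 + 1) => ((b.1, Sum.inl b.2) : Idx (towerTorus Lc (fine Lc (Mc B)) (n + 1)) (Fib 3))) * Matrix.diagonal (fun b : ↥(pbox (towerTorus Lc (fine Lc (Mc B)) (n + 1))) × Fin (3 + 1) => ((lv n) B) (((sn n) * (r n)) • (Pi.single a' (1 : ℝ) : ((↥(pbox (Mc B)) × Fin (3 + 1)) → ℝ))) b.1))))) (hR₂ := by simp only [sum_smul_defect_indicator, smul_smul])) p q α β) μ y ν y'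
  have hQN₂ : ∀ (n : ℕ) (μ : Fin (3 + 1)) (y : Fin (3 + 1) → ℤ) (ν : Fin (3 + 1)) (y' : Fin (3 + 1) → ℤ), ∀ B : ℕ, (1 / 2 : ℝ) • ((𝔔'₂f n) B ((dv n) B (μ, y)) ((dv n) B (ν, y')) + (𝔔'₂f n) B ((dv n) B (ν, y')) ((dv n) B (μ, y))) = (perF (towerTorus Lc (fine Lc (Mc B)) (n + 1)) (dper (towerTorus Lc (fine Lc (Mc B)) (n + 1)) (scaleK (Sum.elim (fun _ : Fin (3 + 1) => (1 : ℝ)) (fun _ : Fin (3 + 1) => (sn n))) (Sum.elim (fun _ : Fin (3 + 1) => (1 : ℝ)) (fun _ : Fin (3 + 1) => (sn n))) ((fun x w a b => ∑' e : Site (3 + 1), ((1 / 2 : ℝ) • (WNAG (Roots.ctr Lc) Pn (ANs (Roots.ctr Lc) (ΨL (Roots.ctr Lc)) (n + 1)) (n + 1) μ y ν (translate (Mc B) y' e) + sgnK (trK (WNAG (Roots.ctr Lc) Pn (ANs (Roots.ctr Lc) (ΨL (Roots.ctr Lc)) (n + 1)) (n + 1) μ y ν (translate (Mc B) y' e)))))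 x w a b) + (fun x w a b => ∑' e : Site (3 + 1), 𝒲Δ (n + 1) μ y ν (translate (Mc B) y' e) x w a b))))).submatrix ((fN n) B) (fun b : ↥(pbox (towerTorus Lc (fine Lc (Mc B)) (n + 1))) × Fin (3 + 1) => ((b.1, Sum.inl b.2) : Idx (towerTorus Lc (fine Lc (Mc B)) (n + 1)) (Fib 3))) := fun n μ y ν y' B => by obtain ⟨CvN, CwN, δN, hδN, hVN, hWN⟩ := vertexFamilies_VNA_WNAG (Roots.ctr Lc) Pn (ANs (Roots.ctr Lc) (ΨL (Roots.ctr Lc)) (n + 1)) (n + 1) (hAd n); obtain ⟨CwΔ, δΔ, hδΔ, hWΔv⟩ := hWΔ₂ (n + 1); rw [(hdv n) B μ y, (hdv n) B ν y', mul_smul, mul_smul, submatrix_perF_dper_fibScale_of_inr _ _ _ _ ((hmN n) B), perF_dper_evenWound_add_wound (towerTorus Lc (fine Lc (Mc B)) (n + 1)) (towerTorus_fine_apply (Mc B) n) (fun μ' y' ν' y'' => WN_swapA (Roots.ctr Lc) Pn (ANs (Roots.ctr Lc) (ΨL (Roots.ctr Lc)) (n + 1)) (n + 1) μ' y' ν'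 y'') hWN hδN (hWΔs (n + 1)) hWΔv hδΔ μ y ν y', Matrix.submatrix_add, Pi.add_apply, Pi.add_apply, submatrix_perF_dper_wound_eq_zero_of_inr (towerTorus Lc (fine Lc (Mc B)) (n + 1)) ((fN n) B) ((hmN n) B) (fun b : ↥(pbox (towerTorus Lc (fine Lc (Mc B)) (n + 1))) × Fin (3 + 1) => ((b.1, Sum.inl b.2) : Idx (towerTorus Lc (fine Lc (Mc B)) (n + 1)) (Fib 3))) (hWΔm (n + 1)) μ y ν y', add_zero, ← submatrix_perF_dper_woundEven_of_cBA (R := Roots.ctr Lc) (P := Pn) (P' := (⟨Pn.cM, Pn.cE, fun m => (∏ ℓ ∈ range m, stepScale 3 Lc ℓ) * Pn.cVH m, Pn.cΛ, Pn.cE₂, fun m => (∏ ℓ ∈ range m, stepScale 3 Lc ℓ) * Pn.cB m, Pn.T⟩ : Pins)) (A := ANs (Roots.ctr Lc) (ΨL (Roots.ctr Lc)) (n + 1)) (j := n + 1) (hA := hAd n) (hAσ := hAσ n) (hAt := hAt n) (M := towerTorus Lc (fine Lc (Mc B)) (n + 1)) (towerTorus_fine_apply (Mc B) n) (t := sn n)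 (by rw [hsn n]) ((fN n) B) ((hmN n) B) μ y ν y']; exact hQN2_family_of_lockA (M := Mc B) (n := n) (c := c n) (Pn := (⟨Pn.cM, Pn.cE, fun m => (∏ ℓ ∈ range m, stepScale 3 Lc ℓ) * Pn.cVH m, Pn.cΛ, Pn.cE₂, fun m => (∏ ℓ ∈ range m, stepScale 3 Lc ℓ) * Pn.cB m, Pn.T⟩ : Pins)) (A := ANs (Roots.ctr Lc) (ΨL (Roots.ctr Lc)) (n + 1)) (hA := hAd n) (hAσ := hAσ n) (hAt := hAt n) (fN := (fN n) B) (hfN := (hfN n) B) (hc := (ctrOff_mem_box (d := 3 + 1) (Nat.one_le_iff_ne_zero.mpr (NeZero.ne Lc)))) (hv := (fun v => ((hv n) B) ((sn n) • v))) (hhvl := ((hvl8 n) B)) (lv := (fun v => ((lv n) B) ((sn n) • v))) (hlv := (lin_comp_smul ((lv n) B) ((hlv n) B) (sn n))) (hJW := ((hJW8 n) B)) (𝔔₀ := (𝔔₀ n) B) (h𝔔₀' := (by rw [← (h𝔔₀ n) B, (hQ₂₀ n) B, (hQ₁₀ n) B]; exact nestedRowsSym_eq_compRowsSym (Lc :=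 Lc) (n := n + 1) (M := Mc B) (lev := fun i : ℕ => n + 1 - (i - 1)) (rs := fun _ : ℕ => ctrOff (3 + 1) Lc))) (𝔔₁f := (fun v => ((𝔔₁f n) B) ((sn n) • v))) (h𝔔₁' := (fun v => by rw [← (fun v => (h𝔔₁ n) B ((sn n) • v)) v, (fun v => (hQ₂₁f n) B ((sn n) • v)) v, (hQ₁₀ n) B, (hQ₂₀ n) B, (fun v => (hQ₁₁f n) B ((sn n) • v)) v]; exact nestedQ₁Sym_eq_smul_compIns₁Sym (Lc := Lc) (n := n + 1) (M := Mc B) (lev := fun i : ℕ => n + 1 - (i - 1)) (rs := fun _ : ℕ => ctrOff (3 + 1) Lc) (c := c n) (w := ((fun v => ((hv n) B) ((sn n) • v))) v))) (𝔔₂f := (fun v v' => ((𝔔₂f n) B) ((sn n) • v) ((sn n) • v'))) (h𝔔₂' := (fun v v' => by rw [← (fun v v' => (h𝔔₂ n) B ((sn n) • v) ((sn n) • v')) v v', ← (fun v v' => (h𝔔₂ n) B ((sn n) • v) ((sn n) • v')) v' v, (fun v => (hQ₂₁f n) B ((sn n) • v)) v, (fun v => (hQ₂₁f n) B ((sn n)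 • v)) v', (fun v v' => (hQ₂₂f n) B ((sn n) • v) ((sn n) • v')) v v', (fun v v' => (hQ₂₂f n) B ((sn n) • v) ((sn n) • v')) v' v, (hQ₁₀ n) B, (hQ₂₀ n) B, (fun v => (hQ₁₁f n) B ((sn n) • v)) v, (fun v => (hQ₁₁f n) B ((sn n) • v)) v', (fun v v' => (hQ₁₂f n) B ((sn n) • v) ((sn n) • v')) v v', (fun v v' => (hQ₁₂f n) B ((sn n) • v) ((sn n) • v')) v' v]; exact nestedQ₂Sym_symm_eq_smul_compIns₂₂Sym (Lc := Lc) (n := n + 1) (M := Mc B) (lev := fun i : ℕ => n + 1 - (i - 1)) (rs := fun _ : ℕ => ctrOff (3 + 1) Lc) (hc := (ctrOff_mem_box (d := 3 + 1) (Nat.one_le_iff_ne_zero.mpr (NeZero.ne Lc)))) (c := c n) (Q₂₁ := fun w => ∑ a' : (↥(pbox (fine Lc (Mc B))) × Fin (3 + 1)), (((c n) * (((Lc : ℝ) ^ (3 + 1) * stepScale 3 Lc ((n + 1 - 0))) * (∏ i ∈ range (n + 1), (stepScale 3 Lc ((n + 1 - (i + 1))) * ((box (3 + 1) Lc).card : ℝ)))⁻¹))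 * (compRowsSym Lc (fine Lc (Mc B)) (fun i : ℕ => n + 1 - i) (fun _ : ℕ => ctrOff (3 + 1) Lc) (n + 1) *ᵥ w) a') • (perF (fine Lc (Mc B)) (dper (fine Lc (Mc B)) (symVhSAt (ctr (3 + 1) Lc) 3 Lc rfl a'.2 (a'.1 : Site (3 + 1))))).submatrix (fun k : (↥(pbox (Mc B)) × Fin (3 + 1)) => (((coarsePt (Mc B) Lc k.1, Sum.inr (k.2)) : Idx (fine Lc (Mc B)) (Fib 3)))) (fun b : (↥(pbox (fine Lc (Mc B))) × Fin (3 + 1)) => ((b.1, Sum.inl b.2) : Idx (fine Lc (Mc B)) (Fib 3)))) (hQ₂₁ := fun w => rfl) (Q₂₂ := fun w w' => ((Lc : ℝ) ^ (3 + 1) * stepScale 3 Lc ((n + 1 - 0)))⁻¹ • ∑ b : (↥(pbox (fine Lc (Mc B))) × Fin (3 + 1)), ∑ b' : (↥(pbox (fine Lc (Mc B))) × Fin (3 + 1)), ((((c n) * (((Lc : ℝ) ^ (3 + 1) * stepScale 3 Lc ((n + 1 - 0))) * (∏ i ∈ range (n + 1), (stepScale 3 Lc ((n + 1 - (i + 1)))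 * ((box (3 + 1) Lc).card : ℝ)))⁻¹)) * (compRowsSym Lc (fine Lc (Mc B)) (fun i : ℕ => n + 1 - i) (fun _ : ℕ => ctrOff (3 + 1) Lc) (n + 1) *ᵥ w) b) * (((c n) * (((Lc : ℝ) ^ (3 + 1) * stepScale 3 Lc ((n + 1 - 0))) * (∏ i ∈ range (n + 1), (stepScale 3 Lc ((n + 1 - (i + 1))) * ((box (3 + 1) Lc).card : ℝ)))⁻¹)) * (compRowsSym Lc (fine Lc (Mc B)) (fun i : ℕ => n + 1 - i) (fun _ : ℕ => ctrOff (3 + 1) Lc) (n + 1) *ᵥ w') b')) • (perF (fine Lc (Mc B)) (dper (fine Lc (Mc B)) (fun x z a e => ∑' m : Site (3 + 1), (1 / 2 : ℝ) * (symVh₂SAt (ctr (3 + 1) Lc) Lc b.2 (b.1 : Site (3 + 1)) b'.2 (translate (fine Lc (Mc B)) (b'.1 : Site (3 + 1)) m) x z a e + symVh₂SAt (ctr (3 + 1) Lc) Lc b'.2 (translate (fine Lc (Mc B)) (b'.1 : Site (3 + 1)) m) b.2 (b.1 : Site (3 + 1)) x z a e)))).submatrix (fun k : (↥(pbox (Mc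 B)) × Fin (3 + 1)) => (((coarsePt (Mc B) Lc k.1, Sum.inr (k.2)) : Idx (fine Lc (Mc B)) (Fib 3)))) (fun b : (↥(pbox (fine Lc (Mc B))) × Fin (3 + 1)) => ((b.1, Sum.inl b.2) : Idx (fine Lc (Mc B)) (Fib 3)))) (hQ₂₂ := fun w w' => rfl) (w := ((fun v => ((hv n) B) ((sn n) • v))) v) (w' := ((fun v => ((hv n) B) ((sn n) • v))) v'))) (Xbf := (fun v => ((Xbf n) B) ((sn n) • v))) (hXbf := (fun v => (hXbf n) B ((sn n) • v))) (𝔔'₂f := (fun v v' => ((𝔔'₂f n) B) ((sn n) • v) ((sn n) • v'))) (h𝔔'₂f := (fun v v' => (h𝔔'₂f n) B ((sn n) • v) ((sn n) • v'))) (r := r n) (dv := (fun p : Fin (3 + 1) × (Fin (3 + 1) → ℤ) => (r n) • (Pi.single (wrapPt (Mc B) p.2, p.1) (1 : ℝ) : ((↥(pbox (Mc B)) × Fin (3 + 1)) → ℝ)))) (hdv := (fun μ y => rfl)) (hcB := hcBd n) μ y ν y'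
  refine d1Tel_JcS_nestedG_of_fedW_pairingCoclosed_wStep hLc N cΛ cB (Roots.ctr Lc) (ΨL (Roots.ctr Lc)) (hΨsL (Roots.ctr Lc)) Pn (JcSymLG (Roots.ctr Lc) Pn hLc N cΛ cB) rfl (fun j hj a b z => by rw [TshotOf_JcSymLG_succ (Roots.ctr Lc) Pn hLc N cΛ cB j hj]) AF 𝒱F 𝒲F (fun j => GcombSh (d := 3) Lc j) 𝒱G 𝒲G 𝒲Δ hWΔ₂ ?_ hF₁ htr hG hT0 hT1
    Sd τd lamd cz hcz eu heu hSd hτd hSda hτda hΘ hdiv Rf kf hRA hRc hX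
  intro j hj μ ν z
  obtain ⟨n, rfl⟩ : ∃ n, j = n + 1 := ⟨j - 1, by omega⟩
  -- S-L1's `VNs ∕ WNsG` ARE the row's generic carriers at the L-chart (`rfl`; an2 PROBE 376c66a2)
  rw [show VNs (Roots.ctr Lc) (ΨL (Roots.ctr Lc)) (hΨsL (Roots.ctr Lc)) Pn (n + 1) = VNA (Roots.ctr Lc) Pn (ANs (Roots.ctr Lc) (ΨL (Roots.ctr Lc)) (n + 1)) (n + 1) from rfl,
    show WNsG (Roots.ctr Lc) (ΨL (Roots.ctr Lc)) (hΨsL (Roots.ctr Lc)) Pn (n + 1) = WNAG (Roots.ctr Lc) Pn (ANs (Roots.ctr Lc) (ΨL (Roots.ctr Lc)) (n + 1)) (n + 1) from rfl]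
  obtain ⟨δA, CA, hδA, -, hA⟩ := hAd n
  obtain ⟨CvN, CwN, δN, hδN, hVN, hWN⟩ := vertexFamilies_VNA_WNAG (Roots.ctr Lc) Pn (ANs (Roots.ctr Lc) (ΨL (Roots.ctr Lc)) (n + 1)) (n + 1) (hAd n)
  obtain ⟨CwΔ, δΔ, hδΔ, hWΔv⟩ := hWΔ₂ (n + 1)
  have hCvN0 : 0 ≤ CvN := (hVN 0 0).nonneg (Sum.inl 0)
  have hCwN0 : 0 ≤ CwN := (hWN 0 0 0 0).nonneg (Sum.inl 0)
  have hCΔ0 : 0 ≤ CwΔ := (hWΔv 0 0 0 0).nonneg (Sum.inl 0)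
  have key := hessKer_law_tower_namedC (Lc := Lc) (M' := fun B => fine Lc (Mc B)) (lev := fun i : ℕ => n + 1 - i) (n := n)
      (hM'gr := (fun K => (hMc K).mono fun B hB i => le_trans (hB i) (Nat.le_mul_of_pos_left _ hL0))) (hlev := (fun i hi => by show n + 1 - i = n + 1 - (i + 1) + 1; omega)) (𝒱N := fun μ' y' => scaleK (Sum.elim (fun _ : Fin (3 + 1) => (1 : ℝ)) (fun _ : Fin (3 + 1) => (sn n))) (Sum.elim (fun _ : Fin (3 + 1) => (1 : ℝ)) (fun _ : Fin (3 + 1) => (sn n))) (VNA (Roots.ctr Lc) Pn (ANs (Roots.ctr Lc) (ΨL (Roots.ctr Lc)) (n + 1)) (n + 1) μ' y')) (𝒱F := (𝒱F (n + 1))) (𝒱G := (𝒱G (n + 1))) (𝒲N := fun μ' y' ν' y'' => scaleK (Sum.elim (fun _ : Fin (3 + 1) => (1 : ℝ)) (fun _ : Fin (3 + 1) => (sn n))) (Sum.elim (fun _ : Fin (3 + 1) => (1 : ℝ)) (fun _ : Fin (3 + 1) => (sn n))) ((1 / 2 : ℝ) • (WNAG (Roots.ctr Lc) Pn (ANs (Roots.ctr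 Lc) (ΨL (Roots.ctr Lc)) (n + 1)) (n + 1) μ' y' ν' y'' + sgnK (trK (WNAG (Roots.ctr Lc) Pn (ANs (Roots.ctr Lc) (ΨL (Roots.ctr Lc)) (n + 1)) (n + 1) μ' y' ν' y''))) + 𝒲Δ (n + 1) μ' y' ν' y'')) (𝒲F := (𝒲F (n + 1))) (𝒲G := (𝒲G (n + 1))) (μ := μ) (ν := ν) (z := z)
      (𝒲bN := fun B => scaleK (Sum.elim (fun _ : Fin (3 + 1) => (1 : ℝ)) (fun _ : Fin (3 + 1) => (sn n))) (Sum.elim (fun _ : Fin (3 + 1) => (1 : ℝ)) (fun _ : Fin (3 + 1) => (sn n))) ((fun x w a b => ∑' e : Site (3 + 1), ((1 / 2 : ℝ) • (WNAG (Roots.ctr Lc) Pn (ANs (Roots.ctr Lc) (ΨL (Roots.ctr Lc)) (n + 1)) (n + 1) μ 0 ν (translate (Mc B) z e) + sgnK (trK (WNAG (Roots.ctr Lc) Pn (ANs (Roots.ctr Lc) (ΨL (Roots.ctr Lc)) (n + 1)) (n + 1) μ 0 ν (translate (Mc B) z e))))) x w a b) + (fun x w a b => ∑' e : Site (3 + 1),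 𝒲Δ (n + 1) μ 0 ν (translate (Mc B) z e) x w a b))) (𝒲bF := fun B => (𝒲bF (n + 1)) B μ 0 ν z) (𝒲bG := fun B => (𝒲bG (n + 1)) B μ 0 ν z) (hM' := (fun B i => ⟨Mc B i, rfl⟩)) (κ := (fun B => ↥(pbox (Mc B)) × Fin (3 + 1))) (pμ' := (fun B a => coarsePt (Mc B) Lc a.1)) (mμ' := (fun B a => a.2)) (hfμ' := (fun B => coarseSlot_injective (Mc B))) (hcoarse' := (fun B => coarseSlot_range (Mc B))) (H₀ := H₀ n) (Q₁₀ := Q₁₀ n) (τ₁ := τ₁ n) (hH₀ := hH₀ n) (hQ₁₀ := hQ₁₀ n) (hτ₁ := hτ₁ n) (τ₂ := τ₂ n) (hτ₂ := hτ₂ n) (Q₂₀ := Q₂₀ n) (hQ₂₀ := hQ₂₀ n) (W₀ := W₀ n) (hW₀ := hW₀ n) (P := P n) (hP := hP n) (c := c n) (Dbar := Dbar n) (hDbar := hDbar n) (Γ := Γ n) (I := I n) (L := L n) (S := S n) (hΓ := hΓ n) (hI := hI n) (hL := hL n) (hS := hS n) (𝔔₀ := 𝔔₀ n) (h𝔔₀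 := h𝔔₀ n) (hv := hv n) (hhv := hhv n) (lv := lv n) (hlv := hlv n) (Xbf := Xbf n)
      (hXbf := hXbfl n) (H₁f := H₁f n) (hH₁l := fun B => H1f_linear Lc N (n + 1) (fine Lc (Mc B)) (fun i : ℕ => n + 1 - i) ((cf n) B) (w n) (c n) ((hb n) B) ((hbl n) B) ((H₁f n) B) ((hH₁f n) B)) (Q₁₁f := Q₁₁f n) (hQ₁₁f := hQ₁₁f n) (Q₂₁f := Q₂₁f n) (hQ₂₁f := hQ₂₁f n) (H₂f := H₂f n) (hH₂l := hH₂l n) (hH₂r := hH₂r n) (Q₁₂f := Q₁₂f n) (hQ₁₂f := hQ₁₂f n) (Q₂₂f := Q₂₂f n) (hQ₂₂f := hQ₂₂f n) (𝔔₁f := 𝔔₁f n) (h𝔔₁ := h𝔔₁ n) (𝔔₂f := 𝔔₂f n) (h𝔔₂ := h𝔔₂ n) (H'₁f := H'₁f n) (hH'₁f := hH'₁f n) (H'₂f := H'₂f n) (hH'₂f := hH'₂f n) (𝔔'₁f := 𝔔'₁f n) (h𝔔'₁f := h𝔔'₁f n) (𝔔'₂f := 𝔔'₂f n) (h𝔔'₂f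 := h𝔔'₂f n) (W₁f := W₁f n) (W₂f := W₂f n) (hW₁f := hW₁f n) (hW₂f := hW₂f n) (Db₁f := Db₁f n) (Db₂f := Db₂f n) (hDb₁f := hDb₁f n) (hDb₂f := hDb₂f n) (Y₁f := fun B _ => 0) (Y₂f := Y₂f n) (Gw₁f := Gw₁f n) (hGw₁f := hGw₁f n) (Gw₂f := Gw₂f n) (hGw₂f := hGw₂f n) (hH₁t := fun B v => H1f_transpose Lc N (n + 1) (fine Lc (Mc B)) (fun i : ℕ => n + 1 - i) ((cf n) B) (w n) (c n) ((hb n) B) ((H₁f n) B) ((hH₁f n) B) v)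
      (hH₂t := hH₂t n) (a1 := fun B v => a1_row Lc N hLc2 (ctrOff_mem_box (d := 3 + 1) hL1) (n + 1) (fine Lc (Mc B)) (fun i : ℕ => n + 1 - i) (fun k => towerTorus Lc (Mc B) k) (fun k i => towerTorus_fine_apply_eq (Mc B) k i) ((cf n) B) ((hcf n) B) (w n) (κ n) ((hκ n)) ((hκn n)) ((hb n) B) (toSite rH) (c n) ((K1 n) B) ((hlink n) B) (n + 1 - (n + 1)) (Nat.sub_self _) ((hH₀ n) B) ((hW₀ n) B) ((W₁f n) B) (fun v => by rw [(hW₁f n) B v, ← (hbtop n) B v]) ((H₁f n) B) ((hH₁f n) B) ((𝔔₀ n) B) v) (a2 := a2 n) (σ := (Fin 2)) (dv := (fun B => ![(dv n) B (μ, 0), (dv n) B (ν, z)])) (a₁ := 0) (a₂ := 1) (XN := XN n) (hXN := hXN n) (ρN := ρN n) (LNc := Lc ^ (n + 1 + 1)) (fN := fN n) (hfN := hfNi n) (hmN := hmN n) (hcN := hcN n) (AN := (scaleK (Sum.elim (fun _ : Fin (3 + 1) => (1 : ℝ)) (fun _ : Fin (3 + 1) => (sn n)⁻¹)) (Sum.elim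 (fun _ : Fin (3 + 1) => (1 : ℝ)) (fun _ : Fin (3 + 1) => (sn n)⁻¹)) (ANs (Roots.ctr Lc) (ΨL (Roots.ctr Lc)) (n + 1)))) (hAN := decays_scaleK (fun a => abs_fibSigma_le (hsn1 n) a) (fun a => abs_fibSigma_le (hsn1 n) a) hA) (hαN := hδA) (hANsh := (fun t => by rw [shiftK_scaleK]; congr 1; rw [show (((Lc ^ (n + 2) : ℕ) : ℤ) • t) = -((((Lc ^ (n + 1 + 1) : ℕ) : ℤ)) • (-t)) by rw [smul_neg, neg_neg]]; exact hAt n (-t))) (hEAN := hEAN n) (hAEN := hAEN n) (hLN := hLN n)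
         (hVN := biLoc_scaleK (fun a => abs_fibSigma'_le (hsn1 n) a) (fun a => abs_fibSigma'_le (hsn1 n) a) (biLoc_mono (hVN μ 0) hCvN0 (min_le_left δN δΔ))) (hVN' := biLoc_scaleK (fun a => abs_fibSigma'_le (hsn1 n) a) (fun a => abs_fibSigma'_le (hsn1 n) a) (biLoc_mono (hVN ν z) hCvN0 (min_le_left δN δΔ))) (hWN := biLoc_scaleK (fun a => abs_fibSigma'_le (hsn1 n) a) (fun a => abs_fibSigma'_le (hsn1 n) a) (biLoc_add (biLoc_mono (vertexFamily₂_evenHalf_of_swap (fun μ' y' ν' y'' => WN_swapA (Roots.ctr Lc) Pn (ANs (Roots.ctr Lc) (ΨL (Roots.ctr Lc)) (n + 1)) (n + 1) μ' y' ν' y'') hWN μ 0 ν z) hCwN0 (min_le_left δN δΔ)) (biLoc_mono (hWΔv μ 0 ν z) hCΔ0 (min_le_right δN δΔ)))) (hδN := lt_min hδN hδΔ)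
      (hVNm := fun B a a' => by rw [perF_dper_scaleK_apply, perF_dper_VNA_apply_of_inr_inr (Roots.ctr Lc) Pn (ANs (Roots.ctr Lc) (ΨL (Roots.ctr Lc)) (n + 1)) (n + 1) (hAd n) (towerTorus Lc (fine Lc (Mc B)) (n + 1)) ((fN n) B) ((hmN n) B) μ 0 a a', mul_zero, zero_mul]) (hVNt := fun B b a => by rw [perF_dper_scaleK_apply, perF_dper_scaleK_apply, perF_dper_VNA_inl_apply_of_inr (Roots.ctr Lc) Pn (ANs (Roots.ctr Lc) (ΨL (Roots.ctr Lc)) (n + 1)) (n + 1) (hAd n) (towerTorus Lc (fine Lc (Mc B)) (n + 1)) ((fN n) B) ((hmN n) B) μ 0 b a]; ring) (hVN'm := fun B a a' => by rw [perF_dper_scaleK_apply, perF_dper_VNA_apply_of_inr_inr (Roots.ctr Lc) Pn (ANs (Roots.ctr Lc) (ΨL (Roots.ctr Lc)) (n + 1)) (n + 1) (hAd n) (towerTorus Lc (fine Lc (Mc B)) (n + 1)) ((fN n) B) ((hmN n) B) ν z a a', mul_zero, zero_mul]) (hVN't := fun B b a => by rw [perF_dper_scaleK_apply, perF_dper_scaleK_apply,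 perF_dper_VNA_inl_apply_of_inr (Roots.ctr Lc) Pn (ANs (Roots.ctr Lc) (ΨL (Roots.ctr Lc)) (n + 1)) (n + 1) (hAd n) (towerTorus Lc (fine Lc (Mc B)) (n + 1)) ((fN n) B) ((hmN n) B) ν z b a]; ring) (hWNw := by simpa only [trace_perF_scaleK_mul_perF_dper_scaleK _ (hσσ n)] using winding_evenWound_add_wound (A := ANs (Roots.ctr Lc) (ΨL (Roots.ctr Lc)) (n + 1)) (fun B => towerTorus Lc (fine Lc (Mc B)) (n + 1)) Mc (fun K => (hMc K).mono fun B hB i => le_trans (hB i) (by rw [towerTorus_fine_apply]; exact Nat.le_mul_of_pos_left _ (pow_pos hL0 _))) hMc (fun B i => towerTorus_fine_apply (Mc B) n i) hA hδA (fun k m x y a b => translate_inv_A' (A := ANs (Roots.ctr Lc) (ΨL (Roots.ctr Lc)) (n + 1)) (j := n + 1) (hAt := hAt n) (M := towerTorus Lc (fine Lc (Mc k)) (n + 1)) (towerTorus_fine_apply (Mc k) n) m x y a b) (fun μ' y' ν' y'' => WN_swapA (Roots.ctr Lc) Pn (ANs (Roots.ctr Lc) (ΨL (Roots.ctr Lc))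 (n + 1)) (n + 1) μ' y' ν' y'') hWN hδN (hWΔs (n + 1)) hWΔv hδΔ μ 0 ν z) (hWNm := fun B a a' => by rw [perF_dper_scaleK_apply, perF_dper_evenWound_add_wound (towerTorus Lc (fine Lc (Mc B)) (n + 1)) (towerTorus_fine_apply (Mc B) n) (fun μ' y' ν' y'' => WN_swapA (Roots.ctr Lc) Pn (ANs (Roots.ctr Lc) (ΨL (Roots.ctr Lc)) (n + 1)) (n + 1) μ' y' ν' y'') hWN hδN (hWΔs (n + 1)) hWΔv hδΔ μ 0 ν z, Matrix.add_apply, hWNm_rows_woundA Mc Pn (ANs (Roots.ctr Lc) (ΨL (Roots.ctr Lc))) fN hmN n μ 0 ν z B a a', perF_dper_wound_eq_zero_of_inr_left (towerTorus Lc (fine Lc (Mc B)) (n + 1)) (hWΔm (n + 1)) μ 0 ν z _ _ ((hmN n) B a), add_zero, mul_zero, zero_mul]) (hWNt := fun B b a => by rw [perF_dper_scaleK_apply, perF_dper_scaleK_apply, perF_dper_evenWound_add_wound (towerTorus Lc (fine Lc (Mc B)) (n + 1)) (towerTorus_fine_apply (Mc B) n) (fun μ' y' ν' y'' => WN_swapA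 (Roots.ctr Lc) Pn (ANs (Roots.ctr Lc) (ΨL (Roots.ctr Lc)) (n + 1)) (n + 1) μ' y' ν' y'') hWN hδN (hWΔs (n + 1)) hWΔv hδΔ μ 0 ν z, Matrix.add_apply, Matrix.add_apply, hWNt_rows_woundA Mc Pn (ANs (Roots.ctr Lc) (ΨL (Roots.ctr Lc))) fN hmN n μ 0 ν z B b a, perF_dper_wound_eq_zero_of_inr_right (towerTorus Lc (fine Lc (Mc B)) (n + 1)) (hWΔm' (n + 1)) μ 0 ν z _ _ ((hmN n) B a), perF_dper_wound_eq_zero_of_inr_left (towerTorus Lc (fine Lc (Mc B)) (n + 1)) (hWΔm (n + 1)) μ 0 ν z _ _ ((hmN n) B a)]; ring)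
      (hHN₁ := (hHN₁ n μ 0)) (hQN₁ := (hQN₁ n μ 0)) (hHN₁' := (hHN₁ n ν z)) (hQN₁' := (hQN₁ n ν z)) (hHN₂ := (hHN₂ n μ 0 ν z)) (hQN₂ := (hQN₂ n μ 0 ν z)) (XF := XF n) (hXF := hXF n) (ρF := ρF n) (LFc := LFc n) (fF := fF n) (hfF := hfF n) (hmF := hmF n) (hcF := hcF n) (AF := (AF (n + 1))) (CAF := CAF n) (αF := αF n) (hAF := hAF n) (hαF := hαF n) (hAFsh := hAFsh n) (hEAF := hEAF n) (hAEF := hAEF n) (hLF := hLF n) (pF := ((((NF n : ℕ) : ℤ)) • (0 : Fin (3 + 1) → ℤ))) (pF' := ((((NF n : ℕ) : ℤ)) • (0 : Fin (3 + 1) → ℤ))) (qF := ((((NF n : ℕ) : ℤ)) • z)) (qF' := ((((NF n : ℕ) : ℤ)) • z)) (CvF := (CvF n)) (CvF' := (CvF n)) (CwF := (CwF n)) (δF := (δF n)) (hVF := (hVF n μ 0)) (hVF' := (hVF n ν z)) (hWF := (hWF n μ 0 ν z)) (hδF := (hδF n)) (hWFw := (hWFw n μ ν z)) (hVFm := (hVFm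 n μ 0)) (hVFt := (hVFt n μ 0)) (hVF'm := (hVFm n ν z)) (hVF't := (hVFt n ν z)) (hWFm := (hWFm n μ 0 ν z)) (hWFt := (hWFt n μ 0 ν z)) (hHF₁ := (hHF₁ n μ 0)) (hQF₁ := (hQF₁ n μ 0)) (hHF₁' := (hHF₁ n ν z)) (hQF₁' := (hQF₁ n ν z)) (hHF₂ := (hHF₂ n μ 0 ν z)) (hQF₂ := (hQF₂ n μ 0 ν z)) (pG := ((((NG n : ℕ) : ℤ)) • (0 : Fin (3 + 1) → ℤ))) (pG' := ((((NG n : ℕ) : ℤ)) • (0 : Fin (3 + 1) → ℤ))) (qG := ((((NG n : ℕ) : ℤ)) • z)) (qG' := ((((NG n : ℕ) : ℤ)) • z)) (CvG := (CvG n))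
      (CvG' := (CvG n)) (CwG := (CwG n)) (δG := (δG n)) (hVG := (hVG n μ 0)) (hVG' := (hVG n ν z)) (hWG := (hWG n μ 0 ν z)) (hδG := (hδG n)) (hWGw := (hWGw n μ ν z)) (hVGm := (hVGm n μ 0)) (hVGt := (hVGt n μ 0)) (hVG'm := (hVGm n ν z)) (hVG't := (hVGt n ν z)) (hWGm := (hWGm n μ 0 ν z)) (hWGt := (hWGt n μ 0 ν z)) (hHG₁ := (hHG₁ n μ 0)) (hQG₁ := (hQG₁ n μ 0)) (hHG₁' := (hHG₁ n ν z)) (hQG₁' := (hQG₁ n ν z)) (hHG₂ := (hHG₂ n μ 0 ν z)) (hQG₂ := (hQG₂ n μ 0 ν z))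
  rw [hessKer_scaleK (Sum.elim (fun _ : Fin (3 + 1) => (1 : ℝ)) (fun _ : Fin (3 + 1) => (sn n)⁻¹)) (Sum.elim (fun _ : Fin (3 + 1) => (1 : ℝ)) (fun _ : Fin (3 + 1) => (sn n))) (hσσ n), hessKer_evenHalf_add_apply (W := WNAG (Roots.ctr Lc) Pn (ANs (Roots.ctr Lc) (ΨL (Roots.ctr Lc)) (n + 1)) (n + 1)) (D := 𝒲Δ (n + 1)) (spr_ANs (Roots.ctr Lc) (ΨL (Roots.ctr Lc)) (hΨsL (Roots.ctr Lc)) (n + 1)) (hAσ n) _ μ ν z (loc_of_biLoc (hWN μ 0 ν z) hδN) (loc_of_biLoc (hWΔv μ 0 ν z) hδΔ)] at key; exact key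


end Summit.QuantumFields.BalabanUV.Beta.FP.StepRecursionSymEndNamedG
end
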